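/-
Copyright (c) 2026. All rights reserved.
Released under Apache 2.0 license as described in the file LICENSE.
-/
import Literature.NumberTheory.ComplexMultiplication.DegenerateCMTypesElementaryAbelianOrderThirtyTwoStabilizers
import Literature.NumberTheory.ComplexMultiplication.DegenerateCMTypesAbelianSurvivorClosure
import Literature.NumberTheory.ComplexMultiplication.CMTypeBalancedSubgroupCosets
import HarnessLib

/-!
# CM types of rank `11` on `(ℤ/2)⁵`: the Weil characters form an affine hyperplane minus two points, and there are
# exactly THREE balanced subgroups of index `8` — three Weil CM subfields of degree `8`

SETTING (tree `CMTypeBalancedSubgroupCosets`, `DegenerateCMTypesElementaryAbelianOrderThirtyTwo{,Stabilizers}`,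
`DegenerateCMTypesElementaryAbelianTitsworth`, `DegenerateCMTypesAbelianSurvivorClosure`).  `G` a finite commutative
group of exponent `2` of order `32` — the Galois group of a multiquadratic CM field `K` of degree `32` — `ρ ∈ G`
(complex conjugation), `T ⊆ G` a CM type (`IsCMTypeWith ρ T`, `|T| = 16`), `χ : AddChar (Additive G) ℂ` the
(`±1`-valued) characters, ODD when `χ(ρ) = −1` (`16` of them), `a_χ = #{t ∈ T : χ(t) = −1}`,
`Ŝ(χ) = Σ_{t∈T} χ(t) = 16 − 2a_χ`, and Kubota's RANK `rank(T) = 1 + #{χ odd : Ŝ(χ) ≠ 0}` ([Kubota1965] §4 Lemma 2,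
[Gordon1999HodgeAVSurvey] 9.4.1; the rank of the Hodge/Mumford–Tate group of the abelian `16`-folds of type
`(K, T)`).  The tree knows (Kubota–Dodson, `profile_of_card_thirtytwo`, `typeRank_mem_of_card_thirtytwo`,
`OrderThirtyTwoStabilizers`): the ranks in order `32` are `2, 5, 9, 11, 17`, the PRIMITIVE DEGENERATE types are
exactly those of rank `11`, and Titsworth's relation `Σ_{χ odd} Ŝ(χ)Ŝ(χψ) = 0` for even `ψ ≠ 1` ([Carlet2020] §2.3
(2.51)).  A subgroup `H ≤ G` has BALANCED COSETS when `2·#(T ∩ xH) = |H|` for every `x` — by the tree's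
`BalancedCosets.forall_coset_iff_forall_oddChar` iff every odd character trivial on `H` is a WEIL CHARACTER
(`Ŝ(χ) = 0`); on the field side (B. Moonen, Yu. Zarhin [MoonenZarhin1998WeilClasses] Criterion (Q1): «`W_F`
consists of Hodge classes if and only if … `n_σ = n_σ̄` for all `σ`») this says that `T` is of WEIL TYPE over the
subfield `L = K^H` (degree `[G:H]`), whose space of Weil classes (of codimension `|H|/2` on the `16`-folds of the
type) then consists of Hodge classes, exceptional when `L` is a CM field.  THIS FILE determines the Weil characters
and the balanced subgroups of index `8` of EVERY rank-`11` type: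

> **Theorem** (`card_classes_of_typeRank_eq_eleven`).  In rank `11` exactly two odd characters `a, b` have
> `Ŝ = ±8`, eight have `Ŝ = ±4`, six have `Ŝ = 0` (the Weil characters).
> **Theorem** (`mul_mul_eq_of_typeRank_eq_eleven`, the pairing; `sum_restricted_eq_zero`;
> `forall_add_mem_four_of_exists`, the dichotomy).  With `e = ab`: `Ŝ(a)Ŝ(b)Ŝ(χ)Ŝ(χe) = −2¹⁰` for every `χ` with
> `Ŝ(χ) = ±4`; for even `ψ ∉ {1, e}` the Titsworth sum restricted to pairs of `±4`-characters vanishes; and an even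
> translate of the set `P` of `±4`-characters is `P` or disjoint from `P`.
> **Theorem** (`add_add_mem_four`, `add_add_not_mem_four`, `exists_forall_four_iff_apply_eq` — THE STRUCTURE
> THEOREM).  **`P` is closed under triple products, and so is its complement: the six Weil characters together with
> `a, b` form an AFFINE HYPERPLANE of the odd characters**; equivalently there is `g₀ ∉ {1, ρ}` with
> `Ŝ(χ) = ±4 ⟺ χ(g₀) = −1` for odd `χ`.
> **Theorem** (`forall_coset_iff_of_index_eight`, `ncard_indexEight_balanced_eq_three`).  A subgroup `H ∌ ρ` of
> index `8` has balanced cosets iff `g₀ ∈ H` and `a, b` are non-trivial on `H`; **there are EXACTLY THREE such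
> subgroups.**
> **Theorem** (`exists_eq_coset_of_balanced_four`, `setOf_balanced_four_eq`, §8).  Conversely **every
> conjugation-free `T`-balanced `4`-set `D` (`ρD ∩ D = ∅`, `2·#(xD ∩ T) = 4` for all `x`) is a coset of one of
> these three subgroups** (`F·Ŝ = 0` and Parseval force three Weil characters to be constant on `D`): the
> conjugation-free balanced `4`-sets are exactly their `24` cosets — on the field side the exceptional Pohlmann sets
> of degree `2` are exactly the `24` Weil lines, `dim B² − dim D² = 24`.
> **Theorem** (`indicator_sub_eq_of_balanced`, `mul_mem_of_balanced_free`, `four_dvd_card_of_balanced_free`, §9).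
> For EVERY `T`-balanced `D`: `𝟙_D(x) − 𝟙_D(ρx)` is `g₀`-invariant; a conjugation-free balanced `D` is `g₀`-STABLE
> and has **`|D| ≡ 0 (mod 4)`** — no conjugation-free balanced sets of sizes `2, 6, 10, 14` (field side: in odd
> codimension every exceptional Pohlmann set contains a conjugate pair; `dim B³ − dim D³ = 288` exactly, sequel).
> **Theorem** (`exists_coset_subset_of_balanced_free`, `exists_cosets_of_balanced_free`, §10 — THE CLASSIFICATION).
> **Every conjugation-free balanced set is a DISJOINT UNION OF COSETS of the three balanced index-`8` subgroups**
> (a `D` balanced and `ρ`-free is `g₀`-stable with matched `(a, b)`-sign classes; `x, g₀x, y, g₀y` with `y` in the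
> class opposite to `x` is a coset of `{1, g₀, xy, g₀xy}`, balanced by §7; remove and recurse) — on the field side
> Pohlmann's basis of `B^•(A) ⊗ ℂ` for these `16`-folds consists of products of divisor monomials with the `24` Weil
> monomials of codimension `2`.
> **Theorem** (`balanced_iff_of_free`, §11 — THE EFFECTIVE TEST).  A conjugation-free `D` is balanced iff `g₀D = D`
> and `Σ_D a = Σ_D b = 0` (`a, b` the two characters with `Ŝ_T = ∓8`): three linear conditions.
> **Theorem** (`four_le_natCard_of_balanced`, `index_le_eight_of_balanced`, §12).  A balanced `H ∌ ρ` has `|H| ≥ 4`,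
> index `≤ 8`: NO Weil subgroups of index `16` or `32` (field side: the Weil CM subfields of these fields have degree
> `2`, `4` or `8` — `6 + 15 + 3 = 24` of them, sequel).
> With the tree's counts (`6` balanced hyperplanes avoiding `ρ`, `15 = C(6,2)` balanced subgroups of
> index `4`): a primitive degenerate CM type of a multiquadratic CM field of degree `32` is of Weil type over exactly
> `6` imaginary quadratic, `15` biquadratic and `3` CM subfields of degree `8` (sequel
> `Pohlmann1968/MultiquadraticCMFieldWeilSubfieldsDegreeEight`: `24` exceptional Weil–Hodge classes of codimension `2`
> on every simple degenerate `16`-fold with complex multiplication by such a field).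

* §0 helpers (`Ŝ = 16 − 2a_χ`, `sum_char_eq_zero_iff_card_eq_eight`).
* §1 `card_classes_of_typeRank_eq_eleven`, `card_filter_mem_of_typeRank_eq_eleven` (the profile `(2, 8, 6)`).
* §2 `sum_odd_sub_mul_sub_eq_zero` (Titsworth in integers), **`mul_mul_eq_of_typeRank_eq_eleven`** (pairing along
  `e = ab`), `add_mem_four_of_typeRank_eq_eleven`, `add_mem_weil_of_typeRank_eq_eleven` (`P` and the Weil characters
  are `e`-stable).
* §3 **`sum_restricted_eq_zero`** (`R(ψ) = 0`).
* §4 **`forall_add_mem_four_of_exists`** (the dichotomy `Pψ = P` or `Pψ ∩ P = ∅`).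
* §5 **`add_add_mem_four`**, `exists_add_eq_of_forall_not_mem`, `forall_add_mem_or_forall_not`,
  **`add_add_not_mem_four`** (both flats).
* §6 **`exists_forall_four_iff_apply_eq`** (the element `g₀`, by Pontryagin duality for the stabiliser of `P`).
* §7 **`forall_coset_iff_of_index_eight`**, **`ncard_indexEight_balanced_eq_three`**.
* §8 (append) `setSum_mul_typeSum_eq_zero_of_balanced` (`F(χ)Ŝ(χ) = 0` for a balanced set), `sum_sq_setSum_mul_apply_eq_card`
  (Parseval with a twist), **`exists_eq_coset_of_balanced_four`**, `coset_balanced_four`, **`setOf_balanced_four_eq`**.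
* §9 (append) **`indicator_sub_eq_of_balanced`** (Fourier inversion, tree `card_mul_indicator_eq_sum`),
  **`mul_mem_of_balanced_free`**, **`four_dvd_card_of_balanced_free`**, `card_ne_six_of_balanced_free`.
* §10 (append) **`exists_coset_subset_of_balanced_free`**, **`exists_cosets_of_balanced_free`** (the classification).
* §11 (append) **`balanced_iff_of_free`** (the effective test).
* §12 (append) **`four_le_natCard_of_balanced`**, `index_le_eight_of_balanced` (no Weil subgroups of index `16`, `32`).

HONEST SCOPE.  Order `32` and rank `11` only.  The sources print the rank formula and the rank profile machinery
(Kubota, Dodson), the Titsworth/Walsh relation (Carlet (2.51)), the Weil-class criterion (Moonen–Zarhin (Q1)) and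
finite-abelian duality (Brzeziński), Pohlmann's balancedness condition (Pohlmann, Gordon (9.2.1)); the hyperplane
structure of the Weil characters in rank `11`, the count of three balanced index-`8` subgroups, the classification
of the balanced `4`-sets, the divisibility `4 ∣ |D|` and the classification of all balanced conjugation-free sets are
DERIVED here from these (a finite Fourier argument), not numbered statements
of the sources — they agree with a direct enumeration of all `26 880` rank-`11` types on `(ℤ/2)⁵` (one affine class,
that of `x₁x₂x₃ + x₁x₄`; seat computation, not used in the proofs).  THEOREMS ONLY: no definition, no named fact,
no instance, no `sorry`.

## References

* [Kubota1965] T. Kubota, *On the field extension by complex multiplication*, Trans. AMS 118 (1965), §4 Lemma 2.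
* [Dodson1984] B. Dodson, *The structure of Galois groups of CM-fields*, Trans. AMS 283 (1984), §3.1.1 Theorem.
* [Carlet2020] C. Carlet, *Boolean Functions for Cryptography and Coding Theory*, CUP (2020), §2.3 (2.51) (p. 61).
* [MoonenZarhin1998WeilClasses] B. J. J. Moonen, Yu. G. Zarhin, *Weil classes on abelian varieties*, J. reine
  angew. Math. 496 (1998), Criterion (Q1) (p. 2 of arXiv:alg-geom/9612017), Remark (1).
* [Gordon1999HodgeAVSurvey] B. B. Gordon, *A survey of the Hodge conjecture for abelian varieties*, 9.4.1, 9.4.3.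
* [Brzezinski2018] J. Brzeziński, *Galois Theory Through Exercises*, Appendix Thm. A.12.1, Lemma A.12.2.
* [MontgomeryVaughan2007] H. L. Montgomery, R. C. Vaughan, *Multiplicative Number Theory I*, §4.2 Lemma 4.2.
* [Pohlmann1968] H. Pohlmann, *Algebraic cycles on abelian varieties of complex multiplication type*, Ann. of Math.
  88 (1968), Thm. 1 (the balancedness condition).

## Provenance

Lane `lit-hodgefound` (Track 2, Layer A3), seat `lit-hodgefound-p10` generation 46, rows g46-#5 (§0–§7), g46-#7 (§8),
g46-#9 (§9), g46-#11 (§10), g46-#14 (§11), g46-#15 (§12); neighbours cited by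
name, nothing restated: `BalancedCosets` (`forall_coset_iff_forall_oddChar`, `exists_eq_inf_of_index_eq_four`, USED),
`CyclicCMType.ExponentTwo` (`profile_of_card_thirtytwo`, `forall_even_of_typeRank_ne_of_card_thirtytwo`,
`sum_odd_sum_char_mul_sum_char_add_eq_zero`, `add_self_eq_zero_char`, `two_mul_card_odd_eq`, `card_mul_indicator_eq_sum`,
`sum_char_eq_zero_of_even`, USED),
`CyclicCMType.AbelianStabilizer` (`card_filter_mem_mul_card_annihilator_eq`, USED), `CyclicCMType.AbelianKernels`
(`exists_oddChar_ker`, USED), Mathlib `AddChar.forall_apply_eq_zero`.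
-/

open scoped BigOperators Classical

namespace Literature.NumberTheory.ComplexMultiplication

namespace BalancedCosetsThirtyTwo

open Literature.NumberTheory.ComplexMultiplication.CyclicCMType.ExponentTwo (add_self_eq_zero_char
  sum_odd_sum_char_mul_sum_char_add_eq_zero profile_of_card_thirtytwo forall_even_of_typeRank_ne_of_card_thirtytwo
  two_mul_card_odd_eq four_mul_card_filter_and_eq card_mul_indicator_eq_sum sum_char_eq_zero_of_even)
open Literature.NumberTheory.ComplexMultiplication.CyclicCMType.AbelianKernels (exists_oddChar_ker
  sum_char_eq_zero_iff_of_index_two)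
open Literature.NumberTheory.ComplexMultiplication.CyclicCMType.AbelianStabilizer
  (card_filter_mem_mul_card_annihilator_eq)

variable {G : Type*} [CommGroup G] [Fintype G] [DecidableEq G] {ρ : G} {T : Finset G}

/-! ## §0 Helpers: exponent `2`, `±1`-valued characters, `Ŝ(χ) = 16 − 2a_χ` -/

section Helpers

omit [Fintype G] [DecidableEq G] in
/-- `g·g = 1` in exponent `2`. [folklore] -/
private theorem mul_self_w (hexp : ∀ g : G, g ^ 2 = 1) (g : G) : g * g = 1 := by
  rw [← pow_two]; exact hexp g

omit [Fintype G] [DecidableEq G] in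
/-- `χ(g) = ±1` in exponent `2`. [folklore] -/
private theorem char_eq_one_or_w (hexp : ∀ g : G, g ^ 2 = 1) (χ : AddChar (Additive G) ℂ) (g : G) :
    χ (Additive.ofMul g) = 1 ∨ χ (Additive.ofMul g) = -1 :=
  character_apply_eq_one_or_of_mul_self χ (mul_self_w hexp g)

omit [Fintype G] [DecidableEq G] in
/-- `χ(gh) = χ(g)χ(h)`. [folklore] -/
private theorem char_mul_w (χ : AddChar (Additive G) ℂ) (g h : G) :
    χ (Additive.ofMul (g * h)) = χ (Additive.ofMul g) * χ (Additive.ofMul h) := by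
  rw [ofMul_mul, AddChar.map_add_eq_mul]

omit [Fintype G] [DecidableEq G] in
/-- `χ(1) = 1`. [folklore] -/
private theorem char_one_w (χ : AddChar (Additive G) ℂ) : χ (Additive.ofMul (1 : G)) = 1 := by
  rw [ofMul_one, AddChar.map_zero_eq_one]

omit [Fintype G] [DecidableEq G] in
/-- `χ + (χ + ψ) = ψ` in the character group of a group of exponent `2`. [folklore] -/
private theorem add_add_cancel_left_w (hexp : ∀ g : G, g ^ 2 = 1) (χ ψ : AddChar (Additive G) ℂ) :
    χ + (χ + ψ) = ψ := by
  rw [← add_assoc, add_self_eq_zero_char hexp, zero_add]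

omit [Fintype G] [DecidableEq G] in
/-- `(χ + ψ) + ψ = χ` in exponent `2`. [folklore] -/
private theorem add_add_cancel_right_w (hexp : ∀ g : G, g ^ 2 = 1) (χ ψ : AddChar (Additive G) ℂ) :
    χ + ψ + ψ = χ := by
  rw [add_assoc, add_self_eq_zero_char hexp, add_zero]

omit [Fintype G] [DecidableEq G] in
/-- `χ + ψ = 0 ⟺ χ = ψ` in exponent `2`. [folklore] -/
private theorem add_eq_zero_iff_w (hexp : ∀ g : G, g ^ 2 = 1) (χ ψ : AddChar (Additive G) ℂ) :
    χ + ψ = 0 ↔ χ = ψ := by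
  constructor
  · intro h0
    have := add_add_cancel_right_w hexp χ ψ
    rw [h0, zero_add] at this
    exact this.symm
  · rintro rfl; exact add_self_eq_zero_char hexp χ

omit [Fintype G] [DecidableEq G] in
/-- `χ + ψ = χ ⟺ ψ = 0`. [folklore] -/
private theorem add_eq_left_iff_w (χ ψ : AddChar (Additive G) ℂ) : χ + ψ = χ ↔ ψ = 0 := by
  constructor
  · intro h0
    have := congrArg (fun φ => -χ + φ) h0
    simpa using this
  · rintro rfl; exact add_zero χ

omit [Fintype G] [DecidableEq G] in
/-- `ρ² = 1`. [folklore] -/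
private theorem rho_mul_rho_w (h : IsCMTypeWith ρ (T : Set G)) : ρ * ρ = 1 := by
  have := h.invol (1 : G)
  simpa [smul_eq_mul] using this

omit [Fintype G] [DecidableEq G] in
/-- `ρ ≠ 1`. [folklore] -/
private theorem rho_ne_one_w (h : IsCMTypeWith ρ (T : Set G)) : ρ ≠ 1 := by
  intro hρ
  have := h.rho_smul_mem_iff (1 : G)
  simp only [hρ, smul_eq_mul, one_mul] at this
  exact iff_not_self this

omit [Fintype G] [DecidableEq G] in
/-- `ρx ∈ T ⟺ x ∉ T`. [folklore] -/
private theorem rho_mul_mem_iff_w (h : IsCMTypeWith ρ (T : Set G)) (x : G) : ρ * x ∈ T ↔ x ∉ T := by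
  have := h.rho_smul_mem_iff x
  simpa only [smul_eq_mul, Finset.mem_coe] using this

/-- `|T| = 16` in order `32`. [folklore] -/
private theorem card_T_w (h : IsCMTypeWith ρ (T : Set G)) (h32 : Fintype.card G = 32) : T.card = 16 := by
  have hinj : Function.Injective fun s : G => ρ * s := fun a b hab => mul_left_cancel hab
  have hc : Tᶜ = T.image fun s => ρ * s := by
    ext x
    rw [Finset.mem_compl, Finset.mem_image]
    constructor
    · intro hx
      refine ⟨ρ * x, (rho_mul_mem_iff_w h x).2 hx, ?_⟩
      rw [← mul_assoc, rho_mul_rho_w h, one_mul]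
    · rintro ⟨s, hs, rfl⟩
      exact fun hx => ((rho_mul_mem_iff_w h s).1 hx) hs
  have h1 : Tᶜ.card = T.card := by rw [hc, Finset.card_image_of_injective _ hinj]
  have h2 := Finset.card_add_card_compl T
  rw [h32] at h2
  omega

omit [Fintype G] [DecidableEq G] in
/-- **`Ŝ(χ) = |T| − 2a_χ(T)`** (`χ = ±1` on `G`). [cite: Kubota1965, §4 Lemma 2 (proof)] -/
private theorem sum_char_eq_w (hexp : ∀ g : G, g ^ 2 = 1) (χ : AddChar (Additive G) ℂ) (S : Finset G) :
    ∑ t ∈ S, χ (Additive.ofMul t) =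
      (S.card : ℂ) - 2 * ((S.filter fun t => χ (Additive.ofMul t) = -1).card : ℂ) := by
  have hsplit := Finset.sum_filter_add_sum_filter_not S (fun t => χ (Additive.ofMul t) = -1)
    (fun t => χ (Additive.ofMul t))
  have h1 : ∑ t ∈ S.filter (fun t => χ (Additive.ofMul t) = -1), χ (Additive.ofMul t) =
      -((S.filter fun t => χ (Additive.ofMul t) = -1).card : ℂ) := by
    rw [Finset.sum_congr rfl fun t ht => (Finset.mem_filter.1 ht).2, Finset.sum_const, nsmul_eq_mul, mul_neg_one]
  have h2 : ∑ t ∈ S.filter (fun t => ¬ χ (Additive.ofMul t) = -1), χ (Additive.ofMul t) =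
      ((S.filter fun t => ¬ χ (Additive.ofMul t) = -1).card : ℂ) := by
    rw [Finset.sum_congr rfl fun t ht => ((char_eq_one_or_w hexp χ t).resolve_right (Finset.mem_filter.1 ht).2),
      Finset.sum_const, nsmul_eq_mul, mul_one]
  have h3 := Finset.card_filter_add_card_filter_not (s := S) (fun t => χ (Additive.ofMul t) = -1)
  rw [← hsplit, h1, h2]
  have : ((S.filter fun t => ¬ χ (Additive.ofMul t) = -1).card : ℂ) =
      (S.card : ℂ) - ((S.filter fun t => χ (Additive.ofMul t) = -1).card : ℂ) := by
    rw [← h3]; push_cast; ring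
  rw [this]; ring

/-- `Ŝ(χ) = 2·(8 − a_χ)` in order `32`, as an integer cast. [cite: Kubota1965, §4 Lemma 2 (proof)] -/
private theorem sum_char_eq_two_mul_w (hexp : ∀ g : G, g ^ 2 = 1) (h : IsCMTypeWith ρ (T : Set G))
    (h32 : Fintype.card G = 32) (χ : AddChar (Additive G) ℂ) :
    ∑ t ∈ T, χ (Additive.ofMul t) =
      2 * (((8 : ℤ) - ((T.filter fun t => χ (Additive.ofMul t) = -1).card : ℤ) : ℤ) : ℂ) := by
  rw [sum_char_eq_w hexp χ T, card_T_w h h32]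
  push_cast; ring

/-- `Ŝ(χ) = 0 ⟺ a_χ = 8` in order `32`. [cite: Kubota1965, §4 Lemma 2] -/
theorem sum_char_eq_zero_iff_card_eq_eight (hexp : ∀ g : G, g ^ 2 = 1) (h : IsCMTypeWith ρ (T : Set G))
    (h32 : Fintype.card G = 32) (χ : AddChar (Additive G) ℂ) :
    ∑ t ∈ T, χ (Additive.ofMul t) = 0 ↔ (T.filter fun t => χ (Additive.ofMul t) = -1).card = 8 := by
  rw [sum_char_eq_two_mul_w hexp h h32 χ]
  constructor
  · intro h0
    have h1 : (((8 : ℤ) - ((T.filter fun t => χ (Additive.ofMul t) = -1).card : ℤ) : ℤ) : ℂ) = 0 := by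
      simpa using h0
    have h2 : (8 : ℤ) - ((T.filter fun t => χ (Additive.ofMul t) = -1).card : ℤ) = 0 := by exact_mod_cast h1
    omega
  · intro h8
    rw [h8]; push_cast; ring

omit [DecidableEq G] in
/-- The `16` odd characters. [folklore] -/
private theorem card_odd_w (h : IsCMTypeWith ρ (T : Set G)) (h32 : Fintype.card G = 32) :
    (Finset.univ.filter fun χ : AddChar (Additive G) ℂ => χ (Additive.ofMul ρ) = -1).card = 16 := by
  have := two_mul_card_odd_eq (T := T) h
  rw [h32] at this
  omega

omit [Fintype G] [DecidableEq G] in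
/-- Odd plus odd is even, at `ρ`. [folklore] -/
private theorem add_apply_rho_of_odd_w {χ ψ : AddChar (Additive G) ℂ} (hχ : χ (Additive.ofMul ρ) = -1)
    (hψ : ψ (Additive.ofMul ρ) = -1) : (χ + ψ) (Additive.ofMul ρ) = 1 := by
  rw [AddChar.add_apply, hχ, hψ]; norm_num

omit [Fintype G] [DecidableEq G] in
/-- Odd plus even is odd, at `ρ`. [folklore] -/
private theorem add_apply_rho_of_odd_even_w {χ ψ : AddChar (Additive G) ℂ} (hχ : χ (Additive.ofMul ρ) = -1)
    (hψ : ψ (Additive.ofMul ρ) = 1) : (χ + ψ) (Additive.ofMul ρ) = -1 := by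
  rw [AddChar.add_apply, hχ, hψ]; norm_num

omit [Fintype G] [DecidableEq G] in
/-- In a `2`-element finset containing `a ≠ b`, every element is `a` or `b`. [folklore] -/
private theorem mem_pair_of_card_two_w {α : Type*} [DecidableEq α] {s : Finset α} (hs : s.card = 2) {a b c : α}
    (ha : a ∈ s) (hb : b ∈ s) (hab : a ≠ b) (hc : c ∈ s) : c = a ∨ c = b := by
  by_contra hne
  push Not at hne
  have hsub : ({a, b, c} : Finset α) ⊆ s := by
    intro x hx
    simp only [Finset.mem_insert, Finset.mem_singleton] at hx
    rcases hx with rfl | rfl | rfl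
    · exact ha
    · exact hb
    · exact hc
  have h3 : ({a, b, c} : Finset α).card = 3 := by
    rw [Finset.card_insert_of_notMem, Finset.card_pair hne.2.symm]
    simp only [Finset.mem_insert, Finset.mem_singleton, not_or]
    exact ⟨hab, hne.1.symm⟩
  have := Finset.card_le_card hsub
  rw [h3, hs] at this
  omega

end Helpers

/-! ## §1 The Walsh profile of rank `11`: two characters with `Ŝ = ±8`, eight with `Ŝ = ±4`, six Weil characters -/

section Profile

/-- **RANK `11` IN ORDER `32` ⟹ THE PROFILE `(n₁₆, n₄, n₀) = (2, 8, 6)`**: exactly two odd characters have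
`a_χ ∈ {4, 12}` (`Ŝ = ±8`), exactly eight have `a_χ ∈ {6, 10}` (`Ŝ = ±4`), exactly six have `a_χ = 8` (`Ŝ = 0`,
the Weil characters), none has `a_χ ∈ {0, 16, 2, 14}` (Kubota–Dodson: `16n₆₄ + 9n₃₆ + 4n₁₆ + n₄ = 16`,
`n₃₆ + n₄ ∈ {0, 8, 16}`, `rank = 17 − n₀`, tree `profile_of_card_thirtytwo`). [cite: Kubota1965, §4 Lemma 2]
[cite: Dodson1984, §3.1.1 Theorem] -/
theorem card_classes_of_typeRank_eq_eleven (hexp : ∀ g : G, g ^ 2 = 1) (h : IsCMTypeWith ρ (T : Set G))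
    (h32 : Fintype.card G = 32) (hr : typeRank G (T : Set G) = 11) :
    ((Finset.univ.filter fun χ : AddChar (Additive G) ℂ => χ (Additive.ofMul ρ) = -1).filter fun χ =>
        (T.filter fun s => χ (Additive.ofMul s) = -1).card = 4 ∨
        (T.filter fun s => χ (Additive.ofMul s) = -1).card = 12).card = 2 ∧
    ((Finset.univ.filter fun χ : AddChar (Additive G) ℂ => χ (Additive.ofMul ρ) = -1).filter fun χ =>
        (T.filter fun s => χ (Additive.ofMul s) = -1).card = 6 ∨
        (T.filter fun s => χ (Additive.ofMul s) = -1).card = 10).card = 8 ∧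
    ((Finset.univ.filter fun χ : AddChar (Additive G) ℂ => χ (Additive.ofMul ρ) = -1).filter fun χ =>
        (T.filter fun s => χ (Additive.ofMul s) = -1).card = 8).card = 6 ∧
    ((Finset.univ.filter fun χ : AddChar (Additive G) ℂ => χ (Additive.ofMul ρ) = -1).filter fun χ =>
        (T.filter fun s => χ (Additive.ofMul s) = -1).card = 0 ∨
        (T.filter fun s => χ (Additive.ofMul s) = -1).card = 16).card = 0 ∧
    ((Finset.univ.filter fun χ : AddChar (Additive G) ℂ => χ (Additive.ofMul ρ) = -1).filter fun χ =>
        (T.filter fun s => χ (Additive.ofMul s) = -1).card = 2 ∨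
        (T.filter fun s => χ (Additive.ofMul s) = -1).card = 14).card = 0 := by
  have hev := forall_even_of_typeRank_ne_of_card_thirtytwo hexp h h32 (by rw [hr]; norm_num)
  obtain ⟨e1, e2, hbal, hrk⟩ := profile_of_card_thirtytwo hexp h h32 hev
  rw [hr] at hrk
  omega

/-- **Every odd character has `a_χ ∈ {4, 6, 8, 10, 12}`** in rank `11` (even type, no `a_χ ∈ {0, 2, 14, 16}`).
[cite: Kubota1965, §4 Lemma 2] [cite: Dodson1984, §3.1.1 Theorem] -/
theorem card_filter_mem_of_typeRank_eq_eleven (hexp : ∀ g : G, g ^ 2 = 1) (h : IsCMTypeWith ρ (T : Set G))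
    (h32 : Fintype.card G = 32) (hr : typeRank G (T : Set G) = 11) {χ : AddChar (Additive G) ℂ}
    (hχ : χ (Additive.ofMul ρ) = -1) :
    ((T.filter fun s => χ (Additive.ofMul s) = -1).card = 4 ∨
      (T.filter fun s => χ (Additive.ofMul s) = -1).card = 12) ∨
    ((T.filter fun s => χ (Additive.ofMul s) = -1).card = 6 ∨
      (T.filter fun s => χ (Additive.ofMul s) = -1).card = 10) ∨
    (T.filter fun s => χ (Additive.ofMul s) = -1).card = 8 := by
  have hev := forall_even_of_typeRank_ne_of_card_thirtytwo hexp h h32 (by rw [hr]; norm_num) χ hχ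
  obtain ⟨-, -, -, h0, h2⟩ := card_classes_of_typeRank_eq_eleven hexp h h32 hr
  have hle : (T.filter fun s => χ (Additive.ofMul s) = -1).card ≤ 16 :=
    (Finset.card_filter_le _ _).trans (card_T_w h h32).le
  have hn0 : ¬ ((T.filter fun s => χ (Additive.ofMul s) = -1).card = 0 ∨
      (T.filter fun s => χ (Additive.ofMul s) = -1).card = 16) := by
    intro hc
    rw [Finset.card_eq_zero, Finset.filter_eq_empty_iff] at h0
    exact h0 (Finset.mem_filter.2 ⟨Finset.mem_univ _, hχ⟩) hc
  have hn2 : ¬ ((T.filter fun s => χ (Additive.ofMul s) = -1).card = 2 ∨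
      (T.filter fun s => χ (Additive.ofMul s) = -1).card = 14) := by
    intro hc
    rw [Finset.card_eq_zero, Finset.filter_eq_empty_iff] at h2
    exact h2 (Finset.mem_filter.2 ⟨Finset.mem_univ _, hχ⟩) hc
  obtain ⟨k, hk⟩ := hev
  omega

end Profile

/-! ## §2 Titsworth's relation in integers and the pairing `χ ↦ χ + e`, `e = a + b` -/

section Pairing

/-- **Titsworth in integers**: with `s(χ) = 8 − a_χ` (`Ŝ(χ) = 2s(χ)`), `Σ_{χ odd} s(χ)s(χψ) = 0` for every even
`ψ ≠ 1`. [cite: Carlet2020, §2.3 (2.51) (p. 61)] [cite: Kubota1965, §4 Lemma 2] -/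
theorem sum_odd_sub_mul_sub_eq_zero (hexp : ∀ g : G, g ^ 2 = 1) (h : IsCMTypeWith ρ (T : Set G))
    (h32 : Fintype.card G = 32) {ψ : AddChar (Additive G) ℂ} (hψρ : ψ (Additive.ofMul ρ) = 1) (hψ : ψ ≠ 0) :
    ∑ χ ∈ Finset.univ.filter (fun χ : AddChar (Additive G) ℂ => χ (Additive.ofMul ρ) = -1),
      ((8 : ℤ) - ((T.filter fun t => χ (Additive.ofMul t) = -1).card : ℤ)) *
        ((8 : ℤ) - ((T.filter fun t => (χ + ψ) (Additive.ofMul t) = -1).card : ℤ)) = 0 := by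
  have ht := sum_odd_sum_char_mul_sum_char_add_eq_zero hexp h hψρ hψ
  rw [Finset.sum_congr rfl fun χ _ => by
    rw [sum_char_eq_two_mul_w hexp h h32 χ, sum_char_eq_two_mul_w hexp h h32 (χ + ψ)]] at ht
  have h4 : (4 : ℂ) * ((∑ χ ∈ Finset.univ.filter (fun χ : AddChar (Additive G) ℂ => χ (Additive.ofMul ρ) = -1),
      ((8 : ℤ) - ((T.filter fun t => χ (Additive.ofMul t) = -1).card : ℤ)) *
        ((8 : ℤ) - ((T.filter fun t => (χ + ψ) (Additive.ofMul t) = -1).card : ℤ)) : ℤ) : ℂ) = 0 := by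
    rw [← ht]; push_cast; rw [Finset.mul_sum]
    exact Finset.sum_congr rfl fun χ _ => by ring
  have h0 := (mul_eq_zero.1 h4).resolve_left (by norm_num)
  exact_mod_cast h0

/-- Arithmetic of the pairing step: `x, y ∈ {±4}`, `z, w ∈ {0, ±2}` ⟹ `xy·zw ∈ {−64, 0, 64}`. [folklore] -/
private theorem prod_cases_w {x y z w : ℤ} (hx : x = 4 ∨ x = -4) (hy : y = 4 ∨ y = -4)
    (hz : z = 0 ∨ z = 2 ∨ z = -2) (hw : w = 0 ∨ w = 2 ∨ w = -2) :
    (x * y * (z * w) ≠ -64 → 0 ≤ x * y * (z * w)) ∧ (x * y * (z * w) = -64 → z ≠ 0 ∧ w ≠ 0) := by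
  rcases hx with rfl | rfl <;> rcases hy with rfl | rfl <;> rcases hz with rfl | rfl | rfl <;>
    rcases hw with rfl | rfl | rfl <;> norm_num

/-- **THE PAIRING ALONG `e = ab`.**  In rank `11` (order `32`) let `a ≠ b` be the two odd characters with `Ŝ = ±8`
and `e = ab` (even, `≠ 1`).  Then for every odd `χ` with `Ŝ(χ) = ±4`:
**`Ŝ(a)Ŝ(b)·Ŝ(χ)Ŝ(χe) = −2¹⁰`**, i.e. `s(a)s(b)·s(χ)s(χe) = −64` — so `χe` again has `Ŝ = ±4`, with the sign rule
`Ŝ(χe)/Ŝ(χ) = −Ŝ(b)/Ŝ(a)` (Titsworth at `ψ = e`: the two terms `Ŝ(a)Ŝ(b)` must be cancelled by the fourteen others,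
each of absolute value `≤ 16`, which forces all eight `±4`-characters to pair up with the opposite sign product).
[cite: Carlet2020, §2.3 (2.51) (p. 61)] [cite: Kubota1965, §4 Lemma 2] [cite: Dodson1984, §3.1.1 Theorem] -/
theorem mul_mul_eq_of_typeRank_eq_eleven (hexp : ∀ g : G, g ^ 2 = 1) (h : IsCMTypeWith ρ (T : Set G))
    (h32 : Fintype.card G = 32) (hr : typeRank G (T : Set G) = 11) {a b : AddChar (Additive G) ℂ}
    (ha : a (Additive.ofMul ρ) = -1) (hb : b (Additive.ofMul ρ) = -1) (hab : a ≠ b)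
    (ha' : (T.filter fun t => a (Additive.ofMul t) = -1).card = 4 ∨
      (T.filter fun t => a (Additive.ofMul t) = -1).card = 12)
    (hb' : (T.filter fun t => b (Additive.ofMul t) = -1).card = 4 ∨
      (T.filter fun t => b (Additive.ofMul t) = -1).card = 12)
    {χ : AddChar (Additive G) ℂ} (hχ : χ (Additive.ofMul ρ) = -1)
    (hχ' : (T.filter fun t => χ (Additive.ofMul t) = -1).card = 6 ∨
      (T.filter fun t => χ (Additive.ofMul t) = -1).card = 10) :
    ((8 : ℤ) - ((T.filter fun t => a (Additive.ofMul t) = -1).card : ℤ)) *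
        ((8 : ℤ) - ((T.filter fun t => b (Additive.ofMul t) = -1).card : ℤ)) *
      (((8 : ℤ) - ((T.filter fun t => χ (Additive.ofMul t) = -1).card : ℤ)) *
        ((8 : ℤ) - ((T.filter fun t => (χ + (a + b)) (Additive.ofMul t) = -1).card : ℤ))) = -64 := by
  set O := Finset.univ.filter (fun χ : AddChar (Additive G) ℂ => χ (Additive.ofMul ρ) = -1) with hO
  set cnt : AddChar (Additive G) ℂ → ℕ := fun χ => (T.filter fun s => χ (Additive.ofMul s) = -1).card with hcnt
  set e := a + b with he
  obtain ⟨h2, h8, -, -, -⟩ := card_classes_of_typeRank_eq_eleven hexp h h32 hr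
  simp only [← hO] at h2 h8
  -- the `A`-class is `{a, b}`
  have hAab : ∀ φ ∈ O, (cnt φ = 4 ∨ cnt φ = 12) → φ = a ∨ φ = b := fun φ hφ hφ' =>
    mem_pair_of_card_two_w h2 (Finset.mem_filter.2 ⟨Finset.mem_filter.2 ⟨Finset.mem_univ _, ha⟩, ha'⟩)
      (Finset.mem_filter.2 ⟨Finset.mem_filter.2 ⟨Finset.mem_univ _, hb⟩, hb'⟩) hab (Finset.mem_filter.2 ⟨hφ, hφ'⟩)
  have heρ : e (Additive.ofMul ρ) = 1 := add_apply_rho_of_odd_w ha hb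
  have he0 : e ≠ 0 := fun h0 => hab ((add_eq_zero_iff_w hexp a b).1 h0)
  -- Titsworth at `e`
  have ht := sum_odd_sub_mul_sub_eq_zero hexp h h32 heρ he0
  simp only [← hO] at ht
  -- values
  have hsa : (8 : ℤ) - (cnt a : ℤ) = 4 ∨ (8 : ℤ) - (cnt a : ℤ) = -4 := by
    simp only [hcnt]; rcases ha' with h1 | h1 <;> simp only [h1] <;> norm_num
  have hsb : (8 : ℤ) - (cnt b : ℤ) = 4 ∨ (8 : ℤ) - (cnt b : ℤ) = -4 := by
    simp only [hcnt]; rcases hb' with h1 | h1 <;> simp only [h1] <;> norm_num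
  have hae : a + e = b := by rw [he, add_add_cancel_left_w hexp]
  have hbe : b + e = a := by rw [he, add_comm a b, add_add_cancel_left_w hexp]
  -- the other fourteen odd characters take `s ∈ {0, ±2}`
  have hsO : ∀ φ ∈ O, φ ≠ a → φ ≠ b →
      (8 : ℤ) - (cnt φ : ℤ) = 0 ∨ (8 : ℤ) - (cnt φ : ℤ) = 2 ∨ (8 : ℤ) - (cnt φ : ℤ) = -2 := by
    intro φ hφ hφa hφb
    have hφρ : φ (Additive.ofMul ρ) = -1 := (Finset.mem_filter.1 hφ).2
    rcases card_filter_mem_of_typeRank_eq_eleven hexp h h32 hr hφρ with hc | hc | hc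
    · rcases hAab φ hφ hc with rfl | rfl
      · exact absurd rfl hφa
      · exact absurd rfl hφb
    · simp only [hcnt]; rcases hc with h1 | h1 <;> simp only [h1] <;> norm_num
    · simp only [hcnt, hc]; norm_num
  have hmemO : ∀ φ ∈ O, φ + e ∈ O := fun φ hφ =>
    Finset.mem_filter.2 ⟨Finset.mem_univ _, add_apply_rho_of_odd_even_w (Finset.mem_filter.1 hφ).2 heρ⟩
  have hnea : ∀ φ ∈ O, φ ≠ b → φ + e ≠ a := by
    intro φ _ hφb hφe
    apply hφb
    have := congrArg (· + e) hφe
    simp only [add_add_cancel_right_w hexp] at this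
    rw [this, hae]
  have hneb : ∀ φ ∈ O, φ ≠ a → φ + e ≠ b := by
    intro φ _ hφa hφe
    apply hφa
    have := congrArg (· + e) hφe
    simp only [add_add_cancel_right_w hexp] at this
    rw [this, hbe]
  -- the sum over `O' = O ∖ {a, b}`
  set O' := O.filter (fun φ => φ ≠ a ∧ φ ≠ b) with hO'
  set xy : ℤ := ((8 : ℤ) - (cnt a : ℤ)) * ((8 : ℤ) - (cnt b : ℤ)) with hxy
  set u : AddChar (Additive G) ℂ → ℤ := fun φ => xy * (((8 : ℤ) - (cnt φ : ℤ)) * ((8 : ℤ) - (cnt (φ + e) : ℤ)))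
    with hu
  have haO : a ∈ O := Finset.mem_filter.2 ⟨Finset.mem_univ _, ha⟩
  have hbO : b ∈ O := Finset.mem_filter.2 ⟨Finset.mem_univ _, hb⟩
  have hsplit : ∑ φ ∈ O, ((8 : ℤ) - (cnt φ : ℤ)) * ((8 : ℤ) - (cnt (φ + e) : ℤ)) =
      2 * xy + ∑ φ ∈ O', ((8 : ℤ) - (cnt φ : ℤ)) * ((8 : ℤ) - (cnt (φ + e) : ℤ)) := by
    have hOeq : O = insert a (insert b O') := by
      ext φ
      simp only [Finset.mem_insert, hO', Finset.mem_filter]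
      constructor
      · intro hφ
        by_cases h1 : φ = a
        · exact Or.inl h1
        by_cases h2 : φ = b
        · exact Or.inr (Or.inl h2)
        exact Or.inr (Or.inr ⟨hφ, h1, h2⟩)
      · rintro (rfl | rfl | ⟨hφ, -, -⟩)
        · exact haO
        · exact hbO
        · exact hφ
    have haI : a ∉ insert b O' := by
      simp only [Finset.mem_insert, hO', Finset.mem_filter, not_or]
      exact ⟨hab, fun h' => h'.2.1 rfl⟩
    have hbI : b ∉ O' := by
      rw [hO', Finset.mem_filter]
      exact fun h' => h'.2.2 rfl
    rw [hOeq, Finset.sum_insert haI, Finset.sum_insert hbI, hae, hbe, hxy]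
    ring
  have hsum' : ∑ φ ∈ O', u φ = -512 := by
    have h1 : ∑ φ ∈ O', u φ = xy * ∑ φ ∈ O', ((8 : ℤ) - (cnt φ : ℤ)) * ((8 : ℤ) - (cnt (φ + e) : ℤ)) := by
      rw [hu, Finset.mul_sum]
    have h2 : ∑ φ ∈ O', ((8 : ℤ) - (cnt φ : ℤ)) * ((8 : ℤ) - (cnt (φ + e) : ℤ)) = -(2 * xy) := by
      linarith [hsplit, ht]
    have hxy2 : xy * xy = 256 := by
      rw [hxy]; rcases hsa with h3 | h3 <;> rcases hsb with h4 | h4 <;> rw [h3, h4] <;> norm_num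
    rw [h1, h2]; nlinarith [hxy2]
  -- each `u φ ∈ {−64, 0, 64}`, and `u φ = −64` forces `s(φ) ≠ 0`
  have hcases : ∀ φ ∈ O', (u φ ≠ -64 → 0 ≤ u φ) ∧
      (u φ = -64 → (8 : ℤ) - (cnt φ : ℤ) ≠ 0 ∧ (8 : ℤ) - (cnt (φ + e) : ℤ) ≠ 0) := by
    intro φ hφ
    obtain ⟨hφO, hφa, hφb⟩ := Finset.mem_filter.1 hφ
    exact prod_cases_w hsa hsb (hsO φ hφO hφa hφb)
      (hsO (φ + e) (hmemO φ hφO) (hnea φ hφO hφb) (hneb φ hφO hφa))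
  -- counting: at least eight `φ ∈ O'` have `u φ = −64`
  set Q := O'.filter (fun φ => u φ = -64) with hQ
  have hO'card : O'.card = 14 := by
    have h1 : O'.card + 2 = O.card := by
      have hOeq : (O.filter fun φ => ¬ (φ ≠ a ∧ φ ≠ b)) = {a, b} := by
        ext φ
        simp only [Finset.mem_filter, Finset.mem_insert, Finset.mem_singleton, not_and, not_not]
        constructor
        · rintro ⟨-, h1⟩
          by_cases h2 : φ = a
          · exact Or.inl h2
          · exact Or.inr (h1 h2)
        · rintro (rfl | rfl)
          · exact ⟨haO, fun h1 => absurd rfl h1⟩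
          · exact ⟨hbO, fun _ => rfl⟩
      have := Finset.card_filter_add_card_filter_not (s := O) (fun φ => φ ≠ a ∧ φ ≠ b)
      rw [hOeq, Finset.card_pair hab] at this
      rw [hO']; exact this
    rw [card_odd_w h h32] at h1
    omega
  have hQ8 : 8 ≤ Q.card := by
    have hs := Finset.sum_filter_add_sum_filter_not O' (fun φ => u φ = -64) u
    have h1 : ∑ φ ∈ O'.filter (fun φ => u φ = -64), u φ = -64 * (Q.card : ℤ) := by
      rw [Finset.sum_congr rfl fun φ hφ => (Finset.mem_filter.1 hφ).2, Finset.sum_const, nsmul_eq_mul, hQ]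
      ring
    have h2 : 0 ≤ ∑ φ ∈ O'.filter (fun φ => ¬ u φ = -64), u φ :=
      Finset.sum_nonneg fun φ hφ => (hcases φ (Finset.mem_filter.1 hφ).1).1 (Finset.mem_filter.1 hφ).2
    have h3 : -512 = -64 * (Q.card : ℤ) + ∑ φ ∈ O'.filter (fun φ => ¬ u φ = -64), u φ := by
      rw [← hsum', ← hs, h1]
    have : (Q.card : ℤ) ≥ 8 := by linarith
    exact_mod_cast this
  -- `Q ⊆ P`, `|P| = 8` ⟹ `Q = P`
  have hQP : Q ⊆ O.filter fun φ => cnt φ = 6 ∨ cnt φ = 10 := by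
    intro φ hφ
    obtain ⟨hφO', hφu⟩ := Finset.mem_filter.1 hφ
    obtain ⟨hφO, hφa, hφb⟩ := Finset.mem_filter.1 hφO'
    refine Finset.mem_filter.2 ⟨hφO, ?_⟩
    have hne := ((hcases φ hφO').2 hφu).1
    rcases hsO φ hφO hφa hφb with h0 | h0 | h0
    · exact absurd h0 hne
    · left; simp only [hcnt] at h0 ⊢; omega
    · right; simp only [hcnt] at h0 ⊢; omega
  have hQeq : Q = O.filter fun φ => cnt φ = 6 ∨ cnt φ = 10 :=
    Finset.eq_of_subset_of_card_le hQP (by rw [h8]; exact hQ8)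
  -- conclude for the given `χ`
  have hχQ : χ ∈ Q := by
    rw [hQeq]
    exact Finset.mem_filter.2 ⟨Finset.mem_filter.2 ⟨Finset.mem_univ _, hχ⟩, hχ'⟩
  have := (Finset.mem_filter.1 hχQ).2
  simpa only [hu, hxy, hcnt] using this

/-- **Consequences of the pairing**: for odd `χ` with `Ŝ(χ) = ±4`, `χe` is odd with `Ŝ(χe) = ±4`.
[cite: Kubota1965, §4 Lemma 2] [cite: Carlet2020, §2.3 (2.51)] -/
theorem add_mem_four_of_typeRank_eq_eleven (hexp : ∀ g : G, g ^ 2 = 1) (h : IsCMTypeWith ρ (T : Set G))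
    (h32 : Fintype.card G = 32) (hr : typeRank G (T : Set G) = 11) {a b : AddChar (Additive G) ℂ}
    (ha : a (Additive.ofMul ρ) = -1) (hb : b (Additive.ofMul ρ) = -1) (hab : a ≠ b)
    (ha' : (T.filter fun t => a (Additive.ofMul t) = -1).card = 4 ∨
      (T.filter fun t => a (Additive.ofMul t) = -1).card = 12)
    (hb' : (T.filter fun t => b (Additive.ofMul t) = -1).card = 4 ∨
      (T.filter fun t => b (Additive.ofMul t) = -1).card = 12)
    {χ : AddChar (Additive G) ℂ} (hχ : χ (Additive.ofMul ρ) = -1)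
    (hχ' : (T.filter fun t => χ (Additive.ofMul t) = -1).card = 6 ∨
      (T.filter fun t => χ (Additive.ofMul t) = -1).card = 10) :
    (χ + (a + b)) (Additive.ofMul ρ) = -1 ∧
      ((T.filter fun t => (χ + (a + b)) (Additive.ofMul t) = -1).card = 6 ∨
        (T.filter fun t => (χ + (a + b)) (Additive.ofMul t) = -1).card = 10) := by
  have hodd : (χ + (a + b)) (Additive.ofMul ρ) = -1 :=
    add_apply_rho_of_odd_even_w hχ (add_apply_rho_of_odd_w ha hb)
  refine ⟨hodd, ?_⟩
  have hm := mul_mul_eq_of_typeRank_eq_eleven hexp h h32 hr ha hb hab ha' hb' hχ hχ'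
  rcases card_filter_mem_of_typeRank_eq_eleven hexp h h32 hr hodd with hc | hc | hc
  · exfalso
    rcases ha' with h1 | h1 <;> rcases hb' with h2 | h2 <;> rcases hχ' with h3 | h3 <;> rcases hc with h4 | h4 <;>
      simp only [h1, h2, h3, h4] at hm <;> norm_num at hm
  · exact hc
  · exfalso
    simp only [hc] at hm
    norm_num at hm

/-- **The Weil characters are `e`-stable too**: `Ŝ(χ) = 0 ⟹ Ŝ(χe) = 0` (odd `χ`).
[cite: Kubota1965, §4 Lemma 2] [cite: Carlet2020, §2.3 (2.51)] -/
theorem add_mem_weil_of_typeRank_eq_eleven (hexp : ∀ g : G, g ^ 2 = 1) (h : IsCMTypeWith ρ (T : Set G))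
    (h32 : Fintype.card G = 32) (hr : typeRank G (T : Set G) = 11) {a b : AddChar (Additive G) ℂ}
    (ha : a (Additive.ofMul ρ) = -1) (hb : b (Additive.ofMul ρ) = -1) (hab : a ≠ b)
    (ha' : (T.filter fun t => a (Additive.ofMul t) = -1).card = 4 ∨
      (T.filter fun t => a (Additive.ofMul t) = -1).card = 12)
    (hb' : (T.filter fun t => b (Additive.ofMul t) = -1).card = 4 ∨
      (T.filter fun t => b (Additive.ofMul t) = -1).card = 12)
    {χ : AddChar (Additive G) ℂ} (hχ : χ (Additive.ofMul ρ) = -1)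
    (hχ' : (T.filter fun t => χ (Additive.ofMul t) = -1).card = 8) :
    (χ + (a + b)) (Additive.ofMul ρ) = -1 ∧ (T.filter fun t => (χ + (a + b)) (Additive.ofMul t) = -1).card = 8 := by
  have hodd : (χ + (a + b)) (Additive.ofMul ρ) = -1 :=
    add_apply_rho_of_odd_even_w hχ (add_apply_rho_of_odd_w ha hb)
  refine ⟨hodd, ?_⟩
  obtain ⟨h2, -, -, -, -⟩ := card_classes_of_typeRank_eq_eleven hexp h h32 hr
  rcases card_filter_mem_of_typeRank_eq_eleven hexp h h32 hr hodd with hc | hc | hc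
  · -- then `χ + e ∈ {a, b}`, so `χ ∈ {b, a}` has `a_χ ∈ {4, 12}`
    exfalso
    have hc' : χ + (a + b) = a ∨ χ + (a + b) = b :=
      mem_pair_of_card_two_w h2 (Finset.mem_filter.2 ⟨Finset.mem_filter.2 ⟨Finset.mem_univ _, ha⟩, ha'⟩)
        (Finset.mem_filter.2 ⟨Finset.mem_filter.2 ⟨Finset.mem_univ _, hb⟩, hb'⟩) hab
        (Finset.mem_filter.2 ⟨Finset.mem_filter.2 ⟨Finset.mem_univ _, hodd⟩, hc⟩)
    have key : χ = χ + (a + b) + (a + b) := (add_add_cancel_right_w hexp χ (a + b)).symm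
    have hχab : χ = b ∨ χ = a := by
      rcases hc' with h1 | h1
      · left; rw [key, h1, add_add_cancel_left_w hexp]
      · right; rw [key, h1, add_comm a b, add_add_cancel_left_w hexp]
    rcases hχab with rfl | rfl
    · rcases hb' with h1 | h1 <;> omega
    · rcases ha' with h1 | h1 <;> omega
  · exfalso
    have := (add_mem_four_of_typeRank_eq_eleven hexp h h32 hr ha hb hab ha' hb' hodd hc).2
    rw [add_add_cancel_right_w hexp] at this
    rcases this with h1 | h1 <;> omega
  · exact hc

end Pairing

/-! ## §3 The restricted correlation `R(ψ) = Σ_{χ, χψ both ±4} s(χ)s(χψ)` vanishes for even `ψ ∉ {1, e}` -/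

section Correlation

/-- Arithmetic: `x, y ∈ {±4}`, `p, q ∈ {±2}`, `xy·pq = −64` ⟹ `xp + yq = 0`. [folklore] -/
private theorem cancel_cases_w {x y p q : ℤ} (hx : x = 4 ∨ x = -4) (hy : y = 4 ∨ y = -4)
    (hp : p = 2 ∨ p = -2) (hq : q = 2 ∨ q = -2) (hm : x * y * (p * q) = -64) : x * p + y * q = 0 := by
  rcases hx with rfl | rfl <;> rcases hy with rfl | rfl <;> rcases hp with rfl | rfl <;>
    rcases hq with rfl | rfl <;> omega

/-- **`R(ψ) = 0`**: for an even character `ψ ∉ {1, e}` the Titsworth sum restricted to the pairs `(χ, χψ)` with BOTH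
`Ŝ(χ), Ŝ(χψ) = ±4` vanishes — all other terms of `Σ_{χ odd} Ŝ(χ)Ŝ(χψ) = 0` either contain a Weil character or
are the four terms through `a, b, aψ, bψ`, which cancel by the sign rule of the pairing.
[cite: Carlet2020, §2.3 (2.51) (p. 61)] [cite: Kubota1965, §4 Lemma 2] -/
theorem sum_restricted_eq_zero (hexp : ∀ g : G, g ^ 2 = 1) (h : IsCMTypeWith ρ (T : Set G))
    (h32 : Fintype.card G = 32) (hr : typeRank G (T : Set G) = 11) {a b : AddChar (Additive G) ℂ}
    (ha : a (Additive.ofMul ρ) = -1) (hb : b (Additive.ofMul ρ) = -1) (hab : a ≠ b)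
    (ha' : (T.filter fun t => a (Additive.ofMul t) = -1).card = 4 ∨
      (T.filter fun t => a (Additive.ofMul t) = -1).card = 12)
    (hb' : (T.filter fun t => b (Additive.ofMul t) = -1).card = 4 ∨
      (T.filter fun t => b (Additive.ofMul t) = -1).card = 12)
    {ψ : AddChar (Additive G) ℂ} (hψρ : ψ (Additive.ofMul ρ) = 1) (hψ0 : ψ ≠ 0) (hψe : ψ ≠ a + b) :
    ∑ χ ∈ (Finset.univ.filter fun χ : AddChar (Additive G) ℂ => χ (Additive.ofMul ρ) = -1).filter (fun χ =>
        ((T.filter fun t => χ (Additive.ofMul t) = -1).card = 6 ∨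
          (T.filter fun t => χ (Additive.ofMul t) = -1).card = 10) ∧
        ((T.filter fun t => (χ + ψ) (Additive.ofMul t) = -1).card = 6 ∨
          (T.filter fun t => (χ + ψ) (Additive.ofMul t) = -1).card = 10)),
      ((8 : ℤ) - ((T.filter fun t => χ (Additive.ofMul t) = -1).card : ℤ)) *
        ((8 : ℤ) - ((T.filter fun t => (χ + ψ) (Additive.ofMul t) = -1).card : ℤ)) = 0 := by
  set O := Finset.univ.filter (fun χ : AddChar (Additive G) ℂ => χ (Additive.ofMul ρ) = -1) with hO
  set cnt : AddChar (Additive G) ℂ → ℕ := fun χ => (T.filter fun s => χ (Additive.ofMul s) = -1).card with hcnt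
  set e := a + b with he
  set f : AddChar (Additive G) ℂ → ℤ := fun χ => ((8 : ℤ) - (cnt χ : ℤ)) * ((8 : ℤ) - (cnt (χ + ψ) : ℤ))
    with hf
  obtain ⟨h2, -, -, -, -⟩ := card_classes_of_typeRank_eq_eleven hexp h h32 hr
  simp only [← hO] at h2
  have hAab : ∀ φ : AddChar (Additive G) ℂ, φ (Additive.ofMul ρ) = -1 → (cnt φ = 4 ∨ cnt φ = 12) →
      φ = a ∨ φ = b := fun φ hφ hφ' =>
    mem_pair_of_card_two_w h2 (Finset.mem_filter.2 ⟨Finset.mem_filter.2 ⟨Finset.mem_univ _, ha⟩, ha'⟩)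
      (Finset.mem_filter.2 ⟨Finset.mem_filter.2 ⟨Finset.mem_univ _, hb⟩, hb'⟩) hab
      (Finset.mem_filter.2 ⟨Finset.mem_filter.2 ⟨Finset.mem_univ _, hφ⟩, hφ'⟩)
  have ht := sum_odd_sub_mul_sub_eq_zero hexp h h32 hψρ hψ0
  simp only [← hO] at ht
  change ∑ χ ∈ O, f χ = 0 at ht
  set Q : AddChar (Additive G) ℂ → Prop := fun χ =>
    (cnt χ = 6 ∨ cnt χ = 10) ∧ (cnt (χ + ψ) = 6 ∨ cnt (χ + ψ) = 10) with hQ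
  change ∑ χ ∈ O.filter Q, f χ = 0
  have hsplit := Finset.sum_filter_add_sum_filter_not O Q f
  -- the four special characters
  have heρ : e (Additive.ofMul ρ) = 1 := add_apply_rho_of_odd_w ha hb
  have haψ : (a + ψ) (Additive.ofMul ρ) = -1 := add_apply_rho_of_odd_even_w ha hψρ
  have hbψ : (b + ψ) (Additive.ofMul ρ) = -1 := add_apply_rho_of_odd_even_w hb hψρ
  have hodd_add : ∀ φ : AddChar (Additive G) ℂ, φ (Additive.ofMul ρ) = -1 → (φ + ψ) (Additive.ofMul ρ) = -1 :=
    fun φ hφ => add_apply_rho_of_odd_even_w hφ hψρ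
  have hne1 : a ≠ a + ψ := fun h1 => hψ0 ((add_eq_left_iff_w a ψ).1 h1.symm)
  have hne2 : b ≠ b + ψ := fun h1 => hψ0 ((add_eq_left_iff_w b ψ).1 h1.symm)
  have hne3 : a ≠ b + ψ := by
    intro h1; apply hψe
    have := congrArg (fun φ => b + φ) h1
    simp only [add_add_cancel_left_w hexp] at this
    rw [he, add_comm, this]
  have hne4 : b ≠ a + ψ := by
    intro h1; apply hψe
    have := congrArg (fun φ => a + φ) h1
    simp only [add_add_cancel_left_w hexp] at this
    rw [he, this]
  have hne5 : a + ψ ≠ b + ψ := fun h1 => hab (add_right_cancel h1)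
  have haP : ¬ (cnt a = 6 ∨ cnt a = 10) := by
    simp only [hcnt]; rcases ha' with h1 | h1 <;> simp only [h1] <;> norm_num
  have hbP : ¬ (cnt b = 6 ∨ cnt b = 10) := by
    simp only [hcnt]; rcases hb' with h1 | h1 <;> simp only [h1] <;> norm_num
  have haψψ : a + ψ + ψ = a := add_add_cancel_right_w hexp a ψ
  have hbψψ : b + ψ + ψ = b := add_add_cancel_right_w hexp b ψ
  set D : Finset (AddChar (Additive G) ℂ) := {a, b, a + ψ, b + ψ} with hD
  have hDsub : D ⊆ O.filter fun χ => ¬ Q χ := by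
    intro φ hφ
    simp only [hD, Finset.mem_insert, Finset.mem_singleton] at hφ
    rw [Finset.mem_filter, hO, Finset.mem_filter, hQ]
    rcases hφ with rfl | rfl | rfl | rfl
    · exact ⟨⟨Finset.mem_univ _, ha⟩, fun hq => haP hq.1⟩
    · exact ⟨⟨Finset.mem_univ _, hb⟩, fun hq => hbP hq.1⟩
    · refine ⟨⟨Finset.mem_univ _, haψ⟩, fun hq => haP ?_⟩
      have := hq.2; rwa [haψψ] at this
    · refine ⟨⟨Finset.mem_univ _, hbψ⟩, fun hq => hbP ?_⟩
      have := hq.2; rwa [hbψψ] at this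
  -- outside `D`, the non-`Q` terms vanish
  have hvanish : ∀ φ ∈ O.filter (fun χ => ¬ Q χ), φ ∉ D → f φ = 0 := by
    intro φ hφ hφD
    obtain ⟨hφO, hφQ⟩ := Finset.mem_filter.1 hφ
    have hφρ : φ (Additive.ofMul ρ) = -1 := (Finset.mem_filter.1 hφO).2
    simp only [hD, Finset.mem_insert, Finset.mem_singleton, not_or] at hφD
    obtain ⟨hφa, hφb, hφaψ, hφbψ⟩ := hφD
    rcases card_filter_mem_of_typeRank_eq_eleven hexp h h32 hr hφρ with hc | hc | hc
    · rcases hAab φ hφρ hc with rfl | rfl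
      · exact absurd rfl hφa
      · exact absurd rfl hφb
    · -- `φ ∈ P`, so `φ + ψ ∉ P`; it is not `a, b` either, hence Weil
      have hnq : ¬ (cnt (φ + ψ) = 6 ∨ cnt (φ + ψ) = 10) := fun hq => hφQ ⟨hc, hq⟩
      rcases card_filter_mem_of_typeRank_eq_eleven hexp h h32 hr (hodd_add φ hφρ) with hc' | hc' | hc'
      · rcases hAab (φ + ψ) (hodd_add φ hφρ) hc' with h1 | h1
        · exact absurd ((add_add_cancel_right_w hexp φ ψ).symm.trans (by rw [h1])) hφaψ
        · exact absurd ((add_add_cancel_right_w hexp φ ψ).symm.trans (by rw [h1])) hφbψ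
      · exact absurd hc' hnq
      · simp only [hf, hcnt] at hc' ⊢; rw [hc']; ring
    · simp only [hf, hcnt] at hc ⊢; rw [hc]; ring
  have hsumD : ∑ φ ∈ O.filter (fun χ => ¬ Q χ), f φ = ∑ φ ∈ D, f φ :=
    (Finset.sum_subset hDsub hvanish).symm
  -- the four special terms cancel
  have hfour : ∑ φ ∈ D, f φ = 2 * (((8 : ℤ) - (cnt a : ℤ)) * ((8 : ℤ) - (cnt (a + ψ) : ℤ)) +
      ((8 : ℤ) - (cnt b : ℤ)) * ((8 : ℤ) - (cnt (b + ψ) : ℤ))) := by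
    have h1 : a ∉ ({b, a + ψ, b + ψ} : Finset (AddChar (Additive G) ℂ)) := by
      simp only [Finset.mem_insert, Finset.mem_singleton, not_or]; exact ⟨hab, hne1, hne3⟩
    have h2' : b ∉ ({a + ψ, b + ψ} : Finset (AddChar (Additive G) ℂ)) := by
      simp only [Finset.mem_insert, Finset.mem_singleton, not_or]; exact ⟨hne4, hne2⟩
    rw [hD, Finset.sum_insert h1, Finset.sum_insert h2', Finset.sum_pair hne5]
    simp only [hf, haψψ, hbψψ]
    ring
  have hcancel : ((8 : ℤ) - (cnt a : ℤ)) * ((8 : ℤ) - (cnt (a + ψ) : ℤ)) +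
      ((8 : ℤ) - (cnt b : ℤ)) * ((8 : ℤ) - (cnt (b + ψ) : ℤ)) = 0 := by
    have haψe : a + ψ + e = b + ψ := by rw [add_right_comm, he, add_add_cancel_left_w hexp a b]
    rcases card_filter_mem_of_typeRank_eq_eleven hexp h h32 hr haψ with hc | hc | hc
    · exfalso
      rcases hAab (a + ψ) haψ hc with h1 | h1
      · exact hne1 h1.symm
      · exact hne4 h1.symm
    · have hm := mul_mul_eq_of_typeRank_eq_eleven hexp h h32 hr ha hb hab ha' hb' haψ hc
      rw [← he, haψe] at hm
      have hsa : (8 : ℤ) - (cnt a : ℤ) = 4 ∨ (8 : ℤ) - (cnt a : ℤ) = -4 := by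
        simp only [hcnt]; rcases ha' with h1 | h1 <;> simp only [h1] <;> norm_num
      have hsb : (8 : ℤ) - (cnt b : ℤ) = 4 ∨ (8 : ℤ) - (cnt b : ℤ) = -4 := by
        simp only [hcnt]; rcases hb' with h1 | h1 <;> simp only [h1] <;> norm_num
      have hp : (8 : ℤ) - (cnt (a + ψ) : ℤ) = 2 ∨ (8 : ℤ) - (cnt (a + ψ) : ℤ) = -2 := by
        simp only [hcnt] at hc ⊢; rcases hc with h1 | h1 <;> simp only [h1] <;> norm_num
      have hq : (8 : ℤ) - (cnt (b + ψ) : ℤ) = 2 ∨ (8 : ℤ) - (cnt (b + ψ) : ℤ) = -2 := by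
        have := (add_mem_four_of_typeRank_eq_eleven hexp h h32 hr ha hb hab ha' hb' haψ hc).2
        rw [← he, haψe] at this
        simp only [hcnt] at this ⊢; rcases this with h1 | h1 <;> simp only [h1] <;> norm_num
      exact cancel_cases_w hsa hsb hp hq (by simpa only [hcnt] using hm)
    · -- `a + ψ` Weil ⟹ `b + ψ = (a + ψ) + e` Weil
      have hc2 := (add_mem_weil_of_typeRank_eq_eleven hexp h h32 hr ha hb hab ha' hb' haψ hc).2
      rw [← he, haψe] at hc2
      simp only [hcnt] at hc hc2 ⊢
      rw [hc, hc2]; ring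
  rw [hsumD, hfour, hcancel, mul_zero, add_zero] at hsplit
  rw [hsplit]; exact ht

end Correlation

/-! ## §4 The dichotomy: an even translate of the `±4`-class `P` meets `P` in `∅` or in all of `P` -/

section Dichotomy

/-- Arithmetic: `p, q, p', q' ∈ {±2}`, `pp' = qq'` ⟹ `p'q' = pq`. [folklore] -/
private theorem transfer_cases_w {p q p' q' : ℤ} (hp : p = 2 ∨ p = -2) (hq : q = 2 ∨ q = -2)
    (hp' : p' = 2 ∨ p' = -2) (hq' : q' = 2 ∨ q' = -2) (hm : p * p' = q * q') : p' * q' = p * q := by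
  rcases hp with rfl | rfl <;> rcases hq with rfl | rfl <;> rcases hp' with rfl | rfl <;>
    rcases hq' with rfl | rfl <;> omega

omit [Fintype G] [DecidableEq G] in
/-- **A non-empty set of characters stable under `χ ↦ χψ` and `χ ↦ χe` (`ψ, e ≠ 1`, `ψ ≠ e`) has at least four
elements** (`χ, χψ, χe, χψe` are distinct). [folklore] -/
private theorem four_le_card_of_stable_w (hexp : ∀ g : G, g ^ 2 = 1) {ψ e : AddChar (Additive G) ℂ} (hψ0 : ψ ≠ 0)
    (he0 : e ≠ 0) (hψe : ψ ≠ e) {N : Finset (AddChar (Additive G) ℂ)}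
    (hN : ∀ χ ∈ N, χ + ψ ∈ N ∧ χ + e ∈ N) (hne : N.Nonempty) : 4 ≤ N.card := by
  obtain ⟨χ, hχ⟩ := hne
  have h1 : χ + ψ ≠ χ := fun h' => hψ0 ((add_eq_left_iff_w χ ψ).1 h')
  have h2 : χ + e ≠ χ := fun h' => he0 ((add_eq_left_iff_w χ e).1 h')
  have h3 : χ + ψ ≠ χ + e := fun h' => hψe (add_left_cancel h')
  have h4 : χ + e + ψ ≠ χ := by
    intro h'
    rw [add_assoc, add_eq_left_iff_w, add_eq_zero_iff_w hexp] at h'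
    exact hψe h'.symm
  have h5 : χ + e + ψ ≠ χ + ψ := fun h' => h2 (add_right_cancel h')
  have h6 : χ + e + ψ ≠ χ + e := fun h' => hψ0 ((add_eq_left_iff_w (χ + e) ψ).1 h')
  have hsub : ({χ + e + ψ, χ + ψ, χ + e, χ} : Finset (AddChar (Additive G) ℂ)) ⊆ N := by
    intro x hx
    simp only [Finset.mem_insert, Finset.mem_singleton] at hx
    rcases hx with rfl | rfl | rfl | rfl
    · exact (hN _ (hN χ hχ).2).1
    · exact (hN χ hχ).1
    · exact (hN χ hχ).2
    · exact hχ
  have hcard : ({χ + e + ψ, χ + ψ, χ + e, χ} : Finset (AddChar (Additive G) ℂ)).card = 4 := by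
    rw [Finset.card_insert_of_notMem, Finset.card_insert_of_notMem, Finset.card_pair h2]
    · simp only [Finset.mem_insert, Finset.mem_singleton, not_or]; exact ⟨h3, h1⟩
    · simp only [Finset.mem_insert, Finset.mem_singleton, not_or]; exact ⟨h5, h6, h4⟩
  exact hcard ▸ Finset.card_le_card hsub

/-- **★ THE DICHOTOMY.**  In rank `11` (order `32`), let `P` be the set of odd characters with `Ŝ = ±4` (`|P| = 8`).
For every even character `ψ`: **if some `χ ∈ P` has `χψ ∈ P`, then EVERY `χ ∈ P` has `χψ ∈ P`** — the translate
`Pψ` is `P` or disjoint from `P`.  (The pairs `(χ, χψ)` inside `P` split by the sign of `Ŝ(χ)Ŝ(χψ)` into two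
classes of equal size, `R(ψ) = 0`; each class is stable under `χ ↦ χψ, χe`, hence empty or of size `≥ 4`; so the
number of such pairs is `0` or `8`.) [cite: Carlet2020, §2.3 (2.51) (p. 61)] [cite: Kubota1965, §4 Lemma 2]
[cite: Dodson1984, §3.1.1 Theorem] -/
theorem forall_add_mem_four_of_exists (hexp : ∀ g : G, g ^ 2 = 1) (h : IsCMTypeWith ρ (T : Set G))
    (h32 : Fintype.card G = 32) (hr : typeRank G (T : Set G) = 11) {a b : AddChar (Additive G) ℂ}
    (ha : a (Additive.ofMul ρ) = -1) (hb : b (Additive.ofMul ρ) = -1) (hab : a ≠ b)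
    (ha' : (T.filter fun t => a (Additive.ofMul t) = -1).card = 4 ∨
      (T.filter fun t => a (Additive.ofMul t) = -1).card = 12)
    (hb' : (T.filter fun t => b (Additive.ofMul t) = -1).card = 4 ∨
      (T.filter fun t => b (Additive.ofMul t) = -1).card = 12)
    {ψ : AddChar (Additive G) ℂ} (hψρ : ψ (Additive.ofMul ρ) = 1) {χ₀ : AddChar (Additive G) ℂ}
    (hχ₀ : χ₀ (Additive.ofMul ρ) = -1)
    (hχ₀' : (T.filter fun t => χ₀ (Additive.ofMul t) = -1).card = 6 ∨
      (T.filter fun t => χ₀ (Additive.ofMul t) = -1).card = 10)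
    (hχ₀ψ : (T.filter fun t => (χ₀ + ψ) (Additive.ofMul t) = -1).card = 6 ∨
      (T.filter fun t => (χ₀ + ψ) (Additive.ofMul t) = -1).card = 10)
    {χ : AddChar (Additive G) ℂ} (hχ : χ (Additive.ofMul ρ) = -1)
    (hχ' : (T.filter fun t => χ (Additive.ofMul t) = -1).card = 6 ∨
      (T.filter fun t => χ (Additive.ofMul t) = -1).card = 10) :
    (T.filter fun t => (χ + ψ) (Additive.ofMul t) = -1).card = 6 ∨
      (T.filter fun t => (χ + ψ) (Additive.ofMul t) = -1).card = 10 := by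
  by_cases hψ0 : ψ = 0
  · rw [hψ0, add_zero]; exact hχ'
  by_cases hψe : ψ = a + b
  · rw [hψe]; exact (add_mem_four_of_typeRank_eq_eleven hexp h h32 hr ha hb hab ha' hb' hχ hχ').2
  set O := Finset.univ.filter (fun χ : AddChar (Additive G) ℂ => χ (Additive.ofMul ρ) = -1) with hO
  set cnt : AddChar (Additive G) ℂ → ℕ := fun χ => (T.filter fun s => χ (Additive.ofMul s) = -1).card with hcnt
  set e := a + b with he
  set f : AddChar (Additive G) ℂ → ℤ := fun χ => ((8 : ℤ) - (cnt χ : ℤ)) * ((8 : ℤ) - (cnt (χ + ψ) : ℤ))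
    with hf
  set Q : AddChar (Additive G) ℂ → Prop := fun χ =>
    (cnt χ = 6 ∨ cnt χ = 10) ∧ (cnt (χ + ψ) = 6 ∨ cnt (χ + ψ) = 10) with hQ
  obtain ⟨-, h8, -, -, -⟩ := card_classes_of_typeRank_eq_eleven hexp h h32 hr
  simp only [← hO] at h8
  change (O.filter fun χ => cnt χ = 6 ∨ cnt χ = 10).card = 8 at h8
  have hR := sum_restricted_eq_zero hexp h h32 hr ha hb hab ha' hb' hψρ hψ0 hψe
  simp only [← hO] at hR
  change ∑ χ ∈ O.filter Q, f χ = 0 at hR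
  set M := O.filter Q with hM
  have heρ : e (Additive.ofMul ρ) = 1 := add_apply_rho_of_odd_w ha hb
  have he0 : e ≠ 0 := fun h0 => hab ((add_eq_zero_iff_w hexp a b).1 h0)
  -- values on `M`
  have hsv : ∀ φ : AddChar (Additive G) ℂ, (cnt φ = 6 ∨ cnt φ = 10) →
      (8 : ℤ) - (cnt φ : ℤ) = 2 ∨ (8 : ℤ) - (cnt φ : ℤ) = -2 := by
    intro φ hφ; rcases hφ with h1 | h1 <;> rw [h1] <;> norm_num
  have hfM : ∀ φ ∈ M, f φ = 4 ∨ f φ = -4 := by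
    intro φ hφ
    obtain ⟨-, hq1, hq2⟩ := Finset.mem_filter.1 hφ
    simp only [hf]
    rcases hsv φ hq1 with h1 | h1 <;> rcases hsv (φ + ψ) hq2 with h2 | h2 <;> rw [h1, h2] <;> norm_num
  -- the two sign classes have equal size
  have hcardM : M.card = (M.filter fun φ => f φ = 4).card + (M.filter fun φ => f φ = -4).card := by
    rw [← Finset.card_filter_add_card_filter_not (s := M) (fun φ => f φ = 4)]
    congr 2
    refine Finset.filter_congr fun φ hφ => ?_
    rcases hfM φ hφ with h1 | h1
    · rw [h1]; norm_num
    · rw [h1]; norm_num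
  have heq : ((M.filter fun φ => f φ = 4).card : ℤ) = (M.filter fun φ => f φ = -4).card := by
    have hs := Finset.sum_filter_add_sum_filter_not M (fun φ => f φ = 4) f
    have h1 : ∑ φ ∈ M.filter (fun φ => f φ = 4), f φ = 4 * ((M.filter fun φ => f φ = 4).card : ℤ) := by
      rw [Finset.sum_congr rfl fun φ hφ => (Finset.mem_filter.1 hφ).2, Finset.sum_const, nsmul_eq_mul, mul_comm]
    have hnot : (M.filter fun φ => ¬ f φ = 4) = M.filter fun φ => f φ = -4 := by
      refine Finset.filter_congr fun φ hφ => ?_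
      rcases hfM φ hφ with h2 | h2
      · rw [h2]; norm_num
      · rw [h2]; norm_num
    have h2 : ∑ φ ∈ M.filter (fun φ => ¬ f φ = 4), f φ = -4 * ((M.filter fun φ => f φ = -4).card : ℤ) := by
      rw [hnot, Finset.sum_congr rfl fun φ hφ => (Finset.mem_filter.1 hφ).2, Finset.sum_const, nsmul_eq_mul,
        mul_comm]
    rw [h1, h2, hR] at hs
    linarith
  -- pairing data
  have hpair : ∀ φ : AddChar (Additive G) ℂ, φ (Additive.ofMul ρ) = -1 → (cnt φ = 6 ∨ cnt φ = 10) →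
      (φ + e) (Additive.ofMul ρ) = -1 ∧ (cnt (φ + e) = 6 ∨ cnt (φ + e) = 10) :=
    fun φ hφ hφ' => add_mem_four_of_typeRank_eq_eleven hexp h h32 hr ha hb hab ha' hb' hφ hφ'
  have hxy0 : ((8 : ℤ) - (cnt a : ℤ)) * ((8 : ℤ) - (cnt b : ℤ)) ≠ 0 := by
    rcases ha' with h1 | h1 <;> rcases hb' with h2 | h2 <;> simp only [hcnt] at h1 h2 ⊢ <;> rw [h1, h2] <;> norm_num
  -- stability of each sign class under `χ ↦ χψ` and `χ ↦ χe`
  have hstab : ∀ v : ℤ, ∀ φ ∈ M.filter (fun φ => f φ = v),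
      φ + ψ ∈ M.filter (fun φ => f φ = v) ∧ φ + e ∈ M.filter (fun φ => f φ = v) := by
    intro v φ hφ
    obtain ⟨hφM, hφv⟩ := Finset.mem_filter.1 hφ
    obtain ⟨hφO, hq1, hq2⟩ := Finset.mem_filter.1 hφM
    have hφρ : φ (Additive.ofMul ρ) = -1 := (Finset.mem_filter.1 hφO).2
    have hφψρ : (φ + ψ) (Additive.ofMul ρ) = -1 := add_apply_rho_of_odd_even_w hφρ hψρ
    have hφψψ : φ + ψ + ψ = φ := add_add_cancel_right_w hexp φ ψ
    constructor
    · refine Finset.mem_filter.2 ⟨Finset.mem_filter.2 ⟨Finset.mem_filter.2 ⟨Finset.mem_univ _, hφψρ⟩, hq2, ?_⟩, ?_⟩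
      · rw [hφψψ]; exact hq1
      · rw [← hφv]; simp only [hf, hφψψ]; ring
    · have h1 := hpair φ hφρ hq1
      have h2 := hpair (φ + ψ) hφψρ hq2
      have hcomm : φ + e + ψ = φ + ψ + e := add_right_comm φ e ψ
      refine Finset.mem_filter.2 ⟨Finset.mem_filter.2 ⟨Finset.mem_filter.2 ⟨Finset.mem_univ _, h1.1⟩, h1.2, ?_⟩, ?_⟩
      · rw [hcomm]; exact h2.2
      · have m1 := mul_mul_eq_of_typeRank_eq_eleven hexp h h32 hr ha hb hab ha' hb' hφρ hq1
        have m2 := mul_mul_eq_of_typeRank_eq_eleven hexp h h32 hr ha hb hab ha' hb' hφψρ hq2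
        simp only [← he] at m1 m2
        have m3 := mul_left_cancel₀ hxy0 (m1.trans m2.symm)
        rw [← hφv]
        simp only [hf, hcomm]
        exact transfer_cases_w (hsv φ hq1) (hsv (φ + ψ) hq2) (hsv (φ + e) h1.2) (hsv (φ + ψ + e) h2.2)
          (by simpa only [hcnt] using m3)
  -- sizes
  have hχ₀M : χ₀ ∈ M :=
    Finset.mem_filter.2 ⟨Finset.mem_filter.2 ⟨Finset.mem_univ _, hχ₀⟩, hχ₀', hχ₀ψ⟩
  have hM8 : 8 ≤ M.card := by
    have hpos : 0 < M.card := Finset.card_pos.2 ⟨χ₀, hχ₀M⟩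
    have hne4 : (M.filter fun φ => f φ = 4).Nonempty := by
      rw [← Finset.card_pos]
      have := heq; omega
    have hne4' : (M.filter fun φ => f φ = -4).Nonempty := by
      rw [← Finset.card_pos]
      have := heq; omega
    have h4a := four_le_card_of_stable_w hexp hψ0 he0 hψe (hstab 4) hne4
    have h4b := four_le_card_of_stable_w hexp hψ0 he0 hψe (hstab (-4)) hne4'
    omega
  have hMP : M = O.filter fun χ => cnt χ = 6 ∨ cnt χ = 10 :=
    Finset.eq_of_subset_of_card_le (fun φ hφ => by
      obtain ⟨hφO, hq1, -⟩ := Finset.mem_filter.1 hφ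
      exact Finset.mem_filter.2 ⟨hφO, hq1⟩) (by rw [h8]; exact hM8)
  have hχM : χ ∈ M := by
    rw [hMP]; exact Finset.mem_filter.2 ⟨Finset.mem_filter.2 ⟨Finset.mem_univ _, hχ⟩, hχ'⟩
  exact (Finset.mem_filter.1 hχM).2.2

end Dichotomy

/-! ## §5 ★ The flats: `P` and its complement are closed under triple products -/

section Flats

/-- **★ THE `±4`-CHARACTERS FORM A FLAT**: in rank `11` (order `32`), if `χ₁, χ₂, χ₃` are odd characters with
`Ŝ = ±4` then so is `χ₁χ₂χ₃` — the eight characters with `Ŝ = ±4` form a coset of a subgroup of order `8` of the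
even characters (an affine hyperplane of the odd characters). [cite: Carlet2020, §2.3 (2.51) (p. 61)]
[cite: Kubota1965, §4 Lemma 2] [cite: Dodson1984, §3.1.1 Theorem] -/
theorem add_add_mem_four (hexp : ∀ g : G, g ^ 2 = 1) (h : IsCMTypeWith ρ (T : Set G))
    (h32 : Fintype.card G = 32) (hr : typeRank G (T : Set G) = 11) {χ₁ χ₂ χ₃ : AddChar (Additive G) ℂ}
    (h₁ : χ₁ (Additive.ofMul ρ) = -1) (h₂ : χ₂ (Additive.ofMul ρ) = -1) (h₃ : χ₃ (Additive.ofMul ρ) = -1)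
    (h₁' : (T.filter fun t => χ₁ (Additive.ofMul t) = -1).card = 6 ∨
      (T.filter fun t => χ₁ (Additive.ofMul t) = -1).card = 10)
    (h₂' : (T.filter fun t => χ₂ (Additive.ofMul t) = -1).card = 6 ∨
      (T.filter fun t => χ₂ (Additive.ofMul t) = -1).card = 10)
    (h₃' : (T.filter fun t => χ₃ (Additive.ofMul t) = -1).card = 6 ∨
      (T.filter fun t => χ₃ (Additive.ofMul t) = -1).card = 10) :
    (χ₁ + χ₂ + χ₃) (Additive.ofMul ρ) = -1 ∧
    ((T.filter fun t => (χ₁ + χ₂ + χ₃) (Additive.ofMul t) = -1).card = 6 ∨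
      (T.filter fun t => (χ₁ + χ₂ + χ₃) (Additive.ofMul t) = -1).card = 10) := by
  have hodd : (χ₁ + χ₂ + χ₃) (Additive.ofMul ρ) = -1 := by
    rw [AddChar.add_apply, AddChar.add_apply, h₁, h₂, h₃]; norm_num
  refine ⟨hodd, ?_⟩
  obtain ⟨h2, -, -, -, -⟩ := card_classes_of_typeRank_eq_eleven hexp h h32 hr
  obtain ⟨a, b, hab, hAeq⟩ := Finset.card_eq_two.1 h2
  have ha2 : a ∈ ({a, b} : Finset (AddChar (Additive G) ℂ)) := by simp
  have hb2 : b ∈ ({a, b} : Finset (AddChar (Additive G) ℂ)) := by simp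
  rw [← hAeq] at ha2 hb2
  obtain ⟨haO, ha'⟩ := Finset.mem_filter.1 ha2
  obtain ⟨hbO, hb'⟩ := Finset.mem_filter.1 hb2
  have ha : a (Additive.ofMul ρ) = -1 := (Finset.mem_filter.1 haO).2
  have hb : b (Additive.ofMul ρ) = -1 := (Finset.mem_filter.1 hbO).2
  have hψρ : (χ₁ + χ₂) (Additive.ofMul ρ) = 1 := add_apply_rho_of_odd_w h₁ h₂
  have h12 : χ₁ + (χ₁ + χ₂) = χ₂ := add_add_cancel_left_w hexp χ₁ χ₂
  have key := forall_add_mem_four_of_exists hexp h h32 hr ha hb hab ha' hb' hψρ h₁ h₁' (by rw [h12]; exact h₂')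
    h₃ h₃'
  rwa [show χ₁ + χ₂ + χ₃ = χ₃ + (χ₁ + χ₂) from add_comm _ _]

/-- **Translation by an even `ψ` that does not stabilise `P` maps `P` ONTO its complement** among the odd characters
(`|P| = 8 = 16 − |P|`). [cite: Kubota1965, §4 Lemma 2] [cite: Dodson1984, §3.1.1 Theorem] -/
theorem exists_add_eq_of_forall_not_mem (hexp : ∀ g : G, g ^ 2 = 1) (h : IsCMTypeWith ρ (T : Set G))
    (h32 : Fintype.card G = 32) (hr : typeRank G (T : Set G) = 11) {ψ : AddChar (Additive G) ℂ}
    (hψρ : ψ (Additive.ofMul ρ) = 1)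
    (hnot : ∀ χ : AddChar (Additive G) ℂ, χ (Additive.ofMul ρ) = -1 →
      ((T.filter fun t => χ (Additive.ofMul t) = -1).card = 6 ∨
        (T.filter fun t => χ (Additive.ofMul t) = -1).card = 10) →
      ¬ ((T.filter fun t => (χ + ψ) (Additive.ofMul t) = -1).card = 6 ∨
        (T.filter fun t => (χ + ψ) (Additive.ofMul t) = -1).card = 10))
    {χ' : AddChar (Additive G) ℂ} (hχ' : χ' (Additive.ofMul ρ) = -1)
    (hχ'' : ¬ ((T.filter fun t => χ' (Additive.ofMul t) = -1).card = 6 ∨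
      (T.filter fun t => χ' (Additive.ofMul t) = -1).card = 10)) :
    ∃ χ : AddChar (Additive G) ℂ, χ (Additive.ofMul ρ) = -1 ∧
      ((T.filter fun t => χ (Additive.ofMul t) = -1).card = 6 ∨
        (T.filter fun t => χ (Additive.ofMul t) = -1).card = 10) ∧ χ + ψ = χ' := by
  set O := Finset.univ.filter (fun χ : AddChar (Additive G) ℂ => χ (Additive.ofMul ρ) = -1) with hO
  set cnt : AddChar (Additive G) ℂ → ℕ := fun χ => (T.filter fun s => χ (Additive.ofMul s) = -1).card with hcnt
  obtain ⟨-, h8, -, -, -⟩ := card_classes_of_typeRank_eq_eleven hexp h h32 hr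
  simp only [← hO] at h8
  change (O.filter fun χ => cnt χ = 6 ∨ cnt χ = 10).card = 8 at h8
  set P := O.filter (fun χ => cnt χ = 6 ∨ cnt χ = 10) with hP
  have himg : P.image (fun χ => χ + ψ) ⊆ O.filter fun χ => ¬ (cnt χ = 6 ∨ cnt χ = 10) := by
    intro φ hφ
    obtain ⟨χ, hχ, rfl⟩ := Finset.mem_image.1 hφ
    obtain ⟨hχO, hχP⟩ := Finset.mem_filter.1 hχ
    have hχρ : χ (Additive.ofMul ρ) = -1 := (Finset.mem_filter.1 hχO).2
    exact Finset.mem_filter.2 ⟨Finset.mem_filter.2 ⟨Finset.mem_univ _, add_apply_rho_of_odd_even_w hχρ hψρ⟩,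
      hnot χ hχρ hχP⟩
  have hcard1 : (P.image fun χ => χ + ψ).card = 8 := by
    rw [Finset.card_image_of_injective _ (add_left_injective ψ), h8]
  have hcard2 : (O.filter fun χ => ¬ (cnt χ = 6 ∨ cnt χ = 10)).card = 8 := by
    have := Finset.card_filter_add_card_filter_not (s := O) (fun χ => cnt χ = 6 ∨ cnt χ = 10)
    rw [h8, card_odd_w h h32] at this
    omega
  have hEq := Finset.eq_of_subset_of_card_le himg (by rw [hcard1, hcard2])
  have hmem : χ' ∈ O.filter fun χ => ¬ (cnt χ = 6 ∨ cnt χ = 10) :=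
    Finset.mem_filter.2 ⟨Finset.mem_filter.2 ⟨Finset.mem_univ _, hχ'⟩, hχ''⟩
  rw [← hEq] at hmem
  obtain ⟨χ, hχ, hχeq⟩ := Finset.mem_image.1 hmem
  obtain ⟨hχO, hχP⟩ := Finset.mem_filter.1 hχ
  exact ⟨χ, (Finset.mem_filter.1 hχO).2, hχP, hχeq⟩

/-- **For every even `ψ`: either `Pψ = P` or `Pψ ∩ P = ∅`** (the dichotomy, both halves).
[cite: Kubota1965, §4 Lemma 2] [cite: Dodson1984, §3.1.1 Theorem] [cite: Carlet2020, §2.3 (2.51)] -/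
theorem forall_add_mem_or_forall_not (hexp : ∀ g : G, g ^ 2 = 1) (h : IsCMTypeWith ρ (T : Set G))
    (h32 : Fintype.card G = 32) (hr : typeRank G (T : Set G) = 11) {ψ : AddChar (Additive G) ℂ}
    (hψρ : ψ (Additive.ofMul ρ) = 1) :
    (∀ χ : AddChar (Additive G) ℂ, χ (Additive.ofMul ρ) = -1 →
      ((T.filter fun t => χ (Additive.ofMul t) = -1).card = 6 ∨
        (T.filter fun t => χ (Additive.ofMul t) = -1).card = 10) →
      ((T.filter fun t => (χ + ψ) (Additive.ofMul t) = -1).card = 6 ∨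
        (T.filter fun t => (χ + ψ) (Additive.ofMul t) = -1).card = 10)) ∨
    (∀ χ : AddChar (Additive G) ℂ, χ (Additive.ofMul ρ) = -1 →
      ((T.filter fun t => χ (Additive.ofMul t) = -1).card = 6 ∨
        (T.filter fun t => χ (Additive.ofMul t) = -1).card = 10) →
      ¬ ((T.filter fun t => (χ + ψ) (Additive.ofMul t) = -1).card = 6 ∨
        (T.filter fun t => (χ + ψ) (Additive.ofMul t) = -1).card = 10)) := by
  obtain ⟨h2, -, -, -, -⟩ := card_classes_of_typeRank_eq_eleven hexp h h32 hr
  obtain ⟨a, b, hab, hAeq⟩ := Finset.card_eq_two.1 h2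
  have ha2 : a ∈ ({a, b} : Finset (AddChar (Additive G) ℂ)) := by simp
  have hb2 : b ∈ ({a, b} : Finset (AddChar (Additive G) ℂ)) := by simp
  rw [← hAeq] at ha2 hb2
  obtain ⟨haO, ha'⟩ := Finset.mem_filter.1 ha2
  obtain ⟨hbO, hb'⟩ := Finset.mem_filter.1 hb2
  have ha : a (Additive.ofMul ρ) = -1 := (Finset.mem_filter.1 haO).2
  have hb : b (Additive.ofMul ρ) = -1 := (Finset.mem_filter.1 hbO).2
  by_cases hex : ∃ χ₀ : AddChar (Additive G) ℂ, χ₀ (Additive.ofMul ρ) = -1 ∧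
      ((T.filter fun t => χ₀ (Additive.ofMul t) = -1).card = 6 ∨
        (T.filter fun t => χ₀ (Additive.ofMul t) = -1).card = 10) ∧
      ((T.filter fun t => (χ₀ + ψ) (Additive.ofMul t) = -1).card = 6 ∨
        (T.filter fun t => (χ₀ + ψ) (Additive.ofMul t) = -1).card = 10)
  · obtain ⟨χ₀, hχ₀, hχ₀', hχ₀ψ⟩ := hex
    left
    intro χ hχ hχ'
    exact forall_add_mem_four_of_exists hexp h h32 hr ha hb hab ha' hb' hψρ hχ₀ hχ₀' hχ₀ψ hχ hχ'
  · right
    intro χ hχ hχ' hχψ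
    exact hex ⟨χ, hχ, hχ', hχψ⟩

/-- **★ THE COMPLEMENT IS A FLAT TOO**: if `χ₁, χ₂, χ₃` are odd characters NONE of which has `Ŝ = ±4` (so each is a
Weil character or one of `a, b`), then `χ₁χ₂χ₃` is odd and again has `Ŝ ≠ ±4` — **the six Weil characters together
with `a, b` form an affine hyperplane of the odd characters.** [cite: Carlet2020, §2.3 (2.51) (p. 61)]
[cite: Kubota1965, §4 Lemma 2] [cite: Dodson1984, §3.1.1 Theorem] [cite: MoonenZarhin1998WeilClasses, Criterion (Q1)] -/
theorem add_add_not_mem_four (hexp : ∀ g : G, g ^ 2 = 1) (h : IsCMTypeWith ρ (T : Set G))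
    (h32 : Fintype.card G = 32) (hr : typeRank G (T : Set G) = 11) {χ₁ χ₂ χ₃ : AddChar (Additive G) ℂ}
    (h₁ : χ₁ (Additive.ofMul ρ) = -1) (h₂ : χ₂ (Additive.ofMul ρ) = -1) (h₃ : χ₃ (Additive.ofMul ρ) = -1)
    (h₁' : ¬ ((T.filter fun t => χ₁ (Additive.ofMul t) = -1).card = 6 ∨
      (T.filter fun t => χ₁ (Additive.ofMul t) = -1).card = 10))
    (h₂' : ¬ ((T.filter fun t => χ₂ (Additive.ofMul t) = -1).card = 6 ∨
      (T.filter fun t => χ₂ (Additive.ofMul t) = -1).card = 10))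
    (h₃' : ¬ ((T.filter fun t => χ₃ (Additive.ofMul t) = -1).card = 6 ∨
      (T.filter fun t => χ₃ (Additive.ofMul t) = -1).card = 10)) :
    (χ₁ + χ₂ + χ₃) (Additive.ofMul ρ) = -1 ∧
    ¬ ((T.filter fun t => (χ₁ + χ₂ + χ₃) (Additive.ofMul t) = -1).card = 6 ∨
      (T.filter fun t => (χ₁ + χ₂ + χ₃) (Additive.ofMul t) = -1).card = 10) := by
  have hodd : (χ₁ + χ₂ + χ₃) (Additive.ofMul ρ) = -1 := by
    rw [AddChar.add_apply, AddChar.add_apply, h₁, h₂, h₃]; norm_num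
  refine ⟨hodd, ?_⟩
  have hψρ : (χ₁ + χ₂) (Additive.ofMul ρ) = 1 := add_apply_rho_of_odd_w h₁ h₂
  rcases forall_add_mem_or_forall_not hexp h h32 hr hψρ with hall | hnone
  · -- `ψ = χ₁χ₂` stabilises `P`: `χ₁χ₂χ₃ ∈ P` would give `χ₃ = χ₁χ₂χ₃·ψ ∈ P`
    intro hin
    have := hall (χ₁ + χ₂ + χ₃) hodd hin
    rw [show χ₁ + χ₂ + χ₃ + (χ₁ + χ₂) = χ₃ by rw [add_comm, ← add_assoc, add_self_eq_zero_char hexp, zero_add]]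
      at this
    exact h₃' this
  · -- `ψ` moves `P` onto the complement, which contains `χ₁`: `χ₁ = χψ`, `χ = χ₂ ∈ P` — absurd
    exfalso
    obtain ⟨χ, -, hχP, hχeq⟩ := exists_add_eq_of_forall_not_mem hexp h h32 hr hψρ hnone h₁ h₁'
    have : χ = χ₂ := by
      have := congrArg (· + (χ₁ + χ₂)) hχeq
      simp only [add_add_cancel_right_w hexp] at this
      rw [this, add_add_cancel_left_w hexp]
    rw [this] at hχP
    exact h₂' hχP

end Flats

/-! ## §6 ★ The element `g₀`: the `±4`-characters are exactly the odd characters with `χ(g₀) = −1` -/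

section Element

/-- **★ THE STRUCTURE THEOREM (element form).**  For a CM type of Kubota rank `11` on `(ℤ/2)⁵` there is an element
`g₀ ∉ {1, ρ}` such that **an odd character `χ` has `Ŝ(χ) = ±4` iff `χ(g₀) = −1`**; equivalently the six Weil
characters (`Ŝ = 0`) and the two characters with `Ŝ = ±8` are exactly the odd characters trivial at `g₀` — an affine
hyperplane of the odd characters.  (The stabiliser `S = {ψ even : Pψ = P}` of the flat `P` is a subgroup of order `8`
of `Ĝ`; Pontryagin duality gives `|S^⊥| = 4 ⊋ {1, ρ}`, tree `card_filter_mem_mul_card_annihilator_eq`, and a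
`g₀ ∈ S^⊥ ∖ {1, ρ}` works, after replacing it by `ρg₀` if necessary.)  In Boolean terms: the Walsh support of a
`5`-variable Boolean function of CM type with exactly `10` non-zero Walsh coefficients is the complement of an affine
hyperplane plus two of its points. [cite: Kubota1965, §4 Lemma 2] [cite: Dodson1984, §3.1.1 Theorem]
[cite: Carlet2020, §2.3 (2.51) (p. 61)] [cite: Brzezinski2018, Appendix Thm. A.12.1 and Lemma A.12.2] -/
theorem exists_forall_four_iff_apply_eq (hexp : ∀ g : G, g ^ 2 = 1) (h : IsCMTypeWith ρ (T : Set G))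
    (h32 : Fintype.card G = 32) (hr : typeRank G (T : Set G) = 11) :
    ∃ g₀ : G, g₀ ≠ 1 ∧ g₀ ≠ ρ ∧ ∀ χ : AddChar (Additive G) ℂ, χ (Additive.ofMul ρ) = -1 →
      (((T.filter fun t => χ (Additive.ofMul t) = -1).card = 6 ∨
        (T.filter fun t => χ (Additive.ofMul t) = -1).card = 10) ↔ χ (Additive.ofMul g₀) = -1) := by
  set O := Finset.univ.filter (fun χ : AddChar (Additive G) ℂ => χ (Additive.ofMul ρ) = -1) with hO
  set cnt : AddChar (Additive G) ℂ → ℕ := fun χ => (T.filter fun s => χ (Additive.ofMul s) = -1).card with hcnt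
  obtain ⟨-, h8, -, -, -⟩ := card_classes_of_typeRank_eq_eleven hexp h h32 hr
  simp only [← hO] at h8
  change (O.filter fun χ => cnt χ = 6 ∨ cnt χ = 10).card = 8 at h8
  set P := O.filter (fun χ => cnt χ = 6 ∨ cnt χ = 10) with hP
  have hρ2 := rho_mul_rho_w h
  -- membership in `P`, unfolded
  have hPiff : ∀ χ : AddChar (Additive G) ℂ, χ ∈ P ↔ χ (Additive.ofMul ρ) = -1 ∧ (cnt χ = 6 ∨ cnt χ = 10) := by
    intro χ; simp only [hP, hO, Finset.mem_filter, Finset.mem_univ, true_and]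
  -- the flat property
  have hflat : ∀ χ₁ ∈ P, ∀ χ₂ ∈ P, ∀ χ₃ ∈ P, χ₁ + χ₂ + χ₃ ∈ P := by
    intro χ₁ h1 χ₂ h2 χ₃ h3
    rw [hPiff] at h1 h2 h3 ⊢
    exact add_add_mem_four hexp h h32 hr h1.1 h2.1 h3.1 h1.2 h2.2 h3.2
  -- a base point
  obtain ⟨π₁, hπ₁⟩ : P.Nonempty := by rw [← Finset.card_pos, h8]; norm_num
  have hπ₁ρ : π₁ (Additive.ofMul ρ) = -1 := ((hPiff π₁).1 hπ₁).1
  -- the stabiliser `S` of `P` among the even characters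
  let S : AddSubgroup (AddChar (Additive G) ℂ) :=
    { carrier := {ψ | ψ (Additive.ofMul ρ) = 1 ∧ ∀ χ ∈ P, χ + ψ ∈ P}
      zero_mem' := ⟨by rw [AddChar.zero_apply], fun χ hχ => by rwa [add_zero]⟩
      add_mem' := fun {ψ₁ ψ₂} h1 h2 => ⟨by rw [AddChar.add_apply, h1.1, h2.1, one_mul],
        fun χ hχ => by rw [← add_assoc]; exact h2.2 _ (h1.2 χ hχ)⟩
      neg_mem' := fun {ψ} hψ => by
        have hneg : -ψ = ψ := by
          rw [neg_eq_iff_add_eq_zero, add_self_eq_zero_char hexp]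
        rw [hneg]; exact hψ }
  have hSmem : ∀ ψ : AddChar (Additive G) ℂ, ψ ∈ S ↔ ψ (Additive.ofMul ρ) = 1 ∧ ∀ χ ∈ P, χ + ψ ∈ P :=
    fun ψ => Iff.rfl
  -- `π₁ + χ ∈ S` for `χ ∈ P`
  have hπS : ∀ χ ∈ P, π₁ + χ ∈ S := by
    intro χ hχ
    rw [hSmem]
    refine ⟨add_apply_rho_of_odd_w hπ₁ρ ((hPiff χ).1 hχ).1, fun χ' hχ' => ?_⟩
    rw [← add_assoc]; exact hflat χ' hχ' π₁ hπ₁ χ hχ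
  -- `|S| = 8` via `ψ ↦ π₁ + ψ : S → P`
  have hScard : (Finset.univ.filter fun ψ : AddChar (Additive G) ℂ => ψ ∈ S).card = 8 := by
    rw [← h8]
    refine Finset.card_bij (fun ψ _ => π₁ + ψ) (fun ψ hψ => ?_) (fun ψ₁ _ ψ₂ _ h12 => add_left_cancel h12)
      (fun χ hχ => ⟨π₁ + χ, ?_, add_add_cancel_left_w hexp π₁ χ⟩)
    · exact ((hSmem ψ).1 (Finset.mem_filter.1 hψ).2).2 π₁ hπ₁
    · exact Finset.mem_filter.2 ⟨Finset.mem_univ _, hπS χ hχ⟩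
  -- the annihilator of `S` has four elements, among them `1, ρ`; pick `g₀` outside `{1, ρ}`
  have hann := card_filter_mem_mul_card_annihilator_eq (G := G) S
  rw [hScard, h32] at hann
  have hann4 : (Finset.univ.filter fun g : G => ∀ χ ∈ S, χ (Additive.ofMul g) = 1).card = 4 := by omega
  obtain ⟨g₀, hg₀, hg₀'⟩ : ∃ g₀ ∈ (Finset.univ.filter fun g : G => ∀ χ ∈ S, χ (Additive.ofMul g) = 1),
      g₀ ∉ ({1, ρ} : Finset G) :=
    Finset.exists_mem_notMem_of_card_lt_card (by
      rw [hann4]; exact (Finset.card_le_two).trans_lt (by norm_num))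
  simp only [Finset.mem_insert, Finset.mem_singleton, not_or] at hg₀'
  have hg₀S : ∀ ψ ∈ S, ψ (Additive.ofMul g₀) = 1 := (Finset.mem_filter.1 hg₀).2
  set ε := π₁ (Additive.ofMul g₀) with hε
  have hε1 : ε = 1 ∨ ε = -1 := char_eq_one_or_w hexp π₁ g₀
  -- (→) members of `P` take the value `ε` at `g₀`
  have hfwd : ∀ χ ∈ P, χ (Additive.ofMul g₀) = ε := by
    intro χ hχ
    have h1 := hg₀S _ (hπS χ hχ)
    rw [AddChar.add_apply, ← hε] at h1
    rcases hε1 with h2 | h2 <;> rw [h2] at h1 ⊢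
    · simpa using h1
    · linear_combination -h1
  -- two even characters outside `S` differ by an element of `S`
  have hSS : ∀ ψ ψ₁ : AddChar (Additive G) ℂ, ψ (Additive.ofMul ρ) = 1 → ψ₁ (Additive.ofMul ρ) = 1 →
      ψ ∉ S → ψ₁ ∉ S → ψ + ψ₁ ∈ S := by
    intro ψ ψ₁ hψρ hψ₁ρ hψS hψ₁S
    rw [hSmem]
    refine ⟨by rw [AddChar.add_apply, hψρ, hψ₁ρ, one_mul], fun χ' hχ' => ?_⟩
    -- neither `ψ` nor `ψ₁` stabilises `P`: both move `P` onto the complement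
    have hnone : ∀ φ : AddChar (Additive G) ℂ, φ ∉ S → φ (Additive.ofMul ρ) = 1 →
        ∀ χ : AddChar (Additive G) ℂ, χ (Additive.ofMul ρ) = -1 → (cnt χ = 6 ∨ cnt χ = 10) →
          ¬ (cnt (χ + φ) = 6 ∨ cnt (χ + φ) = 10) := by
      intro φ hφS hφρ
      rcases forall_add_mem_or_forall_not hexp h h32 hr hφρ with hall | hno
      · exfalso; apply hφS
        rw [hSmem]
        refine ⟨hφρ, fun χ hχ => ?_⟩
        rw [hPiff] at hχ ⊢
        exact ⟨add_apply_rho_of_odd_even_w hχ.1 hφρ, hall χ hχ.1 hχ.2⟩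
      · exact hno
    obtain ⟨hχ'ρ, hχ'P⟩ := (hPiff χ').1 hχ'
    have hout : ¬ (cnt (χ' + ψ) = 6 ∨ cnt (χ' + ψ) = 10) := hnone ψ hψS hψρ χ' hχ'ρ hχ'P
    obtain ⟨χ'', hχ''ρ, hχ''P, hχ''eq⟩ := exists_add_eq_of_forall_not_mem hexp h h32 hr hψ₁ρ
      (hnone ψ₁ hψ₁S hψ₁ρ) (add_apply_rho_of_odd_even_w hχ'ρ hψρ) hout
    rw [hPiff]
    refine ⟨add_apply_rho_of_odd_even_w hχ'ρ (by rw [AddChar.add_apply, hψρ, hψ₁ρ, one_mul]), ?_⟩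
    have : χ' + (ψ + ψ₁) = χ'' := by
      rw [← add_assoc, ← hχ''eq, add_add_cancel_right_w hexp]
    rw [this]; exact hχ''P
  -- (←) an odd character outside `P` does not take the value `ε` at `g₀`
  have hbwd : ∀ χ : AddChar (Additive G) ℂ, χ (Additive.ofMul ρ) = -1 → χ ∉ P → χ (Additive.ofMul g₀) ≠ ε := by
    intro χ hχρ hχP hχε
    set ψ₁ := π₁ + χ with hψ₁
    have hψ₁ρ : ψ₁ (Additive.ofMul ρ) = 1 := add_apply_rho_of_odd_w hπ₁ρ hχρ
    have hψ₁S : ψ₁ ∉ S := fun hS => hχP (by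
      have := ((hSmem ψ₁).1 hS).2 π₁ hπ₁
      rwa [hψ₁, add_add_cancel_left_w hexp] at this)
    have hψ₁g : ψ₁ (Additive.ofMul g₀) = 1 := by
      rw [hψ₁, AddChar.add_apply, ← hε, hχε]
      rcases hε1 with h1 | h1 <;> rw [h1] <;> norm_num
    -- every even character is trivial at `g₀`
    have heven : ∀ ψ : AddChar (Additive G) ℂ, ψ (Additive.ofMul ρ) = 1 → ψ (Additive.ofMul g₀) = 1 := by
      intro ψ hψρ
      by_cases hψS : ψ ∈ S
      · exact hg₀S ψ hψS
      · have h1 := hg₀S _ (hSS ψ ψ₁ hψρ hψ₁ρ hψS hψ₁S)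
        rw [AddChar.add_apply, hψ₁g, mul_one] at h1
        exact h1
    -- every odd character takes the value `ε` at `g₀`
    have hoddv : ∀ φ : AddChar (Additive G) ℂ, φ (Additive.ofMul ρ) = -1 → φ (Additive.ofMul g₀) = ε := by
      intro φ hφρ
      have h1 := heven (π₁ + φ) (add_apply_rho_of_odd_w hπ₁ρ hφρ)
      rw [AddChar.add_apply, ← hε] at h1
      rcases hε1 with h2 | h2 <;> rw [h2] at h1 ⊢
      · simpa using h1
      · linear_combination -h1
    rcases hε1 with h2 | h2
    · -- all characters trivial at `g₀` ⟹ `g₀ = 1`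
      apply hg₀'.1
      have hall : ∀ φ : AddChar (Additive G) ℂ, φ (Additive.ofMul g₀) = 1 := by
        intro φ
        rcases character_apply_eq_one_or_of_mul_self φ hρ2 with h3 | h3
        · exact heven φ h3
        · rw [hoddv φ h3, h2]
      have := (AddChar.forall_apply_eq_zero (α := Additive G) (a := Additive.ofMul g₀)).1 hall
      exact this
    · -- all characters agree at `g₀` and `ρ` ⟹ `g₀ = ρ`
      apply hg₀'.2
      have hall : ∀ φ : AddChar (Additive G) ℂ, φ (Additive.ofMul (ρ * g₀)) = 1 := by
        intro φ
        rw [char_mul_w]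
        rcases character_apply_eq_one_or_of_mul_self φ hρ2 with h3 | h3
        · rw [h3, heven φ h3, one_mul]
        · rw [h3, hoddv φ h3, h2]; norm_num
      have h1 : ρ * g₀ = 1 := (AddChar.forall_apply_eq_zero (α := Additive G) (a := Additive.ofMul (ρ * g₀))).1 hall
      have := congrArg (ρ * ·) h1
      simp only [← mul_assoc, hρ2, one_mul, mul_one] at this
      exact this
  -- normalise: `g₁ = g₀` if `ε = −1`, else `g₁ = ρ g₀`
  rcases hε1 with h2 | h2
  · refine ⟨ρ * g₀, ?_, ?_, fun χ hχρ => ?_⟩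
    · intro h1
      apply hg₀'.2
      have := congrArg (ρ * ·) h1
      simp only [← mul_assoc, hρ2, one_mul, mul_one] at this
      exact this
    · intro h1
      apply hg₀'.1
      have := congrArg (ρ * ·) h1
      simp only [← mul_assoc, hρ2, one_mul] at this
      exact this
    · rw [char_mul_w, hχρ]
      constructor
      · intro hχ
        rw [hfwd χ ((hPiff χ).2 ⟨hχρ, hχ⟩), h2]; norm_num
      · intro hval
        by_contra hχ
        have hne := hbwd χ hχρ (fun hP' => hχ ((hPiff χ).1 hP').2)
        rw [h2] at hne
        rcases char_eq_one_or_w hexp χ g₀ with h3 | h3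
        · exact hne h3
        · rw [h3] at hval; norm_num at hval
  · refine ⟨g₀, hg₀'.1, hg₀'.2, fun χ hχρ => ?_⟩
    constructor
    · intro hχ
      rw [hfwd χ ((hPiff χ).2 ⟨hχρ, hχ⟩), h2]
    · intro hval
      by_contra hχ
      have hne := hbwd χ hχρ (fun hP' => hχ ((hPiff χ).1 hP').2)
      rw [h2] at hne
      exact hne hval

end Element

/-! ## §7 ★★ The balanced subgroups of index `8` avoiding `ρ`: exactly three (the Weil CM subfields of degree `8`) -/

section IndexEight

omit [Fintype G] [DecidableEq G] in
/-- `g ∈ H ⊔ ⟨c⟩ ⟺ g ∈ H ∨ cg ∈ H` in exponent `2`. [folklore] -/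
private theorem mem_sup_zpowers_iff_w (hexp : ∀ g : G, g ^ 2 = 1) (H : Subgroup G) (c g : G) :
    g ∈ H ⊔ Subgroup.zpowers c ↔ g ∈ H ∨ c * g ∈ H := by
  constructor
  · intro hg
    obtain ⟨y, hy, z, hz, rfl⟩ := Subgroup.mem_sup.1 hg
    obtain ⟨k, rfl⟩ := Subgroup.mem_zpowers_iff.1 hz
    rcases Int.even_or_odd k with ⟨j, rfl⟩ | ⟨j, rfl⟩
    · left
      have : c ^ (j + j) = 1 := by
        rw [← two_mul, zpow_mul, zpow_ofNat, hexp c, one_zpow]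
      rw [this, mul_one]; exact hy
    · right
      have : c ^ (2 * j + 1) = c := by
        rw [zpow_add, zpow_mul, zpow_ofNat, hexp c, one_zpow, one_mul, zpow_one]
      rw [this, mul_left_comm, mul_self_w hexp, mul_one]; exact hy
  · rintro (hg | hg)
    · exact Subgroup.mem_sup_left hg
    · have : g = (c * g) * c := by rw [mul_comm, ← mul_assoc, mul_self_w hexp, one_mul]
      rw [this]
      exact Subgroup.mul_mem _ (Subgroup.mem_sup_left hg) (Subgroup.mem_sup_right (Subgroup.mem_zpowers c))

omit [DecidableEq G] in
/-- `|H ⊔ ⟨c⟩| = 2|H|` for `c ∉ H` (exponent `2`). [folklore] -/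
private theorem natCard_sup_zpowers_w (hexp : ∀ g : G, g ^ 2 = 1) (H : Subgroup G) {c : G} (hc : c ∉ H) :
    Nat.card ↥(H ⊔ Subgroup.zpowers c) = 2 * Nat.card H := by
  classical
  have hH : Nat.card H = (Finset.univ.filter fun g : G => g ∈ H).card := by
    rw [Nat.card_eq_fintype_card, ← Fintype.card_subtype]
  have hH' : Nat.card ↥(H ⊔ Subgroup.zpowers c) =
      (Finset.univ.filter fun g : G => g ∈ H ⊔ Subgroup.zpowers c).card := by
    rw [Nat.card_eq_fintype_card, ← Fintype.card_subtype]
  rw [hH, hH']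
  have hunion : (Finset.univ.filter fun g : G => g ∈ H ⊔ Subgroup.zpowers c) =
      (Finset.univ.filter fun g : G => g ∈ H) ∪
        (Finset.univ.filter fun g : G => g ∈ H).image fun k => c * k := by
    ext g
    simp only [Finset.mem_filter, Finset.mem_univ, true_and, Finset.mem_union, Finset.mem_image,
      mem_sup_zpowers_iff_w hexp]
    constructor
    · rintro (hg | hg)
      · exact Or.inl hg
      · exact Or.inr ⟨c * g, hg, by rw [← mul_assoc, mul_self_w hexp, one_mul]⟩
    · rintro (hg | ⟨k, hk, rfl⟩)
      · exact Or.inl hg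
      · right; rwa [← mul_assoc, mul_self_w hexp, one_mul]
  have hdisj : Disjoint (Finset.univ.filter fun g : G => g ∈ H)
      ((Finset.univ.filter fun g : G => g ∈ H).image fun k => c * k) := by
    rw [Finset.disjoint_left]
    rintro g hg hg'
    simp only [Finset.mem_filter, Finset.mem_univ, true_and, Finset.mem_image] at hg hg'
    obtain ⟨k, hk, rfl⟩ := hg'
    exact hc (by simpa using H.mul_mem hg (H.inv_mem hk))
  rw [hunion, Finset.card_union_of_disjoint hdisj,
    Finset.card_image_of_injective _ (fun a b hab => mul_left_cancel hab)]
  ring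

omit [Fintype G] [DecidableEq G] in
/-- `⟨g₀⟩ = {1, g₀}` in exponent `2`. [folklore] -/
private theorem mem_zpowers_iff_w (hexp : ∀ g : G, g ^ 2 = 1) (g₀ y : G) :
    y ∈ Subgroup.zpowers g₀ ↔ y = 1 ∨ y = g₀ := by
  have := mem_sup_zpowers_iff_w hexp ⊥ g₀ y
  rw [bot_sup_eq] at this
  rw [this, Subgroup.mem_bot, Subgroup.mem_bot]
  constructor
  · rintro (h1 | h1)
    · exact Or.inl h1
    · right
      have := congrArg (g₀ * ·) h1
      simp only [← mul_assoc, mul_self_w hexp, one_mul, mul_one] at this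
      exact this
  · rintro (rfl | rfl)
    · exact Or.inl rfl
    · exact Or.inr (mul_self_w hexp _)

omit [DecidableEq G] in
/-- An index-`4` subgroup avoiding `ρ` has an index-`2` overgroup avoiding `ρ` (tree
`exists_eq_inf_of_index_eq_four`). [cite: MontgomeryVaughan2007, §4.2 Lemma 4.2 (p. 115)] -/
private theorem exists_indexTwo_of_index_four_w (hexp : ∀ g : G, g ^ 2 = 1) {K : Subgroup G} (hK : K.index = 4)
    (hρ : ρ ∉ K) : ∃ M : Subgroup G, K ≤ M ∧ M.index = 2 ∧ ρ ∉ M := by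
  obtain ⟨H₁, H₂, h1, -, -, hρ1, -, heq⟩ := BalancedCosets.exists_eq_inf_of_index_eq_four hexp hK hρ
  exact ⟨H₁, heq ▸ inf_le_left, h1, hρ1⟩

omit [DecidableEq G] in
/-- An index-`8` subgroup avoiding `ρ` has an index-`2` overgroup avoiding `ρ` (`|G| = 32`).
[cite: MontgomeryVaughan2007, §4.2 Lemma 4.2 (p. 115)] -/
private theorem exists_indexTwo_of_index_eight_w (hexp : ∀ g : G, g ^ 2 = 1) (h32 : Fintype.card G = 32)
    {H : Subgroup G} (hH : H.index = 8) (hρ : ρ ∉ H) : ∃ M : Subgroup G, H ≤ M ∧ M.index = 2 ∧ ρ ∉ M := by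
  have hcard : Nat.card H = 4 := by
    have := H.card_mul_index; rw [hH, Nat.card_eq_fintype_card (α := G), h32] at this; omega
  obtain ⟨x, hx⟩ : ∃ x : G, x ∉ H ⊔ Subgroup.zpowers ρ := by
    by_contra hall
    push Not at hall
    have htop : H ⊔ Subgroup.zpowers ρ = ⊤ := (Subgroup.eq_top_iff' _).2 hall
    have := natCard_sup_zpowers_w hexp H hρ
    rw [htop, Subgroup.card_top, Nat.card_eq_fintype_card (α := G), h32, hcard] at this
    omega
  rw [mem_sup_zpowers_iff_w hexp] at hx
  push Not at hx
  have hK : (H ⊔ Subgroup.zpowers x).index = 4 := by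
    have h1 := (H ⊔ Subgroup.zpowers x).card_mul_index
    rw [natCard_sup_zpowers_w hexp H hx.1, hcard, Nat.card_eq_fintype_card (α := G), h32] at h1
    omega
  have hρK : ρ ∉ H ⊔ Subgroup.zpowers x := by
    rw [mem_sup_zpowers_iff_w hexp]
    push Not
    refine ⟨hρ, fun h1 => hx.2 ?_⟩
    rwa [mul_comm] at h1
  obtain ⟨M, hle, hM, hρM⟩ := exists_indexTwo_of_index_four_w hexp hK hρK
  exact ⟨M, le_sup_left.trans hle, hM, hρM⟩

omit [Fintype G] [DecidableEq G] in
/-- `G/M` is cyclic for `M` of index `2`. [folklore] -/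
private theorem isCyclic_quotient_w {M : Subgroup G} (hidx : M.index = 2) : IsCyclic (G ⧸ M) := by
  haveI : Fact (Nat.Prime 2) := ⟨Nat.prime_two⟩
  exact isCyclic_of_prime_card (p := 2) (by rw [← Subgroup.index_eq_card, hidx])

/-- **★★ THE BALANCED SUBGROUPS OF INDEX `8`**: in rank `11` (order `32`), with `a ≠ b` the two odd characters with
`Ŝ = ±8` and `g₀` the element of the structure theorem (`Ŝ(χ) = ±4 ⟺ χ(g₀) = −1` for odd `χ`), a subgroup `H ∌ ρ`
of index `8` has ALL ITS COSETS `T`-BALANCED (`2·#(T ∩ xH) = |H|` for every `x`) **iff `g₀ ∈ H` and both `a` and `b`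
are non-trivial on `H`**.  Field side (Moonen–Zarhin Criterion (Q1)): the CM type of a multiquadratic CM field of
degree `32` and rank `11` is of Weil type over the CM subfield `L = K^H` of degree `8` iff `g₀ ∈ Gal(K/L)` and `L` is
not contained in the kernel fields of `a, b`. [cite: MoonenZarhin1998WeilClasses, Criterion (Q1)]
[cite: Kubota1965, §4 Lemma 2] [cite: Dodson1984, §3.1.1 Theorem] [cite: MontgomeryVaughan2007, §4.2 Lemma 4.2] -/
theorem forall_coset_iff_of_index_eight (hexp : ∀ g : G, g ^ 2 = 1) (h : IsCMTypeWith ρ (T : Set G))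
    (h32 : Fintype.card G = 32) (hr : typeRank G (T : Set G) = 11) {a b : AddChar (Additive G) ℂ}
    (ha : a (Additive.ofMul ρ) = -1) (hb : b (Additive.ofMul ρ) = -1) (hab : a ≠ b)
    (ha' : (T.filter fun t => a (Additive.ofMul t) = -1).card = 4 ∨
      (T.filter fun t => a (Additive.ofMul t) = -1).card = 12)
    (hb' : (T.filter fun t => b (Additive.ofMul t) = -1).card = 4 ∨
      (T.filter fun t => b (Additive.ofMul t) = -1).card = 12)
    {g₀ : G} (hg₀ : ∀ χ : AddChar (Additive G) ℂ, χ (Additive.ofMul ρ) = -1 →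
      (((T.filter fun t => χ (Additive.ofMul t) = -1).card = 6 ∨
        (T.filter fun t => χ (Additive.ofMul t) = -1).card = 10) ↔ χ (Additive.ofMul g₀) = -1))
    {H : Subgroup G} (hH : H.index = 8) (hρ : ρ ∉ H) :
    (∀ x : G, 2 * (T.filter fun t => x * t ∈ H).card = Nat.card H) ↔
      g₀ ∈ H ∧ (∃ k ∈ H, a (Additive.ofMul k) = -1) ∧ (∃ k ∈ H, b (Additive.ofMul k) = -1) := by
  rw [BalancedCosets.forall_coset_iff_forall_oddChar hexp h H]
  have hρ2 := rho_mul_rho_w h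
  obtain ⟨h2, -, -, -, -⟩ := card_classes_of_typeRank_eq_eleven hexp h h32 hr
  have hAab : ∀ φ : AddChar (Additive G) ℂ, φ (Additive.ofMul ρ) = -1 →
      ((T.filter fun t => φ (Additive.ofMul t) = -1).card = 4 ∨
        (T.filter fun t => φ (Additive.ofMul t) = -1).card = 12) → φ = a ∨ φ = b := fun φ hφ hφ' =>
    mem_pair_of_card_two_w h2 (Finset.mem_filter.2 ⟨Finset.mem_filter.2 ⟨Finset.mem_univ _, ha⟩, ha'⟩)
      (Finset.mem_filter.2 ⟨Finset.mem_filter.2 ⟨Finset.mem_univ _, hb⟩, hb'⟩) hab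
      (Finset.mem_filter.2 ⟨Finset.mem_filter.2 ⟨Finset.mem_univ _, hφ⟩, hφ'⟩)
  -- an odd character with kernel an index-`2` overgroup `M ⊇ K` of a subgroup `K ∌ ρ` of index `4`
  have hchar : ∀ M : Subgroup G, M.index = 2 → ρ ∉ M →
      ∃ χ : AddChar (Additive G) ℂ, χ (Additive.ofMul ρ) = -1 ∧ ∀ g : G, χ (Additive.ofMul g) = 1 ↔ g ∈ M :=
    fun M hM hρM => exists_oddChar_ker hρM hρ2 (isCyclic_quotient_w hM)
  constructor
  · intro hV
    -- (1) the Weil characters trivial on `H` are trivial at `g₀`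
    have hC : ∀ χ : AddChar (Additive G) ℂ, χ (Additive.ofMul ρ) = -1 → (∀ k ∈ H, χ (Additive.ofMul k) = 1) →
        χ (Additive.ofMul g₀) = 1 := by
      intro χ hχ hχH
      have h8 := (sum_char_eq_zero_iff_card_eq_eight hexp h h32 χ).1 (hV χ hχ hχH)
      have hnP : ¬ ((T.filter fun t => χ (Additive.ofMul t) = -1).card = 6 ∨
          (T.filter fun t => χ (Additive.ofMul t) = -1).card = 10) := by omega
      rw [hg₀ χ hχ] at hnP
      exact (char_eq_one_or_w hexp χ g₀).resolve_right hnP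
    refine ⟨?_, ?_, ?_⟩
    · by_contra hg
      by_cases hρg : ρ * g₀ ∈ H
      · obtain ⟨M, hle, hM, hρM⟩ := exists_indexTwo_of_index_eight_w hexp h32 hH hρ
        obtain ⟨χ, hχρ, hker⟩ := hchar M hM hρM
        have h1 := hC χ hχρ fun k hk => (hker k).2 (hle hk)
        have h2 := (hker (ρ * g₀)).2 (hle hρg)
        rw [char_mul_w, hχρ, h1] at h2
        norm_num at h2
      · have hcardH : Nat.card H = 4 := by
          have := H.card_mul_index; rw [hH, Nat.card_eq_fintype_card (α := G), h32] at this; omega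
        have hK : (H ⊔ Subgroup.zpowers (ρ * g₀)).index = 4 := by
          have h1 := (H ⊔ Subgroup.zpowers (ρ * g₀)).card_mul_index
          rw [natCard_sup_zpowers_w hexp H hρg, hcardH, Nat.card_eq_fintype_card (α := G), h32] at h1
          omega
        have hρK : ρ ∉ H ⊔ Subgroup.zpowers (ρ * g₀) := by
          rw [mem_sup_zpowers_iff_w hexp]
          push Not
          refine ⟨hρ, fun h1 => hg ?_⟩
          rwa [mul_right_comm, hρ2, one_mul] at h1
        obtain ⟨M, hle, hM, hρM⟩ := exists_indexTwo_of_index_four_w hexp hK hρK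
        obtain ⟨χ, hχρ, hker⟩ := hchar M hM hρM
        have h1 := hC χ hχρ fun k hk => (hker k).2 (hle (Subgroup.mem_sup_left hk))
        have h2 := (hker (ρ * g₀)).2 (hle (Subgroup.mem_sup_right (Subgroup.mem_zpowers _)))
        rw [char_mul_w, hχρ, h1] at h2
        norm_num at h2
    · by_contra hna
      push Not at hna
      have htriv : ∀ k ∈ H, a (Additive.ofMul k) = 1 := fun k hk =>
        (char_eq_one_or_w hexp a k).resolve_right (hna k hk)
      have := (sum_char_eq_zero_iff_card_eq_eight hexp h h32 a).1 (hV a ha htriv)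
      omega
    · by_contra hnb
      push Not at hnb
      have htriv : ∀ k ∈ H, b (Additive.ofMul k) = 1 := fun k hk =>
        (char_eq_one_or_w hexp b k).resolve_right (hnb k hk)
      have := (sum_char_eq_zero_iff_card_eq_eight hexp h h32 b).1 (hV b hb htriv)
      omega
  · rintro ⟨hg, ⟨k₁, hk₁, hak⟩, ⟨k₂, hk₂, hbk⟩⟩ χ hχ hχH
    rw [sum_char_eq_zero_iff_card_eq_eight hexp h h32 χ]
    have hg1 := hχH g₀ hg
    have hnP : ¬ ((T.filter fun t => χ (Additive.ofMul t) = -1).card = 6 ∨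
        (T.filter fun t => χ (Additive.ofMul t) = -1).card = 10) := by
      rw [hg₀ χ hχ, hg1]; norm_num
    rcases card_filter_mem_of_typeRank_eq_eleven hexp h h32 hr hχ with hc | hc | hc
    · exfalso
      rcases hAab χ hχ hc with rfl | rfl
      · have := hχH k₁ hk₁; rw [hak] at this; norm_num at this
      · have := hχH k₂ hk₂; rw [hbk] at this; norm_num at this
    · exact absurd hc hnP
    · exact hc

end IndexEight

section Count

omit [DecidableEq G] in
/-- **`8·#{g : a(g) = −1, b(g) = −1, c(g) = 1} = |G|`** for three characters of a group of exponent `2` all of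
whose seven non-empty products are non-trivial (expand `Σ_g (1 − a(g))(1 − b(g))(1 + c(g))`).
[cite: Kubota1965, §4 Lemma 2 (proof)] -/
private theorem eight_mul_card_filter_three_w (hexp : ∀ g : G, g ^ 2 = 1) {a b c : AddChar (Additive G) ℂ}
    (h1 : a ≠ 0) (h2 : b ≠ 0) (h3 : c ≠ 0) (h4 : a + b ≠ 0) (h5 : a + c ≠ 0) (h6 : b + c ≠ 0)
    (h7 : a + b + c ≠ 0) :
    8 * (Finset.univ.filter fun g : G =>
      a (Additive.ofMul g) = -1 ∧ b (Additive.ofMul g) = -1 ∧ c (Additive.ofMul g) = 1).card = Fintype.card G := by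
  have hkey : ∀ g : G, (1 - a (Additive.ofMul g)) * (1 - b (Additive.ofMul g)) * (1 + c (Additive.ofMul g)) =
      if a (Additive.ofMul g) = -1 ∧ b (Additive.ofMul g) = -1 ∧ c (Additive.ofMul g) = 1 then (8 : ℂ) else 0 := by
    intro g
    rcases char_eq_one_or_w hexp a g with ha | ha <;> rcases char_eq_one_or_w hexp b g with hb | hb <;>
      rcases char_eq_one_or_w hexp c g with hc | hc <;> simp only [ha, hb, hc] <;> norm_num
  have hsum : ∑ g : G, (1 - a (Additive.ofMul g)) * (1 - b (Additive.ofMul g)) * (1 + c (Additive.ofMul g)) =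
      8 * ((Finset.univ.filter fun g : G =>
        a (Additive.ofMul g) = -1 ∧ b (Additive.ofMul g) = -1 ∧ c (Additive.ofMul g) = 1).card : ℂ) := by
    rw [Finset.sum_congr rfl fun g _ => hkey g, ← Finset.sum_filter, Finset.sum_const, nsmul_eq_mul, mul_comm]
  have hpt : ∀ g : G, (1 - a (Additive.ofMul g)) * (1 - b (Additive.ofMul g)) * (1 + c (Additive.ofMul g)) =
      1 - a (Additive.ofMul g) - b (Additive.ofMul g) + c (Additive.ofMul g) + (a + b) (Additive.ofMul g) -
        (a + c) (Additive.ofMul g) - (b + c) (Additive.ofMul g) + (a + b + c) (Additive.ofMul g) := by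
    intro g; simp only [AddChar.add_apply]; ring
  have hexpand : ∑ g : G, (1 - a (Additive.ofMul g)) * (1 - b (Additive.ofMul g)) * (1 + c (Additive.ofMul g)) =
      (Fintype.card G : ℂ) := by
    rw [Finset.sum_congr rfl fun g _ => hpt g]
    simp only [Finset.sum_add_distrib, Finset.sum_sub_distrib, sum_character_eq_zero_of_ne_zero h1,
      sum_character_eq_zero_of_ne_zero h2, sum_character_eq_zero_of_ne_zero h3,
      sum_character_eq_zero_of_ne_zero h4, sum_character_eq_zero_of_ne_zero h5,
      sum_character_eq_zero_of_ne_zero h6, sum_character_eq_zero_of_ne_zero h7, Finset.sum_const,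
      Finset.card_univ, nsmul_eq_mul, mul_one]
    ring
  rw [hexpand] at hsum
  exact_mod_cast hsum.symm

/-- **★★ EXACTLY THREE BALANCED SUBGROUPS OF INDEX `8`.**  For a CM type `T` of Kubota rank `11` on `G ≅ (ℤ/2)⁵`
(`|G| = 32`; these are exactly the primitive degenerate types, tree `OrderThirtyTwoStabilizers`), **there are exactly
THREE subgroups `H ∌ ρ` of index `8` all of whose cosets are `T`-balanced** (`2·#(T ∩ xH) = |H| = 4` for every `x`)
— they are the subgroups `{1, g₀, k, g₀k}` with `a(k) = b(k) = −1`.  On the field side (Moonen–Zarhin Criterion (Q1),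
sequel in `Pohlmann1968/`): **every primitive degenerate CM type of a multiquadratic CM field of degree `32` is of WEIL
TYPE over exactly three CM subfields of degree `8`**, each carrying an `8`-dimensional space of Weil–Hodge classes of
codimension `2` on the `16`-folds of the type, exceptional since these subfields are CM fields (`ρ ∉ H`).  The count
`3` complements the tree's `6` imaginary quadratic and `15 = C(6,2)` biquadratic Weil subfields.
[cite: MoonenZarhin1998WeilClasses, Criterion (Q1)] [cite: Kubota1965, §4 Lemma 2] [cite: Dodson1984, §3.1.1 Theorem]
[cite: Carlet2020, §2.3 (2.51) (p. 61)] [cite: Brzezinski2018, Appendix Thm. A.12.1 and Lemma A.12.2] -/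
theorem ncard_indexEight_balanced_eq_three (hexp : ∀ g : G, g ^ 2 = 1) (h : IsCMTypeWith ρ (T : Set G))
    (h32 : Fintype.card G = 32) (hr : typeRank G (T : Set G) = 11) :
    {H : Subgroup G | H.index = 8 ∧ ρ ∉ H ∧
      ∀ x : G, 2 * (T.filter fun t => x * t ∈ H).card = Nat.card H}.ncard = 3 := by
  have hρ2 := rho_mul_rho_w h
  have hρ1 := rho_ne_one_w h
  obtain ⟨h2, h8, -, -, -⟩ := card_classes_of_typeRank_eq_eleven hexp h h32 hr
  obtain ⟨a, b, hab, hAeq⟩ := Finset.card_eq_two.1 h2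
  have ha2 : a ∈ ({a, b} : Finset (AddChar (Additive G) ℂ)) := by simp
  have hb2 : b ∈ ({a, b} : Finset (AddChar (Additive G) ℂ)) := by simp
  rw [← hAeq] at ha2 hb2
  obtain ⟨haO, ha'⟩ := Finset.mem_filter.1 ha2
  obtain ⟨hbO, hb'⟩ := Finset.mem_filter.1 hb2
  have ha : a (Additive.ofMul ρ) = -1 := (Finset.mem_filter.1 haO).2
  have hb : b (Additive.ofMul ρ) = -1 := (Finset.mem_filter.1 hbO).2
  obtain ⟨g₀, hg1, hgρ, hg₀⟩ := exists_forall_four_iff_apply_eq hexp h h32 hr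
  -- `a(g₀) = b(g₀) = 1`
  have hag : a (Additive.ofMul g₀) = 1 :=
    (char_eq_one_or_w hexp a g₀).resolve_right fun h1 => by have := (hg₀ a ha).2 h1; omega
  have hbg : b (Additive.ofMul g₀) = 1 :=
    (char_eq_one_or_w hexp b g₀).resolve_right fun h1 => by have := (hg₀ b hb).2 h1; omega
  -- a `±4`-character `π₁` and the even character `c = aπ₁` with `c(g₀) = −1`
  have hne : ((Finset.univ.filter fun χ : AddChar (Additive G) ℂ => χ (Additive.ofMul ρ) = -1).filter
      (fun χ => (T.filter fun s => χ (Additive.ofMul s) = -1).card = 6 ∨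
        (T.filter fun s => χ (Additive.ofMul s) = -1).card = 10)).Nonempty := by
    rw [← Finset.card_pos, h8]; norm_num
  obtain ⟨π₁, hπ₁⟩ := hne
  obtain ⟨hπ₁O, hπ₁'⟩ := Finset.mem_filter.1 hπ₁
  have hπ₁ρ : π₁ (Additive.ofMul ρ) = -1 := (Finset.mem_filter.1 hπ₁O).2
  have hπ₁g : π₁ (Additive.ofMul g₀) = -1 := (hg₀ π₁ hπ₁ρ).1 hπ₁'
  set c := a + π₁ with hc
  have hcg : c (Additive.ofMul g₀) = -1 := by rw [hc, AddChar.add_apply, hag, hπ₁g]; norm_num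
  have hcρ : c (Additive.ofMul ρ) = 1 := add_apply_rho_of_odd_w ha hπ₁ρ
  -- the transversal `Y`
  set Y := (Finset.univ.filter fun k : G =>
    a (Additive.ofMul k) = -1 ∧ b (Additive.ofMul k) = -1 ∧ c (Additive.ofMul k) = 1).erase ρ with hY
  have hYmem : ∀ k : G, k ∈ Y ↔
      k ≠ ρ ∧ a (Additive.ofMul k) = -1 ∧ b (Additive.ofMul k) = -1 ∧ c (Additive.ofMul k) = 1 := by
    intro k; simp only [hY, Finset.mem_erase, Finset.mem_filter, Finset.mem_univ, true_and]
  have hYcard : Y.card = 3 := by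
    have hne0 : ∀ χ : AddChar (Additive G) ℂ, χ (Additive.ofMul ρ) = -1 → χ ≠ 0 := by
      intro χ hχ h0; rw [h0, AddChar.zero_apply] at hχ; norm_num at hχ
    have h4 : 8 * (Finset.univ.filter fun k : G =>
        a (Additive.ofMul k) = -1 ∧ b (Additive.ofMul k) = -1 ∧ c (Additive.ofMul k) = 1).card = Fintype.card G := by
      refine eight_mul_card_filter_three_w hexp (hne0 a ha) (hne0 b hb) ?_ ?_ ?_ ?_ ?_
      · intro h0; rw [h0, AddChar.zero_apply] at hcg; norm_num at hcg
      · exact fun h0 => hab ((add_eq_zero_iff_w hexp a b).1 h0)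
      · rw [hc, add_add_cancel_left_w hexp]; exact hne0 π₁ hπ₁ρ
      · refine hne0 _ ?_
        rw [hc, AddChar.add_apply, AddChar.add_apply, hb, ha, hπ₁ρ]; norm_num
      · -- `a + b + (a + π₁) = b + π₁ ≠ 0` since `π₁ ≠ b`
        intro h0
        have hbπ : b + π₁ = 0 := by
          have : a + b + c = b + π₁ := by
            rw [hc, add_add_add_comm, add_self_eq_zero_char hexp, zero_add]
          rw [← this]; exact h0
        rw [add_eq_zero_iff_w hexp] at hbπ
        rw [hbπ] at hb'
        rcases hb' with h1 | h1 <;> rcases hπ₁' with h3 | h3 <;> omega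
    rw [h32] at h4
    have hρmem : ρ ∈ (Finset.univ.filter fun k : G =>
        a (Additive.ofMul k) = -1 ∧ b (Additive.ofMul k) = -1 ∧ c (Additive.ofMul k) = 1) :=
      Finset.mem_filter.2 ⟨Finset.mem_univ _, ha, hb, hcρ⟩
    rw [hY, Finset.card_erase_of_mem hρmem]
    omega
  -- the map `k ↦ ⟨g₀, k⟩`
  set hH : G → Subgroup G := fun k => Subgroup.zpowers g₀ ⊔ Subgroup.zpowers k with hHdef
  have hz2 : Nat.card (Subgroup.zpowers g₀) = 2 := by
    have := natCard_sup_zpowers_w hexp (⊥ : Subgroup G) (c := g₀) (by rwa [Subgroup.mem_bot])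
    rwa [bot_sup_eq, Subgroup.card_bot, mul_one] at this
  have hcard4 : ∀ k : G, k ∉ Subgroup.zpowers g₀ → Nat.card (hH k) = 4 := by
    intro k hk
    simp only [hHdef]
    rw [natCard_sup_zpowers_w hexp _ hk, hz2]
  have hidx8 : ∀ k : G, k ∉ Subgroup.zpowers g₀ → (hH k).index = 8 := by
    intro k hk
    have := (hH k).card_mul_index
    rw [hcard4 k hk, Nat.card_eq_fintype_card (α := G), h32] at this
    omega
  have hmemH : ∀ k x : G, x ∈ hH k ↔ (x = 1 ∨ x = g₀) ∨ (k * x = 1 ∨ k * x = g₀) := by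
    intro k x
    simp only [hHdef]
    rw [mem_sup_zpowers_iff_w hexp, mem_zpowers_iff_w hexp, mem_zpowers_iff_w hexp]
  have heqH : ∀ (H : Subgroup G) (k : G), Nat.card H = 4 → g₀ ∈ H → k ∈ H → k ∉ Subgroup.zpowers g₀ →
      hH k = H := fun H k hcd hg hk hkz =>
    Subgroup.eq_of_le_of_card_ge (sup_le (Subgroup.zpowers_le.2 hg) (Subgroup.zpowers_le.2 hk))
      (by rw [hcd, hcard4 k hkz])
  have hnotz : ∀ k : G, a (Additive.ofMul k) = -1 → k ∉ Subgroup.zpowers g₀ := by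
    intro k hk hz
    rw [mem_zpowers_iff_w hexp] at hz
    rcases hz with rfl | rfl
    · rw [char_one_w] at hk; norm_num at hk
    · rw [hag] at hk; norm_num at hk
  have hmul_eq_one : ∀ k x : G, k * x = 1 → x = k := by
    intro k x hkx
    have : k * x = k * k := by rw [hkx, mul_self_w hexp]
    exact mul_left_cancel this
  -- image lands in the balanced family
  have himage : ∀ k ∈ Y, (hH k).index = 8 ∧ ρ ∉ hH k ∧
      ∀ x : G, 2 * (T.filter fun t => x * t ∈ hH k).card = Nat.card (hH k) := by
    intro k hk
    obtain ⟨hkρ, hak, hbk, hck⟩ := (hYmem k).1 hk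
    have hkz := hnotz k hak
    have hρH : ρ ∉ hH k := by
      rw [hmemH]
      push Not
      refine ⟨⟨hρ1, fun h1 => hgρ h1.symm⟩, fun h1 => hkρ ?_, fun h1 => ?_⟩
      · have := hmul_eq_one k ρ h1; exact this.symm
      · have := congrArg (fun g => c (Additive.ofMul g)) h1
        simp only [char_mul_w, hck, hcρ, hcg, one_mul] at this
        norm_num at this
    have hkH : k ∈ hH k := Subgroup.mem_sup_right (Subgroup.mem_zpowers k)
    refine ⟨hidx8 k hkz, hρH, ?_⟩
    exact (forall_coset_iff_of_index_eight hexp h h32 hr ha hb hab ha' hb' hg₀ (hidx8 k hkz) hρH).2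
      ⟨Subgroup.mem_sup_left (Subgroup.mem_zpowers g₀), ⟨k, hkH, hak⟩, ⟨k, hkH, hbk⟩⟩
  -- injective on `Y`
  have hinj : Set.InjOn hH ↑Y := by
    intro k₁ hk₁ k₂ hk₂ heq
    obtain ⟨-, -, -, hck₁⟩ := (hYmem k₁).1 hk₁
    obtain ⟨-, hak₂, -, hck₂⟩ := (hYmem k₂).1 hk₂
    have hk₂mem : k₂ ∈ hH k₁ := by
      have : k₂ ∈ hH k₂ := Subgroup.mem_sup_right (Subgroup.mem_zpowers k₂)
      rwa [← heq] at this
    rw [hmemH] at hk₂mem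
    rcases hk₂mem with h1 | (h1 | h1)
    · exact absurd ((mem_zpowers_iff_w hexp g₀ k₂).2 h1) (hnotz k₂ hak₂)
    · exact (hmul_eq_one k₁ k₂ h1).symm
    · exfalso
      have := congrArg (fun g => c (Additive.ofMul g)) h1
      simp only [char_mul_w, hck₁, hck₂, hcg, one_mul] at this
      norm_num at this
  -- surjective onto the balanced family
  have hsurj : ∀ H : Subgroup G, (H.index = 8 ∧ ρ ∉ H ∧
      ∀ x : G, 2 * (T.filter fun t => x * t ∈ H).card = Nat.card H) → ∃ k ∈ Y, hH k = H := by
    rintro H ⟨hHidx, hρH, hbal⟩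
    obtain ⟨hg, ⟨k₁, hk₁, hak⟩, ⟨k₂, hk₂, hbk⟩⟩ :=
      (forall_coset_iff_of_index_eight hexp h h32 hr ha hb hab ha' hb' hg₀ hHidx hρH).1 hbal
    have hcardH : Nat.card H = 4 := by
      have := H.card_mul_index; rw [hHidx, Nat.card_eq_fintype_card (α := G), h32] at this; omega
    have hk₁z := hnotz k₁ hak
    have hHeq := heqH H k₁ hcardH hg hk₁ hk₁z
    have hbk₁ : b (Additive.ofMul k₁) = -1 := by
      have hk₂mem : k₂ ∈ hH k₁ := by rw [hHeq]; exact hk₂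
      rw [hmemH] at hk₂mem
      rcases hk₂mem with (h1 | h1) | (h1 | h1)
      · rw [h1, char_one_w] at hbk; norm_num at hbk
      · rw [h1, hbg] at hbk; norm_num at hbk
      · rw [hmul_eq_one k₁ k₂ h1] at hbk; exact hbk
      · have := congrArg (fun g => b (Additive.ofMul g)) h1
        simp only [char_mul_w, hbk, hbg] at this
        linear_combination -this
    by_cases hck : c (Additive.ofMul k₁) = 1
    · exact ⟨k₁, (hYmem k₁).2 ⟨fun h1 => hρH (h1 ▸ hk₁), hak, hbk₁, hck⟩, hHeq⟩
    · have hck' : c (Additive.ofMul k₁) = -1 := (char_eq_one_or_w hexp c k₁).resolve_left hck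
      have hgk : g₀ * k₁ ∈ H := H.mul_mem hg hk₁
      have hagk : a (Additive.ofMul (g₀ * k₁)) = -1 := by rw [char_mul_w, hag, hak]; norm_num
      refine ⟨g₀ * k₁, (hYmem _).2 ⟨fun h1 => hρH (h1 ▸ hgk), hagk, ?_, ?_⟩, ?_⟩
      · rw [char_mul_w, hbg, hbk₁]; norm_num
      · rw [char_mul_w, hcg, hck']; norm_num
      · exact heqH H (g₀ * k₁) hcardH hg hgk (hnotz _ hagk)
  -- conclude
  have hW : {H : Subgroup G | H.index = 8 ∧ ρ ∉ H ∧
      ∀ x : G, 2 * (T.filter fun t => x * t ∈ H).card = Nat.card H} = hH '' ↑Y := by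
    ext H
    simp only [Set.mem_setOf_eq, Set.mem_image, Finset.mem_coe]
    constructor
    · intro hHW; exact hsurj H hHW
    · rintro ⟨k, hk, rfl⟩; exact himage k hk
  rw [hW, hinj.ncard_image, Set.ncard_coe_finset, hYcard]

end Count

/-! ## §8 ★★ Conversely: every conjugation-free balanced `4`-set is a coset of one of the three subgroups -/

section BalancedSets

/-- `Σ_χ χ(x) = |G|·[x = 1]`. [folklore] -/
private theorem sum_char_apply_eq_ite_w (x : G) :
    ∑ χ : AddChar (Additive G) ℂ, χ (Additive.ofMul x) = if x = 1 then (Fintype.card G : ℂ) else 0 := by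
  have h := AddChar.sum_apply_eq_ite (α := Additive G) (Additive.ofMul x)
  have hc : Fintype.card (Additive G) = Fintype.card G := Fintype.card_congr Additive.toMul
  rw [h, hc]
  rfl

omit [DecidableEq G] in
/-- **`8·#{g : a(g) = b(g) = c(g) = 1} = |G|`** for three characters of a group of exponent `2` all of whose seven
non-empty products are non-trivial (expand `Σ_g (1 + a(g))(1 + b(g))(1 + c(g))`). [cite: Kubota1965, §4 Lemma 2 (proof)] -/
private theorem eight_mul_card_filter_three_one_w (hexp : ∀ g : G, g ^ 2 = 1) {a b c : AddChar (Additive G) ℂ}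
    (h1 : a ≠ 0) (h2 : b ≠ 0) (h3 : c ≠ 0) (h4 : a + b ≠ 0) (h5 : a + c ≠ 0) (h6 : b + c ≠ 0)
    (h7 : a + b + c ≠ 0) :
    8 * (Finset.univ.filter fun g : G =>
      a (Additive.ofMul g) = 1 ∧ b (Additive.ofMul g) = 1 ∧ c (Additive.ofMul g) = 1).card = Fintype.card G := by
  have hkey : ∀ g : G, (1 + a (Additive.ofMul g)) * (1 + b (Additive.ofMul g)) * (1 + c (Additive.ofMul g)) =
      if a (Additive.ofMul g) = 1 ∧ b (Additive.ofMul g) = 1 ∧ c (Additive.ofMul g) = 1 then (8 : ℂ) else 0 := by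
    intro g
    rcases char_eq_one_or_w hexp a g with ha | ha <;> rcases char_eq_one_or_w hexp b g with hb | hb <;>
      rcases char_eq_one_or_w hexp c g with hc | hc <;> simp only [ha, hb, hc] <;> norm_num
  have hsum : ∑ g : G, (1 + a (Additive.ofMul g)) * (1 + b (Additive.ofMul g)) * (1 + c (Additive.ofMul g)) =
      8 * ((Finset.univ.filter fun g : G =>
        a (Additive.ofMul g) = 1 ∧ b (Additive.ofMul g) = 1 ∧ c (Additive.ofMul g) = 1).card : ℂ) := by
    rw [Finset.sum_congr rfl fun g _ => hkey g, ← Finset.sum_filter, Finset.sum_const, nsmul_eq_mul, mul_comm]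
  have hpt : ∀ g : G, (1 + a (Additive.ofMul g)) * (1 + b (Additive.ofMul g)) * (1 + c (Additive.ofMul g)) =
      1 + a (Additive.ofMul g) + b (Additive.ofMul g) + c (Additive.ofMul g) + (a + b) (Additive.ofMul g) +
        (a + c) (Additive.ofMul g) + (b + c) (Additive.ofMul g) + (a + b + c) (Additive.ofMul g) := by
    intro g; simp only [AddChar.add_apply]; ring
  have hexpand : ∑ g : G, (1 + a (Additive.ofMul g)) * (1 + b (Additive.ofMul g)) * (1 + c (Additive.ofMul g)) =
      (Fintype.card G : ℂ) := by
    rw [Finset.sum_congr rfl fun g _ => hpt g]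
    simp only [Finset.sum_add_distrib, sum_character_eq_zero_of_ne_zero h1,
      sum_character_eq_zero_of_ne_zero h2, sum_character_eq_zero_of_ne_zero h3,
      sum_character_eq_zero_of_ne_zero h4, sum_character_eq_zero_of_ne_zero h5,
      sum_character_eq_zero_of_ne_zero h6, sum_character_eq_zero_of_ne_zero h7, Finset.sum_const,
      Finset.card_univ, nsmul_eq_mul, mul_one]
    ring
  rw [hexpand] at hsum
  exact_mod_cast hsum.symm

omit [Fintype G] in
/-- A translate `{x : x·d ∈ T}` of `T` is `T·d`. [folklore] -/
private theorem filter_mul_mem_eq_image_w (hexp : ∀ g : G, g ^ 2 = 1) (S : Finset G) [Fintype G] (d : G) :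
    (Finset.univ.filter fun x : G => x * d ∈ S) = S.image fun t => t * d := by
  ext x
  simp only [Finset.mem_filter, Finset.mem_univ, true_and, Finset.mem_image]
  constructor
  · intro hx; exact ⟨x * d, hx, by rw [mul_assoc, mul_self_w hexp, mul_one]⟩
  · rintro ⟨t, ht, rfl⟩; rwa [mul_assoc, mul_self_w hexp, mul_one]

/-- **`F(χ)·Ŝ(χ) = 0`** for every character `χ ≠ 1` and every `T`-BALANCED set `D` (`2·#{d ∈ D : xd ∈ T} = |D|` for
all `x`), `F(χ) = Σ_{d∈D} χ(d)`: the function `x ↦ #(xD ∩ T)` is constant, and its Fourier coefficient at `χ` is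
`F(χ̄)Ŝ(χ)` up to `|G|`. [cite: Pohlmann1968, Thm. 1] [cite: Gordon1999HodgeAVSurvey, §9.2 (9.2.1)] [cite: Kubota1965, §4 Lemma 2] -/
theorem setSum_mul_typeSum_eq_zero_of_balanced (hexp : ∀ g : G, g ^ 2 = 1) {D : Finset G}
    (hbal : ∀ x : G, 2 * (D.filter fun d => x * d ∈ T).card = D.card) {χ : AddChar (Additive G) ℂ} (hχ : χ ≠ 0) :
    (∑ d ∈ D, χ (Additive.ofMul d)) * ∑ t ∈ T, χ (Additive.ofMul t) = 0 := by
  -- `Σ_x #(xD ∩ T)·χ(x) = F(χ)Ŝ(χ)`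
  have h1 : ∑ x : G, ((D.filter fun d => x * d ∈ T).card : ℂ) * χ (Additive.ofMul x) =
      (∑ d ∈ D, χ (Additive.ofMul d)) * ∑ t ∈ T, χ (Additive.ofMul t) := by
    have e1 : ∀ x : G, ((D.filter fun d => x * d ∈ T).card : ℂ) * χ (Additive.ofMul x) =
        ∑ d ∈ D, if x * d ∈ T then χ (Additive.ofMul x) else 0 := by
      intro x
      rw [Finset.natCast_card_filter, Finset.sum_mul]
      refine Finset.sum_congr rfl fun d _ => ?_
      split_ifs <;> simp
    rw [Finset.sum_congr rfl fun x _ => e1 x, Finset.sum_comm, Finset.sum_mul]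
    refine Finset.sum_congr rfl fun d _ => ?_
    rw [← Finset.sum_filter, filter_mul_mem_eq_image_w hexp T d,
      Finset.sum_image fun t _ t' _ (h : t * d = t' * d) => mul_right_cancel h, Finset.mul_sum]
    refine Finset.sum_congr rfl fun t _ => ?_
    rw [char_mul_w, mul_comm]
  -- `Σ_x #(xD ∩ T)·χ(x) = (|D|/2)·Σ_x χ(x) = 0`
  have h2 : 2 * ∑ x : G, ((D.filter fun d => x * d ∈ T).card : ℂ) * χ (Additive.ofMul x) = 0 := by
    rw [Finset.mul_sum, Finset.sum_congr rfl fun x _ => by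
      rw [← mul_assoc, show (2 : ℂ) * ((D.filter fun d => x * d ∈ T).card : ℂ) = (D.card : ℂ) by
        exact_mod_cast hbal x], ← Finset.mul_sum, sum_character_eq_zero_of_ne_zero hχ, mul_zero]
  rw [← h1]
  have := h2
  simpa using this

/-- **Parseval for `F`**: `Σ_χ F(χ)²·χ(g) = |G|·#{(d, d') ∈ D² : dd'g = 1}`; at `g = 1` this is `|G|·|D|`
(exponent `2`), at `g = ρ` it is `0` for a CONJUGATION-FREE `D` (`ρD ∩ D = ∅`). [cite: Kubota1965, §4 Lemma 2 (proof)] -/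
theorem sum_sq_setSum_mul_apply_eq_card (hexp : ∀ g : G, g ^ 2 = 1) (D : Finset G) (g : G) :
    ∑ χ : AddChar (Additive G) ℂ, (∑ d ∈ D, χ (Additive.ofMul d)) ^ 2 * χ (Additive.ofMul g) =
      (Fintype.card G : ℂ) * ((D.filter fun d => g * d ∈ D).card : ℂ) := by
  have e1 : ∀ χ : AddChar (Additive G) ℂ, (∑ d ∈ D, χ (Additive.ofMul d)) ^ 2 * χ (Additive.ofMul g) =
      ∑ d ∈ D, ∑ d' ∈ D, χ (Additive.ofMul (d * d' * g)) := by
    intro χ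
    rw [pow_two, Finset.sum_mul_sum, Finset.sum_mul]
    refine Finset.sum_congr rfl fun d _ => ?_
    rw [Finset.sum_mul]
    refine Finset.sum_congr rfl fun d' _ => ?_
    rw [char_mul_w, char_mul_w]
  rw [Finset.sum_congr rfl fun χ _ => e1 χ, Finset.sum_comm]
  rw [Finset.sum_congr rfl fun d _ => Finset.sum_comm]
  rw [Finset.sum_congr rfl fun d _ => Finset.sum_congr rfl fun d' _ => sum_char_apply_eq_ite_w (d * d' * g)]
  -- `d d' g = 1 ⟺ d' = g d`
  have e2 : ∀ d ∈ D, ∑ d' ∈ D, (if d * d' * g = 1 then (Fintype.card G : ℂ) else 0) =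
      if g * d ∈ D then (Fintype.card G : ℂ) else 0 := by
    intro d _
    have hiff : ∀ d' : G, d * d' * g = 1 ↔ d' = g * d := by
      intro d'
      constructor
      · intro h1
        calc d' = d * d * (g * g) * d' := by rw [mul_self_w hexp, mul_self_w hexp, one_mul, one_mul]
          _ = d * g * (d * d' * g) := by simp only [mul_comm, mul_left_comm]
          _ = g * d := by rw [h1, mul_one, mul_comm]
      · rintro rfl
        calc d * (g * d) * g = d * d * (g * g) := by simp only [mul_comm, mul_left_comm]
          _ = 1 := by rw [mul_self_w hexp, mul_self_w hexp, one_mul]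
    have e3 : ∀ d' ∈ D, (if d * d' * g = 1 then (Fintype.card G : ℂ) else 0) =
        if d' = g * d then (Fintype.card G : ℂ) else 0 := fun d' _ => by simp only [hiff d']
    rw [Finset.sum_congr rfl e3, Finset.sum_ite_eq' D (g * d) (fun _ => (Fintype.card G : ℂ))]
  rw [Finset.sum_congr rfl e2, ← Finset.sum_filter, Finset.sum_const, nsmul_eq_mul, mul_comm]

/-- **★★ EVERY CONJUGATION-FREE BALANCED `4`-SET IS A COSET OF A BALANCED SUBGROUP OF INDEX `8`** (rank `11`, order
`32`).  If `D ⊆ G`, `|D| = 4`, `ρD ∩ D = ∅` and `2·#(xD ∩ T) = 4` for every `x`, then `D = x₀H` for a subgroup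
`H ∌ ρ` of index `8` all of whose cosets are balanced — one of the three of `ncard_indexEight_balanced_eq_three`.
(Fourier: `F·Ŝ = 0` kills `F = Σ_D χ` off the Weil characters; Parseval `Σ_χ F² = 128`, `Σ_χ F²χ(ρ) = 0` give
`Σ_{Weil} F² = 64` over six characters with `F² ∈ {0, 4, 16}`, so at least three Weil characters are CONSTANT on `D`,
and `D` is a coset of their joint kernel.)  Field side (sequel): on a simple degenerate CM `16`-fold with multiquadratic
complex multiplication the exceptional Pohlmann sets of degree `2` are EXACTLY the `24` coset-fibres, `dim B² − dim D² = 24`.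
[cite: Pohlmann1968, Thm. 1] [cite: MoonenZarhin1998WeilClasses, Criterion (Q1) and Criterion (Q2)]
[cite: Kubota1965, §4 Lemma 2] [cite: Gordon1999HodgeAVSurvey, §9.2 (9.2.1) and 9.2.2] -/
theorem exists_eq_coset_of_balanced_four (hexp : ∀ g : G, g ^ 2 = 1) (h : IsCMTypeWith ρ (T : Set G))
    (h32 : Fintype.card G = 32) (hr : typeRank G (T : Set G) = 11) {D : Finset G} (hD : D.card = 4)
    (hfree : ∀ d ∈ D, ρ * d ∉ D) (hbal : ∀ x : G, 2 * (D.filter fun d => x * d ∈ T).card = D.card) :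
    ∃ H : Subgroup G, H.index = 8 ∧ ρ ∉ H ∧ (∀ x : G, 2 * (T.filter fun t => x * t ∈ H).card = Nat.card H) ∧
      ∃ x₀ : G, D = Finset.univ.filter fun t : G => x₀ * t ∈ H := by
  set O := Finset.univ.filter (fun χ : AddChar (Additive G) ℂ => χ (Additive.ofMul ρ) = -1) with hO
  set F : AddChar (Additive G) ℂ → ℂ := fun χ => ∑ d ∈ D, χ (Additive.ofMul d) with hF
  have hρ2 := rho_mul_rho_w h
  obtain ⟨-, -, h6, -, -⟩ := card_classes_of_typeRank_eq_eleven hexp h h32 hr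
  simp only [← hO] at h6
  -- (1) `F` vanishes at the odd non-Weil characters
  have hF0 : ∀ χ : AddChar (Additive G) ℂ, χ (Additive.ofMul ρ) = -1 →
      (T.filter fun t => χ (Additive.ofMul t) = -1).card ≠ 8 → F χ = 0 := by
    intro χ hχ hne
    have hχ0 : χ ≠ 0 := by intro h0; rw [h0, AddChar.zero_apply] at hχ; norm_num at hχ
    have hS : ∑ t ∈ T, χ (Additive.ofMul t) ≠ 0 := fun h0 =>
      hne ((sum_char_eq_zero_iff_card_eq_eight hexp h h32 χ).1 h0)
    exact (mul_eq_zero.1 (setSum_mul_typeSum_eq_zero_of_balanced hexp hbal hχ0)).resolve_right hS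
  -- (2) Parseval: `Σ_odd F² = 64`
  have hP1 := sum_sq_setSum_mul_apply_eq_card hexp D 1
  have hPρ := sum_sq_setSum_mul_apply_eq_card hexp D ρ
  have hc1 : (D.filter fun d => (1 : G) * d ∈ D).card = 4 := by
    rw [← hD]; congr 1; ext d; simp
  have hcρ : (D.filter fun d => ρ * d ∈ D).card = 0 := by
    rw [Finset.card_eq_zero, Finset.filter_eq_empty_iff]; exact fun d hd => hfree d hd
  simp only [char_one_w, mul_one, hc1, h32] at hP1
  rw [hcρ, h32] at hPρ
  have hsplit1 := Finset.sum_filter_add_sum_filter_not Finset.univ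
    (fun χ : AddChar (Additive G) ℂ => χ (Additive.ofMul ρ) = -1) (fun χ => F χ ^ 2)
  have hsplitρ := Finset.sum_filter_add_sum_filter_not Finset.univ
    (fun χ : AddChar (Additive G) ℂ => χ (Additive.ofMul ρ) = -1) (fun χ => F χ ^ 2 * χ (Additive.ofMul ρ))
  have hoddρ : ∑ χ ∈ O, F χ ^ 2 * χ (Additive.ofMul ρ) = -∑ χ ∈ O, F χ ^ 2 := by
    rw [← Finset.sum_neg_distrib]
    refine Finset.sum_congr rfl fun χ hχ => ?_
    rw [(Finset.mem_filter.1 hχ).2]; ring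
  have hevenρ : ∑ χ ∈ Finset.univ.filter (fun χ : AddChar (Additive G) ℂ => ¬ χ (Additive.ofMul ρ) = -1),
      F χ ^ 2 * χ (Additive.ofMul ρ) =
      ∑ χ ∈ Finset.univ.filter (fun χ : AddChar (Additive G) ℂ => ¬ χ (Additive.ofMul ρ) = -1), F χ ^ 2 := by
    refine Finset.sum_congr rfl fun χ hχ => ?_
    rw [(character_apply_eq_one_or_of_mul_self χ hρ2).resolve_right (Finset.mem_filter.1 hχ).2, mul_one]
  simp only [← hO] at hsplit1 hsplitρ
  rw [hoddρ, hevenρ] at hsplitρ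
  have hodd64 : ∑ χ ∈ O, F χ ^ 2 = 64 := by
    have e1 : ∑ χ ∈ O, F χ ^ 2 + ∑ χ ∈ Finset.univ.filter
        (fun χ : AddChar (Additive G) ℂ => ¬ χ (Additive.ofMul ρ) = -1), F χ ^ 2 = (32 : ℕ) * (4 : ℕ) := by
      rw [hsplit1]; exact hP1
    have e2 : -∑ χ ∈ O, F χ ^ 2 + ∑ χ ∈ Finset.univ.filter
        (fun χ : AddChar (Additive G) ℂ => ¬ χ (Additive.ofMul ρ) = -1), F χ ^ 2 = (32 : ℕ) * ((0 : ℕ) : ℂ) := by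
      rw [hsplitρ]; exact hPρ
    push_cast at e1 e2
    linear_combination (e1 - e2) / 2
  -- (3) only the six Weil characters contribute
  set Z := O.filter (fun χ => (T.filter fun t => χ (Additive.ofMul t) = -1).card = 8) with hZ
  have hZ64 : ∑ χ ∈ Z, F χ ^ 2 = 64 := by
    rw [← hodd64, hZ, ← Finset.sum_filter_add_sum_filter_not O
      (fun χ => (T.filter fun t => χ (Additive.ofMul t) = -1).card = 8) (fun χ => F χ ^ 2)]
    rw [Finset.sum_eq_zero (s := O.filter fun χ => ¬ (T.filter fun t => χ (Additive.ofMul t) = -1).card = 8)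
      fun χ hχ => by
        obtain ⟨hχO, hne⟩ := Finset.mem_filter.1 hχ
        rw [hF0 χ (Finset.mem_filter.1 hχO).2 hne]; ring]
    ring
  -- (4) `F(ζ) = 4 − 2k_ζ`; at least three Weil characters are constant on `D`
  set k : AddChar (Additive G) ℂ → ℕ := fun χ => (D.filter fun d => χ (Additive.ofMul d) = -1).card with hk
  have hFk : ∀ χ : AddChar (Additive G) ℂ, F χ = (4 : ℂ) - 2 * (k χ : ℂ) := by
    intro χ; simp only [hF, hk]; rw [sum_char_eq_w hexp χ D, hD]; push_cast; ring
  have hkle : ∀ χ, k χ ≤ 4 := fun χ => (Finset.card_filter_le _ _).trans hD.le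
  have hZint : ∑ χ ∈ Z, ((4 : ℤ) - 2 * (k χ : ℤ)) ^ 2 = 64 := by
    have : ((∑ χ ∈ Z, ((4 : ℤ) - 2 * (k χ : ℤ)) ^ 2 : ℤ) : ℂ) = 64 := by
      rw [← hZ64]; push_cast
      exact Finset.sum_congr rfl fun χ _ => by rw [hFk χ]
    exact_mod_cast this
  set C := Z.filter (fun χ => k χ = 0 ∨ k χ = 4) with hC
  have hC3 : 2 < C.card := by
    by_contra hle
    push Not at hle
    have hbound : ∑ χ ∈ Z, ((4 : ℤ) - 2 * (k χ : ℤ)) ^ 2 ≤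
        ∑ χ ∈ Z, (if k χ = 0 ∨ k χ = 4 then (16 : ℤ) else 4) := by
      refine Finset.sum_le_sum fun χ _ => ?_
      have h4 := hkle χ
      split_ifs with hc
      · rcases hc with h0 | h0 <;> rw [h0] <;> norm_num
      · push Not at hc
        interval_cases (k χ) <;> simp_all
    rw [Finset.sum_ite, Finset.sum_const, Finset.sum_const, nsmul_eq_mul, nsmul_eq_mul] at hbound
    have hCZ : C.card + (Z.filter fun χ => ¬ (k χ = 0 ∨ k χ = 4)).card = 6 := by
      rw [hC, Finset.card_filter_add_card_filter_not, h6]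
    rw [← hC] at hbound
    have : ((Z.filter fun χ => ¬ (k χ = 0 ∨ k χ = 4)).card : ℤ) = 6 - C.card := by
      have := hCZ; omega
    rw [this, hZint] at hbound
    have hC2 : (C.card : ℤ) ≤ 2 := by exact_mod_cast hle
    linarith
  obtain ⟨ζ₁, hζ₁, ζ₂, hζ₂, ζ₃, hζ₃, h12, h13, h23⟩ := Finset.two_lt_card.1 hC3
  -- unpack
  have hCmem : ∀ ζ ∈ C, ζ (Additive.ofMul ρ) = -1 ∧ (T.filter fun t => ζ (Additive.ofMul t) = -1).card = 8 ∧
      ∃ ε : ℂ, ∀ d ∈ D, ζ (Additive.ofMul d) = ε := by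
    intro ζ hζ
    obtain ⟨hζZ, hkζ⟩ := Finset.mem_filter.1 hζ
    obtain ⟨hζO, hζ8⟩ := Finset.mem_filter.1 hζZ
    refine ⟨(Finset.mem_filter.1 hζO).2, hζ8, ?_⟩
    rcases hkζ with h0 | h4
    · refine ⟨1, fun d hd => ?_⟩
      simp only [hk, Finset.card_eq_zero, Finset.filter_eq_empty_iff] at h0
      exact (char_eq_one_or_w hexp ζ d).resolve_right (h0 hd)
    · refine ⟨-1, fun d hd => ?_⟩
      have : D.filter (fun d => ζ (Additive.ofMul d) = -1) = D :=
        Finset.eq_of_subset_of_card_le (Finset.filter_subset _ _) (by simp only [hk] at h4; rw [h4, hD])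
      have hd' : d ∈ D.filter (fun d => ζ (Additive.ofMul d) = -1) := by rw [this]; exact hd
      exact (Finset.mem_filter.1 hd').2
  obtain ⟨hζ₁ρ, hζ₁8, ε₁, hε₁⟩ := hCmem ζ₁ hζ₁
  obtain ⟨hζ₂ρ, hζ₂8, ε₂, hε₂⟩ := hCmem ζ₂ hζ₂
  obtain ⟨hζ₃ρ, hζ₃8, ε₃, hε₃⟩ := hCmem ζ₃ hζ₃
  -- (5) the joint kernel
  let H : Subgroup G :=
    { carrier := {g : G | ζ₁ (Additive.ofMul g) = 1 ∧ ζ₂ (Additive.ofMul g) = 1 ∧ ζ₃ (Additive.ofMul g) = 1}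
      one_mem' := by
        refine ⟨?_, ?_, ?_⟩ <;> exact char_one_w _
      mul_mem' := fun {x y} hx hy => by
        refine ⟨?_, ?_, ?_⟩
        · rw [char_mul_w, hx.1, hy.1, one_mul]
        · rw [char_mul_w, hx.2.1, hy.2.1, one_mul]
        · rw [char_mul_w, hx.2.2, hy.2.2, one_mul]
      inv_mem' := fun {x} hx => by
        have : x⁻¹ = x := inv_eq_of_mul_eq_one_right (mul_self_w hexp x)
        rw [this]; exact hx }
  have hHmem : ∀ g : G, g ∈ H ↔
      ζ₁ (Additive.ofMul g) = 1 ∧ ζ₂ (Additive.ofMul g) = 1 ∧ ζ₃ (Additive.ofMul g) = 1 := fun g => Iff.rfl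
  have hne0 : ∀ χ : AddChar (Additive G) ℂ, χ (Additive.ofMul ρ) = -1 → χ ≠ 0 := by
    intro χ hχ h0; rw [h0, AddChar.zero_apply] at hχ; norm_num at hχ
  have hodd3 : (ζ₁ + ζ₂ + ζ₃) (Additive.ofMul ρ) = -1 := by
    rw [AddChar.add_apply, AddChar.add_apply, hζ₁ρ, hζ₂ρ, hζ₃ρ]; norm_num
  have hcardH : Nat.card H = 4 := by
    have e : Nat.card H = (Finset.univ.filter fun g : G =>
        ζ₁ (Additive.ofMul g) = 1 ∧ ζ₂ (Additive.ofMul g) = 1 ∧ ζ₃ (Additive.ofMul g) = 1).card := by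
      have e0 : Nat.card H = (Finset.univ.filter fun g : G => g ∈ H).card := by
        rw [Nat.card_eq_fintype_card, ← Fintype.card_subtype]
      rw [e0, Finset.filter_congr fun g _ => hHmem g]
    have h8 := eight_mul_card_filter_three_one_w hexp (hne0 ζ₁ hζ₁ρ) (hne0 ζ₂ hζ₂ρ) (hne0 ζ₃ hζ₃ρ)
      (fun h0 => h12 ((add_eq_zero_iff_w hexp ζ₁ ζ₂).1 h0)) (fun h0 => h13 ((add_eq_zero_iff_w hexp ζ₁ ζ₃).1 h0))
      (fun h0 => h23 ((add_eq_zero_iff_w hexp ζ₂ ζ₃).1 h0)) (hne0 _ hodd3)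
    rw [h32] at h8
    rw [e]; omega
  have hidx : H.index = 8 := by
    have := H.card_mul_index; rw [hcardH, Nat.card_eq_fintype_card (α := G), h32] at this; omega
  have hρH : ρ ∉ H := by
    intro hρ'; have := ((hHmem ρ).1 hρ').1; rw [hζ₁ρ] at this; norm_num at this
  -- `D` is the coset `{t : d₁ t ∈ H}`
  obtain ⟨d₁, hd₁⟩ : D.Nonempty := by rw [← Finset.card_pos, hD]; norm_num
  have hsq : ∀ (χ : AddChar (Additive G) ℂ) (ε : ℂ), (∀ d ∈ D, χ (Additive.ofMul d) = ε) → ∀ d ∈ D,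
      χ (Additive.ofMul (d₁ * d)) = 1 := by
    intro χ ε hχ d hd
    rw [char_mul_w, hχ d₁ hd₁, hχ d hd]
    rcases char_eq_one_or_w hexp χ d with h1 | h1 <;> rw [← hχ d hd, h1] <;> norm_num
  have hDeq : D = Finset.univ.filter fun t : G => d₁ * t ∈ H := by
    refine Finset.eq_of_subset_of_card_le (fun d hd => ?_) ?_
    · rw [Finset.mem_filter, hHmem]
      exact ⟨Finset.mem_univ _, hsq ζ₁ ε₁ hε₁ d hd, hsq ζ₂ ε₂ hε₂ d hd, hsq ζ₃ ε₃ hε₃ d hd⟩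
    · have : (Finset.univ.filter fun t : G => d₁ * t ∈ H).card = Nat.card H := by
        have e : Nat.card H = (Finset.univ.filter fun g : G => g ∈ H).card := by
          rw [Nat.card_eq_fintype_card, ← Fintype.card_subtype]
        rw [e]
        refine Finset.card_bij (fun u _ => d₁ * u) (fun u hu => ?_) (fun a _ b _ hab => mul_left_cancel hab)
          (fun k hk' => ⟨d₁⁻¹ * k, ?_, by rw [mul_inv_cancel_left]⟩)
        · simpa using hu
        · simpa using hk'
      rw [this, hcardH, hD]
  -- `H` is balanced: `N_H(y) = #{d ∈ D : (d₁y)d ∈ T} = 2`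
  have hbalH : ∀ y : G, 2 * (T.filter fun t => y * t ∈ H).card = Nat.card H := by
    intro y
    rw [hcardH]
    have hb := hbal (d₁ * y)
    rw [hD] at hb
    have e : (D.filter fun d => d₁ * y * d ∈ T).card = (T.filter fun t => y * t ∈ H).card := by
      refine Finset.card_bij (fun d _ => d₁ * y * d) (fun d hd => ?_)
        (fun a _ b _ hab => mul_left_cancel hab) (fun t ht => ⟨d₁ * y * t, ?_, ?_⟩)
      · obtain ⟨hdD, hdT⟩ := Finset.mem_filter.1 hd
        rw [hDeq] at hdD
        refine Finset.mem_filter.2 ⟨hdT, ?_⟩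
        have : y * (d₁ * y * d) = d₁ * d := by
          rw [← mul_assoc, ← mul_assoc, mul_comm y d₁, mul_assoc d₁ y y, mul_self_w hexp, mul_one]
        rw [this]; exact (Finset.mem_filter.1 hdD).2
      · obtain ⟨htT, htH⟩ := Finset.mem_filter.1 ht
        refine Finset.mem_filter.2 ⟨?_, ?_⟩
        · rw [hDeq, Finset.mem_filter]
          refine ⟨Finset.mem_univ _, ?_⟩
          have : d₁ * (d₁ * y * t) = y * t := by
            rw [← mul_assoc, ← mul_assoc, mul_self_w hexp, one_mul]
          rw [this]; exact htH
        · have : d₁ * y * (d₁ * y * t) = t := by rw [← mul_assoc, mul_self_w hexp, one_mul]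
          rw [this]; exact htT
      · rw [← mul_assoc, mul_self_w hexp, one_mul]
    omega
  exact ⟨H, hidx, hρH, hbalH, d₁, hDeq⟩

/-- **Conversely, the cosets of a balanced index-`8` subgroup `H ∌ ρ` are conjugation-free balanced `4`-sets.**
[cite: MoonenZarhin1998WeilClasses, Criterion (Q1)] [cite: Gordon1999HodgeAVSurvey, §9.2 (9.2.1)] -/
theorem coset_balanced_four (hexp : ∀ g : G, g ^ 2 = 1) (h32 : Fintype.card G = 32) {H : Subgroup G}
    (hH : H.index = 8) (hρ : ρ ∉ H) (hbal : ∀ x : G, 2 * (T.filter fun t => x * t ∈ H).card = Nat.card H)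
    (x₀ : G) :
    (Finset.univ.filter fun t : G => x₀ * t ∈ H).card = 4 ∧
      (∀ d ∈ (Finset.univ.filter fun t : G => x₀ * t ∈ H), ρ * d ∉ (Finset.univ.filter fun t : G => x₀ * t ∈ H)) ∧
      ∀ x : G, 2 * ((Finset.univ.filter fun t : G => x₀ * t ∈ H).filter fun d => x * d ∈ T).card =
        (Finset.univ.filter fun t : G => x₀ * t ∈ H).card := by
  have hcardH : Nat.card H = 4 := by
    have := H.card_mul_index; rw [hH, Nat.card_eq_fintype_card (α := G), h32] at this; omega
  have hc : (Finset.univ.filter fun t : G => x₀ * t ∈ H).card = 4 := by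
    have e : Nat.card H = (Finset.univ.filter fun g : G => g ∈ H).card := by
      rw [Nat.card_eq_fintype_card, ← Fintype.card_subtype]
    rw [← hcardH, e]
    refine Finset.card_bij (fun u _ => x₀ * u) (fun u hu => ?_) (fun a _ b _ hab => mul_left_cancel hab)
      (fun k hk' => ⟨x₀⁻¹ * k, ?_, by rw [mul_inv_cancel_left]⟩)
    · simpa using hu
    · simpa using hk'
  refine ⟨hc, fun d hd hd' => hρ ?_, fun x => ?_⟩
  · have h1 : x₀ * d ∈ H := (Finset.mem_filter.1 hd).2
    have h2 : x₀ * (ρ * d) ∈ H := (Finset.mem_filter.1 hd').2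
    have : x₀ * (ρ * d) * (x₀ * d)⁻¹ = ρ := by
      rw [mul_left_comm, mul_assoc, mul_inv_cancel, mul_one]
    rw [← this]; exact H.mul_mem h2 (H.inv_mem h1)
  · rw [hc]
    have hb := hbal (x * x₀)
    rw [hcardH] at hb
    have e : ((Finset.univ.filter fun t : G => x₀ * t ∈ H).filter fun d => x * d ∈ T).card =
        (T.filter fun t => x * x₀ * t ∈ H).card := by
      refine Finset.card_bij (fun d _ => x * d) (fun d hd => ?_) (fun a _ b _ hab => mul_left_cancel hab)
        (fun t ht => ⟨x * t, ?_, by rw [← mul_assoc, mul_self_w hexp, one_mul]⟩)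
      · obtain ⟨hdH, hdT⟩ := Finset.mem_filter.1 hd
        refine Finset.mem_filter.2 ⟨hdT, ?_⟩
        have : x * x₀ * (x * d) = x₀ * d := by
          rw [mul_comm x x₀, mul_assoc, ← mul_assoc x x, mul_self_w hexp, one_mul]
        rw [this]; exact (Finset.mem_filter.1 hdH).2
      · obtain ⟨htT, htH⟩ := Finset.mem_filter.1 ht
        refine Finset.mem_filter.2 ⟨Finset.mem_filter.2 ⟨Finset.mem_univ _, ?_⟩, ?_⟩
        · have : x₀ * (x * t) = x * x₀ * t := by rw [← mul_assoc, mul_comm x₀ x]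
          rw [this]; exact htH
        · rw [← mul_assoc, mul_self_w hexp, one_mul]; exact htT
    omega

/-- **★★ THE CONJUGATION-FREE BALANCED `4`-SETS ARE EXACTLY THE `24` COSETS of the three balanced index-`8` subgroups
avoiding `ρ`** (rank `11`, order `32`). [cite: Pohlmann1968, Thm. 1] [cite: MoonenZarhin1998WeilClasses, Criterion (Q1)]
[cite: Kubota1965, §4 Lemma 2] [cite: Gordon1999HodgeAVSurvey, §9.2 (9.2.1) and 9.2.2] -/
theorem setOf_balanced_four_eq (hexp : ∀ g : G, g ^ 2 = 1) (h : IsCMTypeWith ρ (T : Set G))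
    (h32 : Fintype.card G = 32) (hr : typeRank G (T : Set G) = 11) :
    {D : Finset G | D.card = 4 ∧ (∀ d ∈ D, ρ * d ∉ D) ∧ ∀ x : G, 2 * (D.filter fun d => x * d ∈ T).card = D.card} =
      {C : Finset G | ∃ H : Subgroup G, H.index = 8 ∧ (ρ ∉ H ∧
        ∀ x : G, 2 * (T.filter fun t => x * t ∈ H).card = Nat.card H) ∧
        ∃ x₀ : G, C = Finset.univ.filter fun t : G => x₀ * t ∈ H} := by
  ext D
  simp only [Set.mem_setOf_eq]
  constructor
  · rintro ⟨hD, hfree, hbal⟩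
    obtain ⟨H, hH, hρ, hbalH, x₀, hx₀⟩ := exists_eq_coset_of_balanced_four hexp h h32 hr hD hfree hbal
    exact ⟨H, hH, ⟨hρ, hbalH⟩, x₀, hx₀⟩
  · rintro ⟨H, hH, ⟨hρ, hbalH⟩, x₀, rfl⟩
    exact coset_balanced_four hexp h32 hH hρ hbalH x₀

end BalancedSets

/-! ## §9 Balanced sets of any size: `g₀`-stability and `|D| ≡ 0 (mod 4)` (append, g46-#9) -/

section ModFour

/-- **THE `ρ`-ANTISYMMETRISED INDICATOR OF A BALANCED SET IS `g₀`-INVARIANT.**  For a `T`-balanced `D ⊆ G` (rank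
`11`, order `32`) and the element `g₀` of the structure theorem: `𝟙_D(x) − 𝟙_D(ρx) = 𝟙_D(g₀x) − 𝟙_D(ρg₀x)` for all
`x` (Fourier inversion `32·𝟙_D = Σ_χ F(χ)χ`: the antisymmetrisation keeps only the odd characters, `F` vanishes at the
odd characters with `Ŝ ≠ 0`, and the remaining Weil characters are trivial at `g₀`).
[cite: Pohlmann1968, Thm. 1] [cite: Kubota1965, §4 Lemma 2] [cite: Dodson1984, §3.1.1 Theorem] -/
theorem indicator_sub_eq_of_balanced (hexp : ∀ g : G, g ^ 2 = 1) (h : IsCMTypeWith ρ (T : Set G))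
    (h32 : Fintype.card G = 32) {g₀ : G}
    (hg₀ : ∀ χ : AddChar (Additive G) ℂ, χ (Additive.ofMul ρ) = -1 →
      (((T.filter fun t => χ (Additive.ofMul t) = -1).card = 6 ∨
        (T.filter fun t => χ (Additive.ofMul t) = -1).card = 10) ↔ χ (Additive.ofMul g₀) = -1))
    {D : Finset G} (hbal : ∀ x : G, 2 * (D.filter fun d => x * d ∈ T).card = D.card) (x : G) :
    ((if x ∈ D then (1 : ℤ) else 0) - if ρ * x ∈ D then 1 else 0) =
      (if g₀ * x ∈ D then (1 : ℤ) else 0) - if ρ * (g₀ * x) ∈ D then 1 else 0 := by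
  have hρ2 := rho_mul_rho_w h
  set F : AddChar (Additive G) ℂ → ℂ := fun χ => ∑ d ∈ D, χ (Additive.ofMul d) with hF
  -- Fourier inversion, antisymmetrised: `32(𝟙_D(y) − 𝟙_D(ρy)) = Σ_χ F(χ)χ(y)(1 − χ(ρ))`
  have hinv : ∀ y : G, ((if y ∈ D then (Fintype.card G : ℂ) else 0) - if ρ * y ∈ D then (Fintype.card G : ℂ) else 0) =
      ∑ χ : AddChar (Additive G) ℂ, F χ * χ (Additive.ofMul y) * (1 - χ (Additive.ofMul ρ)) := by
    intro y
    rw [card_mul_indicator_eq_sum hexp D y, card_mul_indicator_eq_sum hexp D (ρ * y), ← Finset.sum_sub_distrib]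
    refine Finset.sum_congr rfl fun χ _ => ?_
    simp only [hF, char_mul_w]; ring
  -- the terms with `χ(g₀) = −1` vanish: such `χ` are odd... or even; only odd ones survive `1 − χ(ρ)`, and for
  -- odd `χ` with `χ(g₀) = −1` the class is `±4`, so `Ŝ(χ) ≠ 0` and `F(χ) = 0`
  have hterm : ∀ χ : AddChar (Additive G) ℂ,
      F χ * χ (Additive.ofMul (g₀ * x)) * (1 - χ (Additive.ofMul ρ)) =
        F χ * χ (Additive.ofMul x) * (1 - χ (Additive.ofMul ρ)) := by
    intro χ
    rcases character_apply_eq_one_or_of_mul_self χ hρ2 with he | ho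
    · rw [he]; ring
    · rcases char_eq_one_or_w hexp χ g₀ with h1 | h1
      · rw [char_mul_w, h1, one_mul]
      · -- `χ` odd with `χ(g₀) = −1`: `F χ = 0`
        have hP := (hg₀ χ ho).2 h1
        have hne : (T.filter fun t => χ (Additive.ofMul t) = -1).card ≠ 8 := by omega
        have hχ0 : χ ≠ 0 := by intro h0; rw [h0, AddChar.zero_apply] at ho; norm_num at ho
        have hS : ∑ t ∈ T, χ (Additive.ofMul t) ≠ 0 := fun h0 =>
          hne ((sum_char_eq_zero_iff_card_eq_eight hexp h h32 χ).1 h0)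
        have hF0 : F χ = 0 := (mul_eq_zero.1 (setSum_mul_typeSum_eq_zero_of_balanced hexp hbal hχ0)).resolve_right hS
        rw [hF0]; ring
  have key : ((if g₀ * x ∈ D then (Fintype.card G : ℂ) else 0) - if ρ * (g₀ * x) ∈ D then (Fintype.card G : ℂ) else 0) =
      ((if x ∈ D then (Fintype.card G : ℂ) else 0) - if ρ * x ∈ D then (Fintype.card G : ℂ) else 0) := by
    rw [hinv, hinv]
    exact Finset.sum_congr rfl fun χ _ => hterm χ
  -- divide by `32`
  rw [h32] at key
  have e : ∀ (P Q : Prop) [Decidable P] [Decidable Q],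
      ((if P then ((32 : ℕ) : ℂ) else 0) - if Q then ((32 : ℕ) : ℂ) else 0) =
        (32 : ℂ) * (((if P then (1 : ℤ) else 0) - if Q then (1 : ℤ) else 0 : ℤ) : ℂ) := by
    intro P Q _ _
    split_ifs <;> push_cast <;> ring
  rw [e, e] at key
  have := mul_left_cancel₀ (by norm_num : (32 : ℂ) ≠ 0) key
  exact_mod_cast this.symm

/-- **★ A CONJUGATION-FREE BALANCED SET IS `g₀`-STABLE**: `x ∈ D ⟹ g₀x ∈ D` (rank `11`, order `32`).
[cite: Pohlmann1968, Thm. 1] [cite: Kubota1965, §4 Lemma 2] [cite: MoonenZarhin1998WeilClasses, Criterion (Q1)] -/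
theorem mul_mem_of_balanced_free (hexp : ∀ g : G, g ^ 2 = 1) (h : IsCMTypeWith ρ (T : Set G))
    (h32 : Fintype.card G = 32) {g₀ : G}
    (hg₀ : ∀ χ : AddChar (Additive G) ℂ, χ (Additive.ofMul ρ) = -1 →
      (((T.filter fun t => χ (Additive.ofMul t) = -1).card = 6 ∨
        (T.filter fun t => χ (Additive.ofMul t) = -1).card = 10) ↔ χ (Additive.ofMul g₀) = -1))
    {D : Finset G} (hfree : ∀ d ∈ D, ρ * d ∉ D)
    (hbal : ∀ x : G, 2 * (D.filter fun d => x * d ∈ T).card = D.card) {x : G} (hx : x ∈ D) : g₀ * x ∈ D := by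
  have key := indicator_sub_eq_of_balanced hexp h h32 hg₀ hbal x
  rw [if_pos hx, if_neg (hfree x hx)] at key
  by_contra hgx
  rw [if_neg hgx] at key
  split_ifs at key <;> omega

/-- **★★ A CONJUGATION-FREE BALANCED SET HAS CARDINALITY DIVISIBLE BY `4`** (rank `11`, order `32`): with `a` one of
the two `±8`-characters (`a(g₀) = 1`, `F(a) = 0`), the halves `{a = ±1} ∩ D` have equal size and each is stable under
the fixed-point-free involution `d ↦ g₀d`.  So there are NO conjugation-free balanced sets of sizes `2, 6, 10, 14` —
on the field side (sequel): in ODD codimension every exceptional Pohlmann set of a simple degenerate CM `16`-fold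
with multiquadratic complex multiplication of degree `32` contains a conjugate pair, i.e. is divisible by a divisor
class on the index sets. [cite: Pohlmann1968, Thm. 1] [cite: MoonenZarhin1998WeilClasses, Criterion (Q1) and Criterion (Q2)]
[cite: Kubota1965, §4 Lemma 2] [cite: Gordon1999HodgeAVSurvey, 9.2.2] -/
theorem four_dvd_card_of_balanced_free (hexp : ∀ g : G, g ^ 2 = 1) (h : IsCMTypeWith ρ (T : Set G))
    (h32 : Fintype.card G = 32) (hr : typeRank G (T : Set G) = 11) {D : Finset G}
    (hfree : ∀ d ∈ D, ρ * d ∉ D) (hbal : ∀ x : G, 2 * (D.filter fun d => x * d ∈ T).card = D.card) :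
    4 ∣ D.card := by
  obtain ⟨h2, h8, -, -, -⟩ := card_classes_of_typeRank_eq_eleven hexp h h32 hr
  obtain ⟨a, b, hab, hAeq⟩ := Finset.card_eq_two.1 h2
  have ha2 : a ∈ ({a, b} : Finset (AddChar (Additive G) ℂ)) := by simp
  rw [← hAeq] at ha2
  obtain ⟨haO, ha'⟩ := Finset.mem_filter.1 ha2
  have ha : a (Additive.ofMul ρ) = -1 := (Finset.mem_filter.1 haO).2
  obtain ⟨g₀, hg1, -, hg₀⟩ := exists_forall_four_iff_apply_eq hexp h h32 hr
  have hag : a (Additive.ofMul g₀) = 1 :=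
    (char_eq_one_or_w hexp a g₀).resolve_right fun h1 => by have := (hg₀ a ha).2 h1; omega
  -- a `±4`-character `π₁` and the even character `c = aπ₁` with `c(g₀) = −1`
  have hne : ((Finset.univ.filter fun χ : AddChar (Additive G) ℂ => χ (Additive.ofMul ρ) = -1).filter
      (fun χ => (T.filter fun s => χ (Additive.ofMul s) = -1).card = 6 ∨
        (T.filter fun s => χ (Additive.ofMul s) = -1).card = 10)).Nonempty := by
    rw [← Finset.card_pos, h8]; norm_num
  obtain ⟨π₁, hπ₁⟩ := hne
  obtain ⟨hπ₁O, hπ₁'⟩ := Finset.mem_filter.1 hπ₁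
  have hπ₁ρ : π₁ (Additive.ofMul ρ) = -1 := (Finset.mem_filter.1 hπ₁O).2
  have hπ₁g : π₁ (Additive.ofMul g₀) = -1 := (hg₀ π₁ hπ₁ρ).1 hπ₁'
  set c := a + π₁ with hc
  have hcg : c (Additive.ofMul g₀) = -1 := by rw [hc, AddChar.add_apply, hag, hπ₁g]; norm_num
  -- `F(a) = 0`: the two halves of `D` have equal size
  have ha0 : a ≠ 0 := by intro h0; rw [h0, AddChar.zero_apply] at ha; norm_num at ha
  have hSa : ∑ t ∈ T, a (Additive.ofMul t) ≠ 0 := fun h0 => by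
    have := (sum_char_eq_zero_iff_card_eq_eight hexp h h32 a).1 h0; omega
  have hFa : ∑ d ∈ D, a (Additive.ofMul d) = 0 :=
    (mul_eq_zero.1 (setSum_mul_typeSum_eq_zero_of_balanced hexp hbal ha0)).resolve_right hSa
  rw [sum_char_eq_w hexp a D] at hFa
  have hhalf : D.card = 2 * (D.filter fun d => a (Additive.ofMul d) = -1).card := by
    have : ((D.card : ℂ)) = 2 * ((D.filter fun d => a (Additive.ofMul d) = -1).card : ℂ) := by
      linear_combination hFa
    exact_mod_cast this
  -- the half `D₋ = {a = −1} ∩ D` is `g₀`-stable and splits evenly along `c`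
  set Dm := D.filter (fun d => a (Additive.ofMul d) = -1) with hDm
  have hstab : ∀ d ∈ Dm, g₀ * d ∈ Dm := by
    intro d hd
    obtain ⟨hdD, had⟩ := Finset.mem_filter.1 hd
    refine Finset.mem_filter.2 ⟨mul_mem_of_balanced_free hexp h h32 hg₀ hfree hbal hdD, ?_⟩
    rw [char_mul_w, hag, had]; norm_num
  have hsplit : (Dm.filter fun d => c (Additive.ofMul d) = 1).card = (Dm.filter fun d => ¬ c (Additive.ofMul d) = 1).card := by
    refine Finset.card_bij (fun d _ => g₀ * d) (fun d hd => ?_) (fun x _ y _ hxy => mul_left_cancel hxy)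
      (fun d hd => ⟨g₀ * d, ?_, by rw [← mul_assoc, mul_self_w hexp, one_mul]⟩)
    · obtain ⟨hdm, hcd⟩ := Finset.mem_filter.1 hd
      refine Finset.mem_filter.2 ⟨hstab d hdm, ?_⟩
      rw [char_mul_w, hcg, hcd]; norm_num
    · obtain ⟨hdm, hcd⟩ := Finset.mem_filter.1 hd
      refine Finset.mem_filter.2 ⟨hstab d hdm, ?_⟩
      rw [char_mul_w, hcg, (char_eq_one_or_w hexp c d).resolve_left hcd]; norm_num
  have hDm2 : Dm.card = 2 * (Dm.filter fun d => c (Additive.ofMul d) = 1).card := by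
    have := Finset.card_filter_add_card_filter_not (s := Dm) (fun d => c (Additive.ofMul d) = 1)
    omega
  rw [hhalf, hDm2]
  exact ⟨(Dm.filter fun d => c (Additive.ofMul d) = 1).card, by ring⟩

/-- **No conjugation-free balanced `6`-sets** (rank `11`, order `32`). [cite: Pohlmann1968, Thm. 1]
[cite: MoonenZarhin1998WeilClasses, Criterion (Q2)] [cite: Gordon1999HodgeAVSurvey, 9.2.2] -/
theorem card_ne_six_of_balanced_free (hexp : ∀ g : G, g ^ 2 = 1) (h : IsCMTypeWith ρ (T : Set G))
    (h32 : Fintype.card G = 32) (hr : typeRank G (T : Set G) = 11) {D : Finset G}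
    (hfree : ∀ d ∈ D, ρ * d ∉ D) (hbal : ∀ x : G, 2 * (D.filter fun d => x * d ∈ T).card = D.card) :
    D.card ≠ 6 := by
  intro h6
  have := four_dvd_card_of_balanced_free hexp h h32 hr hfree hbal
  rw [h6] at this
  omega

end ModFour

/-! ## §10 ★★ The classification: every conjugation-free balanced set is a disjoint union of the `24` cosets (append, g46-#11) -/

section Classification

omit [Fintype G] in
/-- Removing a balanced subset from a balanced set leaves a balanced set. [cite: Gordon1999HodgeAVSurvey, §9.2 (9.2.1)] -/
private theorem balanced_sdiff_w {D C : Finset G} (hCD : C ⊆ D)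
    (hD : ∀ x : G, 2 * (D.filter fun d => x * d ∈ T).card = D.card)
    (hC : ∀ x : G, 2 * (C.filter fun d => x * d ∈ T).card = C.card) :
    ∀ x : G, 2 * ((D \ C).filter fun d => x * d ∈ T).card = (D \ C).card := by
  intro x
  have h1 : ((D \ C).filter fun d => x * d ∈ T) = (D.filter fun d => x * d ∈ T) \ (C.filter fun d => x * d ∈ T) := by
    ext d; simp only [Finset.mem_filter, Finset.mem_sdiff]; tauto
  have hsub : (C.filter fun d => x * d ∈ T) ⊆ D.filter fun d => x * d ∈ T :=
    Finset.filter_subset_filter _ hCD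
  rw [h1, Finset.card_sdiff_of_subset hsub, Finset.card_sdiff_of_subset hCD]
  have := hD x; have := hC x
  have := Finset.card_le_card hsub; have := Finset.card_le_card hCD
  omega

/-- **The two sign classes of `(a, b)` on a conjugation-free balanced `D` are matched**: `#{d ∈ D : a(d) = ε₁,
b(d) = ε₂} = #{d ∈ D : a(d) = −ε₁, b(d) = −ε₂}` (`F(a) = F(b) = 0`). [cite: Kubota1965, §4 Lemma 2]
[cite: Pohlmann1968, Thm. 1] -/
private theorem card_class_eq_w (hexp : ∀ g : G, g ^ 2 = 1) (h : IsCMTypeWith ρ (T : Set G))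
    (h32 : Fintype.card G = 32) {a b : AddChar (Additive G) ℂ} (ha : a (Additive.ofMul ρ) = -1)
    (hb : b (Additive.ofMul ρ) = -1)
    (ha' : (T.filter fun t => a (Additive.ofMul t) = -1).card = 4 ∨
      (T.filter fun t => a (Additive.ofMul t) = -1).card = 12)
    (hb' : (T.filter fun t => b (Additive.ofMul t) = -1).card = 4 ∨
      (T.filter fun t => b (Additive.ofMul t) = -1).card = 12)
    {D : Finset G} (hbal : ∀ x : G, 2 * (D.filter fun d => x * d ∈ T).card = D.card) (ε₁ ε₂ : ℂ)
    (hε₁ : ε₁ = 1 ∨ ε₁ = -1) (hε₂ : ε₂ = 1 ∨ ε₂ = -1) :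
    (D.filter fun d => a (Additive.ofMul d) = ε₁ ∧ b (Additive.ofMul d) = ε₂).card =
      (D.filter fun d => a (Additive.ofMul d) = -ε₁ ∧ b (Additive.ofMul d) = -ε₂).card := by
  -- `F(a) = F(b) = 0`
  have hF0 : ∀ χ : AddChar (Additive G) ℂ, χ (Additive.ofMul ρ) = -1 →
      ((T.filter fun t => χ (Additive.ofMul t) = -1).card = 4 ∨ (T.filter fun t => χ (Additive.ofMul t) = -1).card = 12) →
      D.card = 2 * (D.filter fun d => χ (Additive.ofMul d) = -1).card := by
    intro χ hχ hχ'
    have hχ0 : χ ≠ 0 := by intro h0; rw [h0, AddChar.zero_apply] at hχ; norm_num at hχ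
    have hS : ∑ t ∈ T, χ (Additive.ofMul t) ≠ 0 := fun h0 => by
      have := (sum_char_eq_zero_iff_card_eq_eight hexp h h32 χ).1 h0; omega
    have hF := (mul_eq_zero.1 (setSum_mul_typeSum_eq_zero_of_balanced hexp hbal hχ0)).resolve_right hS
    rw [sum_char_eq_w hexp χ D] at hF
    have : ((D.card : ℂ)) = 2 * ((D.filter fun d => χ (Additive.ofMul d) = -1).card : ℂ) := by
      linear_combination hF
    exact_mod_cast this
  have hA := hF0 a ha ha'
  have hB := hF0 b hb hb'
  -- the four classes
  have hsplitA : ∀ (P : G → Prop) [DecidablePred P], (D.filter P).card =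
      ((D.filter P).filter fun d => b (Additive.ofMul d) = 1).card +
        ((D.filter P).filter fun d => b (Additive.ofMul d) = -1).card := by
    intro P _
    rw [← Finset.card_filter_add_card_filter_not (s := D.filter P) (fun d => b (Additive.ofMul d) = 1)]
    congr 2
    refine Finset.filter_congr fun d _ => ?_
    rcases char_eq_one_or_w hexp b d with h1 | h1 <;> rw [h1] <;> norm_num
  have hsplitB : ∀ (P : G → Prop) [DecidablePred P], (D.filter P).card =
      ((D.filter P).filter fun d => a (Additive.ofMul d) = 1).card +
        ((D.filter P).filter fun d => a (Additive.ofMul d) = -1).card := by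
    intro P _
    rw [← Finset.card_filter_add_card_filter_not (s := D.filter P) (fun d => a (Additive.ofMul d) = 1)]
    congr 2
    refine Finset.filter_congr fun d _ => ?_
    rcases char_eq_one_or_w hexp a d with h1 | h1 <;> rw [h1] <;> norm_num
  have hDa : D.card = (D.filter fun d => a (Additive.ofMul d) = 1).card +
      (D.filter fun d => a (Additive.ofMul d) = -1).card := by
    rw [← Finset.card_filter_add_card_filter_not (s := D) (fun d => a (Additive.ofMul d) = 1)]
    congr 2
    refine Finset.filter_congr fun d _ => ?_
    rcases char_eq_one_or_w hexp a d with h1 | h1 <;> rw [h1] <;> norm_num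
  have hDb : D.card = (D.filter fun d => b (Additive.ofMul d) = 1).card +
      (D.filter fun d => b (Additive.ofMul d) = -1).card := by
    rw [← Finset.card_filter_add_card_filter_not (s := D) (fun d => b (Additive.ofMul d) = 1)]
    congr 2
    refine Finset.filter_congr fun d _ => ?_
    rcases char_eq_one_or_w hexp b d with h1 | h1 <;> rw [h1] <;> norm_num
  -- name the four counts
  have e : ∀ (u v : ℂ), (D.filter fun d => a (Additive.ofMul d) = u ∧ b (Additive.ofMul d) = v) =
      (D.filter fun d => a (Additive.ofMul d) = u).filter fun d => b (Additive.ofMul d) = v := by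
    intro u v; rw [Finset.filter_filter]
  have e' : ∀ (u v : ℂ), ((D.filter fun d => b (Additive.ofMul d) = v).filter fun d => a (Additive.ofMul d) = u) =
      (D.filter fun d => a (Additive.ofMul d) = u).filter fun d => b (Additive.ofMul d) = v := by
    intro u v; rw [Finset.filter_filter, Finset.filter_filter]
    exact Finset.filter_congr fun d _ => and_comm
  have h1 := hsplitA (fun d => a (Additive.ofMul d) = 1)
  have h2 := hsplitA (fun d => a (Additive.ofMul d) = -1)
  have h3 := hsplitB (fun d => b (Additive.ofMul d) = 1)
  have h4 := hsplitB (fun d => b (Additive.ofMul d) = -1)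
  rw [e', e'] at h3 h4
  -- solve
  rcases hε₁ with rfl | rfl <;> rcases hε₂ with rfl | rfl <;> rw [e, e] <;> norm_num <;> omega

/-- **ONE COSET INSIDE**: a non-empty conjugation-free balanced `D` contains a coset of a balanced index-`8` subgroup
`H ∌ ρ` (rank `11`, order `32`): for `x ∈ D` and `y ∈ D` in the opposite `(a, b)`-class, `{x, g₀x, y, g₀y}` is a coset
of `H = {1, g₀, xy, g₀xy}`. [cite: Pohlmann1968, Thm. 1] [cite: MoonenZarhin1998WeilClasses, Criterion (Q1)]
[cite: Kubota1965, §4 Lemma 2] -/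
theorem exists_coset_subset_of_balanced_free (hexp : ∀ g : G, g ^ 2 = 1) (h : IsCMTypeWith ρ (T : Set G))
    (h32 : Fintype.card G = 32) (hr : typeRank G (T : Set G) = 11) {D : Finset G} (hne : D.Nonempty)
    (hfree : ∀ d ∈ D, ρ * d ∉ D) (hbal : ∀ x : G, 2 * (D.filter fun d => x * d ∈ T).card = D.card) :
    ∃ H : Subgroup G, H.index = 8 ∧ ρ ∉ H ∧ (∀ x : G, 2 * (T.filter fun t => x * t ∈ H).card = Nat.card H) ∧
      ∃ x₀ : G, (Finset.univ.filter fun t : G => x₀ * t ∈ H) ⊆ D := by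
  have hρ2 := rho_mul_rho_w h
  have hρ1 := rho_ne_one_w h
  obtain ⟨h2, -, -, -, -⟩ := card_classes_of_typeRank_eq_eleven hexp h h32 hr
  obtain ⟨a, b, hab, hAeq⟩ := Finset.card_eq_two.1 h2
  have ha2 : a ∈ ({a, b} : Finset (AddChar (Additive G) ℂ)) := by simp
  have hb2 : b ∈ ({a, b} : Finset (AddChar (Additive G) ℂ)) := by simp
  rw [← hAeq] at ha2 hb2
  obtain ⟨haO, ha'⟩ := Finset.mem_filter.1 ha2
  obtain ⟨hbO, hb'⟩ := Finset.mem_filter.1 hb2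
  have ha : a (Additive.ofMul ρ) = -1 := (Finset.mem_filter.1 haO).2
  have hb : b (Additive.ofMul ρ) = -1 := (Finset.mem_filter.1 hbO).2
  obtain ⟨g₀, hg1, hgρ, hg₀⟩ := exists_forall_four_iff_apply_eq hexp h h32 hr
  have hag : a (Additive.ofMul g₀) = 1 :=
    (char_eq_one_or_w hexp a g₀).resolve_right fun h1 => by have := (hg₀ a ha).2 h1; omega
  have hbg : b (Additive.ofMul g₀) = 1 :=
    (char_eq_one_or_w hexp b g₀).resolve_right fun h1 => by have := (hg₀ b hb).2 h1; omega
  have hstab : ∀ x ∈ D, g₀ * x ∈ D := fun x hx => mul_mem_of_balanced_free hexp h h32 hg₀ hfree hbal hx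
  -- `x ∈ D` and a partner `y` in the opposite class
  obtain ⟨x, hx⟩ := hne
  have hcls := card_class_eq_w hexp h h32 ha hb ha' hb' hbal (a (Additive.ofMul x)) (b (Additive.ofMul x))
    (char_eq_one_or_w hexp a x) (char_eq_one_or_w hexp b x)
  have hpos : 0 < (D.filter fun d => a (Additive.ofMul d) = -a (Additive.ofMul x) ∧
      b (Additive.ofMul d) = -b (Additive.ofMul x)).card := by
    rw [← hcls, Finset.card_pos]
    exact ⟨x, Finset.mem_filter.2 ⟨hx, rfl, rfl⟩⟩
  obtain ⟨y, hy⟩ := Finset.card_pos.1 hpos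
  obtain ⟨hyD, hay, hby⟩ := Finset.mem_filter.1 hy
  -- the subgroup `H = ⟨g₀, xy⟩`
  set k := x * y with hk
  have hak : a (Additive.ofMul k) = -1 := by
    rw [hk, char_mul_w, hay]
    rcases char_eq_one_or_w hexp a x with h1 | h1 <;> rw [h1] <;> norm_num
  have hbk : b (Additive.ofMul k) = -1 := by
    rw [hk, char_mul_w, hby]
    rcases char_eq_one_or_w hexp b x with h1 | h1 <;> rw [h1] <;> norm_num
  have hkz : k ∉ Subgroup.zpowers g₀ := by
    intro hz
    rw [mem_zpowers_iff_w hexp] at hz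
    rcases hz with h1 | h1
    · rw [h1, char_one_w] at hak; norm_num at hak
    · rw [h1, hag] at hak; norm_num at hak
  have hz2 : Nat.card (Subgroup.zpowers g₀) = 2 := by
    have := natCard_sup_zpowers_w hexp (⊥ : Subgroup G) (c := g₀) (by rwa [Subgroup.mem_bot])
    rwa [bot_sup_eq, Subgroup.card_bot, mul_one] at this
  set H := Subgroup.zpowers g₀ ⊔ Subgroup.zpowers k with hH
  have hcardH : Nat.card H = 4 := by rw [hH, natCard_sup_zpowers_w hexp _ hkz, hz2]
  have hidx : H.index = 8 := by
    have := H.card_mul_index; rw [hcardH, Nat.card_eq_fintype_card (α := G), h32] at this; omega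
  have hmemH : ∀ z : G, z ∈ H ↔ (z = 1 ∨ z = g₀) ∨ (k * z = 1 ∨ k * z = g₀) := by
    intro z; rw [hH, mem_sup_zpowers_iff_w hexp, mem_zpowers_iff_w hexp, mem_zpowers_iff_w hexp]
  have hmul_eq_one : ∀ u v : G, u * v = 1 → v = u := by
    intro u v huv
    have : u * v = u * u := by rw [huv, mul_self_w hexp]
    exact mul_left_cancel this
  have hρH : ρ ∉ H := by
    rw [hmemH]
    push Not
    refine ⟨⟨hρ1, fun h1 => hgρ h1.symm⟩, fun h1 => ?_, fun h1 => ?_⟩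
    · -- `k ρ = 1` ⟹ `y = ρ x`
      have hρk : ρ = k := hmul_eq_one k ρ h1
      apply hfree x hx
      have : ρ * x = y := by rw [hρk, hk, mul_comm x y, mul_assoc, mul_self_w hexp, mul_one]
      rw [this]; exact hyD
    · -- `k ρ = g₀` ⟹ `y = ρ g₀ x`
      apply hfree (g₀ * x) (hstab x hx)
      have : ρ * (g₀ * x) = y := by
        rw [← h1, hk]
        calc ρ * (x * y * ρ * x) = (ρ * ρ) * (x * x) * y := by simp only [mul_comm, mul_left_comm]
          _ = y := by rw [hρ2, mul_self_w hexp, one_mul, one_mul]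
      rw [this]; exact hyD
  have hkH : k ∈ H := Subgroup.mem_sup_right (Subgroup.mem_zpowers k)
  have hbalH := (forall_coset_iff_of_index_eight hexp h h32 hr ha hb hab ha' hb' hg₀ hidx hρH).2
    ⟨Subgroup.mem_sup_left (Subgroup.mem_zpowers g₀), ⟨k, hkH, hak⟩, ⟨k, hkH, hbk⟩⟩
  refine ⟨H, hidx, hρH, hbalH, x, fun t ht => ?_⟩
  rw [Finset.mem_filter, hmemH] at ht
  rcases ht.2 with (h1 | h1) | (h1 | h1)
  · rw [hmul_eq_one x t h1]; exact hx
  · have : t = g₀ * x := by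
      calc t = x * x * t := by rw [mul_self_w hexp, one_mul]
        _ = x * (x * t) := by rw [mul_assoc]
        _ = g₀ * x := by rw [h1, mul_comm]
    rw [this]; exact hstab x hx
  · -- `k x t = 1` ⟹ `t = y`
    have : t = y := by
      have h' : x * y * (x * t) = y * t := by
        calc x * y * (x * t) = x * x * (y * t) := by simp only [mul_comm, mul_left_comm]
          _ = y * t := by rw [mul_self_w hexp, one_mul]
      rw [hk] at h1; rw [h'] at h1
      exact hmul_eq_one y t h1
    rw [this]; exact hyD
  · have : t = g₀ * y := by
      have h' : x * y * (x * t) = y * t := by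
        calc x * y * (x * t) = x * x * (y * t) := by simp only [mul_comm, mul_left_comm]
          _ = y * t := by rw [mul_self_w hexp, one_mul]
      rw [hk] at h1; rw [h'] at h1
      calc t = y * y * t := by rw [mul_self_w hexp, one_mul]
        _ = y * (y * t) := by rw [mul_assoc]
        _ = g₀ * y := by rw [h1, mul_comm]
    rw [this]; exact hstab y hyD

/-- **★★ THE CLASSIFICATION OF THE CONJUGATION-FREE BALANCED SETS** (rank `11`, order `32`): every conjugation-free
`T`-balanced `D ⊆ G` is a DISJOINT UNION OF COSETS of balanced index-`8` subgroups avoiding `ρ` — of the `24` cosets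
of the three Weil subgroups.  Field side (sequel): every exceptional Pohlmann set of a simple degenerate CM `16`-fold
with multiquadratic complex multiplication of degree `32` is a disjoint union of Weil `4`-sets of the three octic Weil
subfields and conjugate pairs — Pohlmann's basis of `B^•(A) ⊗ ℂ` consists of products of divisor monomials and the
`24` Weil monomials of codimension `2`. [cite: Pohlmann1968, Thm. 1] [cite: MoonenZarhin1998WeilClasses, Criterion (Q1) and Criterion (Q2)]
[cite: Kubota1965, §4 Lemma 2] [cite: Gordon1999HodgeAVSurvey, §9.2 (9.2.1) and 9.2.2] -/
theorem exists_cosets_of_balanced_free (hexp : ∀ g : G, g ^ 2 = 1) (h : IsCMTypeWith ρ (T : Set G))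
    (h32 : Fintype.card G = 32) (hr : typeRank G (T : Set G) = 11) (D : Finset G)
    (hfree : ∀ d ∈ D, ρ * d ∉ D) (hbal : ∀ x : G, 2 * (D.filter fun d => x * d ∈ T).card = D.card) :
    ∃ 𝒞 : Finset (Finset G),
      (∀ C ∈ 𝒞, ∃ H : Subgroup G, H.index = 8 ∧ ρ ∉ H ∧
        (∀ x : G, 2 * (T.filter fun t => x * t ∈ H).card = Nat.card H) ∧
        ∃ x₀ : G, C = Finset.univ.filter fun t : G => x₀ * t ∈ H) ∧
      (∀ C ∈ 𝒞, ∀ C' ∈ 𝒞, C ≠ C' → Disjoint C C') ∧ D = 𝒞.biUnion id := by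
  induction' hn : D.card using Nat.strong_induction_on with n ih generalizing D
  rcases D.eq_empty_or_nonempty with rfl | hne
  · exact ⟨∅, fun C hC => absurd hC (Finset.notMem_empty C), fun C hC => absurd hC (Finset.notMem_empty C), by simp⟩
  obtain ⟨H, hH, hρH, hbalH, x₀, hsub⟩ := exists_coset_subset_of_balanced_free hexp h h32 hr hne hfree hbal
  set C := Finset.univ.filter (fun t : G => x₀ * t ∈ H) with hC
  obtain ⟨hC4, -, hCbal⟩ := coset_balanced_four hexp h32 hH hρH hbalH x₀
  have hlt : (D \ C).card < n := by
    rw [← hn, Finset.card_sdiff_of_subset hsub, hC4]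
    have : 4 ≤ D.card := hC4 ▸ Finset.card_le_card hsub
    omega
  obtain ⟨𝒞', h𝒞'1, h𝒞'2, h𝒞'3⟩ := ih _ hlt (D \ C) (fun d hd hd' => hfree d (Finset.mem_sdiff.1 hd).1
    (Finset.mem_sdiff.1 hd').1) (balanced_sdiff_w hsub hbal hCbal) rfl
  refine ⟨insert C 𝒞', ?_, ?_, ?_⟩
  · intro C₁ hC₁
    rcases Finset.mem_insert.1 hC₁ with rfl | hC₁
    · exact ⟨H, hH, hρH, hbalH, x₀, rfl⟩
    · exact h𝒞'1 C₁ hC₁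
  · have hdisjC : ∀ C' ∈ 𝒞', Disjoint C C' := by
      intro C' hC'
      have hC'sub : C' ⊆ D \ C := by rw [h𝒞'3]; exact Finset.subset_biUnion_of_mem id hC'
      exact Finset.disjoint_of_subset_right hC'sub Finset.disjoint_sdiff
    intro C₁ hC₁ C₂ hC₂ hne12
    rcases Finset.mem_insert.1 hC₁ with rfl | hC₁ <;> rcases Finset.mem_insert.1 hC₂ with rfl | hC₂
    · exact absurd rfl hne12
    · exact hdisjC C₂ hC₂
    · exact (hdisjC C₁ hC₁).symm
    · exact h𝒞'2 C₁ hC₁ C₂ hC₂ hne12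
  · rw [Finset.biUnion_insert, id, ← h𝒞'3, Finset.union_sdiff_of_subset hsub]

end Classification

/-! ## §11 ★ An effective test: balanced ⟺ `g₀`-stable with `F(a) = F(b) = 0` (append, g46-#14) -/

section Test

/-- **★ THE EFFECTIVE CRITERION** (rank `11`, order `32`).  A conjugation-free `D ⊆ G` is `T`-balanced
(`2·#(xD ∩ T) = |D|` for all `x`) **iff** it is `g₀`-stable and the two characters `a, b` with `Ŝ_T = ∓8` sum to
zero on it: `g₀D = D`, `Σ_D a = Σ_D b = 0`.  (`⟹`: §9 and `F·Ŝ_T = 0`; `⟸`: Fourier inversion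
`|G|·#(xD ∩ T) = Σ_χ F(χ) Ŝ_T(χ) χ(x)`, where `F(χ) = 0` for `χ(g₀) = −1` by `g₀`-stability, `Ŝ_T(χ) = 0` for the
even `χ ≠ 1` and for the Weil characters, and `F(a) = F(b) = 0`.)  With §10 this makes the Weil decomposition of a
Pohlmann index set checkable by three linear conditions. [cite: Pohlmann1968, Thm. 1] [cite: Kubota1965, §4 Lemma 2]
[cite: MoonenZarhin1998WeilClasses, Criterion (Q1)] [cite: MontgomeryVaughan2007, §4.2, Lemma 4.2] -/
theorem balanced_iff_of_free (hexp : ∀ g : G, g ^ 2 = 1) (h : IsCMTypeWith ρ (T : Set G))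
    (h32 : Fintype.card G = 32) (hr : typeRank G (T : Set G) = 11) {a b : AddChar (Additive G) ℂ}
    (ha : a (Additive.ofMul ρ) = -1) (hb : b (Additive.ofMul ρ) = -1) (hab : a ≠ b)
    (ha' : (T.filter fun t => a (Additive.ofMul t) = -1).card = 4 ∨
      (T.filter fun t => a (Additive.ofMul t) = -1).card = 12)
    (hb' : (T.filter fun t => b (Additive.ofMul t) = -1).card = 4 ∨
      (T.filter fun t => b (Additive.ofMul t) = -1).card = 12)
    {g₀ : G} (hg₀ : ∀ χ : AddChar (Additive G) ℂ, χ (Additive.ofMul ρ) = -1 →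
      (((T.filter fun t => χ (Additive.ofMul t) = -1).card = 6 ∨
        (T.filter fun t => χ (Additive.ofMul t) = -1).card = 10) ↔ χ (Additive.ofMul g₀) = -1))
    {D : Finset G} (hfree : ∀ d ∈ D, ρ * d ∉ D) :
    (∀ x : G, 2 * (D.filter fun d => x * d ∈ T).card = D.card) ↔
      (∀ d ∈ D, g₀ * d ∈ D) ∧ ∑ d ∈ D, a (Additive.ofMul d) = 0 ∧ ∑ d ∈ D, b (Additive.ofMul d) = 0 := by
  have hT16 := card_T_w h h32
  -- `F(χ) = 0` from balancedness when `Ŝ(χ) ≠ 0`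
  have hF0 : (∀ x : G, 2 * (D.filter fun d => x * d ∈ T).card = D.card) →
      ∀ χ : AddChar (Additive G) ℂ, χ (Additive.ofMul ρ) = -1 →
      ((T.filter fun t => χ (Additive.ofMul t) = -1).card = 4 ∨ (T.filter fun t => χ (Additive.ofMul t) = -1).card = 12) →
      ∑ d ∈ D, χ (Additive.ofMul d) = 0 := by
    intro hbal χ hχ hχ'
    have hχ0 : χ ≠ 0 := by intro h0; rw [h0, AddChar.zero_apply] at hχ; norm_num at hχ
    have hS : ∑ t ∈ T, χ (Additive.ofMul t) ≠ 0 := fun h0 => by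
      have := (sum_char_eq_zero_iff_card_eq_eight hexp h h32 χ).1 h0; omega
    exact (mul_eq_zero.1 (setSum_mul_typeSum_eq_zero_of_balanced hexp hbal hχ0)).resolve_right hS
  refine ⟨fun hbal => ⟨fun d hd => mul_mem_of_balanced_free hexp h h32 hg₀ hfree hbal hd, hF0 hbal a ha ha',
    hF0 hbal b hb hb'⟩, fun ⟨hstab, hFa, hFb⟩ => ?_⟩
  -- `⟸`: every product `F(χ) Ŝ(χ)` with `χ ≠ 1` vanishes
  have hA2 := (card_classes_of_typeRank_eq_eleven hexp h h32 hr).1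
  have hprod : ∀ χ : AddChar (Additive G) ℂ, χ ≠ 0 →
      (∑ d ∈ D, χ (Additive.ofMul d)) * ∑ t ∈ T, χ (Additive.ofMul t) = 0 := by
    intro χ hχ0
    rcases char_eq_one_or_w hexp χ ρ with hev | hodd
    · rw [sum_char_eq_zero_of_even h hev hχ0, mul_zero]
    · rcases char_eq_one_or_w hexp χ g₀ with hg1 | hg1
      · -- `χ(g₀) = 1`: `χ` is `a`, `b` or a Weil character
        have hnot : ¬ ((T.filter fun t => χ (Additive.ofMul t) = -1).card = 6 ∨
            (T.filter fun t => χ (Additive.ofMul t) = -1).card = 10) := by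
          intro h6; have := (hg₀ χ hodd).1 h6; rw [hg1] at this; norm_num at this
        rcases card_filter_mem_of_typeRank_eq_eleven hexp h h32 hr hodd with h412 | h610 | h8
        rotate_left
        · exact absurd h610 hnot
        · rw [(sum_char_eq_zero_iff_card_eq_eight hexp h h32 χ).2 h8, mul_zero]
        · -- `#{χ = −1 on T} ∈ {4, 12}`: `χ ∈ {a, b}`
          have hmem : χ ∈ ((Finset.univ.filter fun χ : AddChar (Additive G) ℂ => χ (Additive.ofMul ρ) = -1).filter
              fun χ => (T.filter fun t => χ (Additive.ofMul t) = -1).card = 4 ∨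
                (T.filter fun t => χ (Additive.ofMul t) = -1).card = 12) :=
            Finset.mem_filter.2 ⟨Finset.mem_filter.2 ⟨Finset.mem_univ _, hodd⟩, h412⟩
          have hmemab : a ∈ ((Finset.univ.filter fun χ : AddChar (Additive G) ℂ => χ (Additive.ofMul ρ) = -1).filter
              fun χ => (T.filter fun t => χ (Additive.ofMul t) = -1).card = 4 ∨
                (T.filter fun t => χ (Additive.ofMul t) = -1).card = 12) ∧
              b ∈ ((Finset.univ.filter fun χ : AddChar (Additive G) ℂ => χ (Additive.ofMul ρ) = -1).filter
              fun χ => (T.filter fun t => χ (Additive.ofMul t) = -1).card = 4 ∨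
                (T.filter fun t => χ (Additive.ofMul t) = -1).card = 12) :=
            ⟨Finset.mem_filter.2 ⟨Finset.mem_filter.2 ⟨Finset.mem_univ _, ha⟩, ha'⟩,
              Finset.mem_filter.2 ⟨Finset.mem_filter.2 ⟨Finset.mem_univ _, hb⟩, hb'⟩⟩
          obtain ⟨u, v, huv, heq⟩ := Finset.card_eq_two.1 hA2
          rw [heq] at hmem hmemab
          simp only [Finset.mem_insert, Finset.mem_singleton] at hmem hmemab
          have hχab : χ = a ∨ χ = b := by
            rcases hmemab with ⟨ha1 | ha1, hb1 | hb1⟩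
            · exact absurd (ha1.trans hb1.symm) hab
            · rcases hmem with h1 | h1
              · exact Or.inl (h1.trans ha1.symm)
              · exact Or.inr (h1.trans hb1.symm)
            · rcases hmem with h1 | h1
              · exact Or.inr (h1.trans hb1.symm)
              · exact Or.inl (h1.trans ha1.symm)
            · exact absurd (ha1.trans hb1.symm) hab
          rcases hχab with rfl | rfl
          · rw [hFa, zero_mul]
          · rw [hFb, zero_mul]
      · -- `χ(g₀) = −1`: `F(χ) = 0` by `g₀`-stability
        have hinv : ∀ d ∈ D, g₀ * (g₀ * d) = d := fun d _ => by rw [← mul_assoc, mul_self_w hexp, one_mul]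
        have hF : ∑ d ∈ D, χ (Additive.ofMul d) = ∑ d ∈ D, χ (Additive.ofMul (g₀ * d)) :=
          (Finset.sum_nbij' (fun d => g₀ * d) (fun d => g₀ * d) (fun d hd => hstab d hd) (fun d hd => hstab d hd)
            hinv hinv (fun d _ => rfl)).symm
        have hF' : ∑ d ∈ D, χ (Additive.ofMul (g₀ * d)) = -∑ d ∈ D, χ (Additive.ofMul d) := by
          rw [← Finset.sum_neg_distrib]
          refine Finset.sum_congr rfl fun d _ => ?_
          rw [char_mul_w, hg1]; ring
        have : ∑ d ∈ D, χ (Additive.ofMul d) = 0 := by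
          have h2 := hF.trans hF'
          linear_combination h2 / 2
        rw [this, zero_mul]
  -- Fourier inversion for `#(xD ∩ T)`
  intro x
  have hind : ∀ d : G, (if x * d ∈ T then (Fintype.card G : ℂ) else 0) =
      ∑ χ : AddChar (Additive G) ℂ, (∑ t ∈ T, χ (Additive.ofMul t)) * χ (Additive.ofMul (x * d)) :=
    fun d => card_mul_indicator_eq_sum hexp T (x * d)
  have hsum : ((Fintype.card G : ℂ)) * ((D.filter fun d => x * d ∈ T).card : ℂ) =
      ∑ χ : AddChar (Additive G) ℂ, (∑ t ∈ T, χ (Additive.ofMul t)) * χ (Additive.ofMul x) *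
        ∑ d ∈ D, χ (Additive.ofMul d) := by
    have h1 : ((Fintype.card G : ℂ)) * ((D.filter fun d => x * d ∈ T).card : ℂ) =
        ∑ d ∈ D, (if x * d ∈ T then (Fintype.card G : ℂ) else 0) := by
      rw [Finset.sum_ite, Finset.sum_const_zero, add_zero, Finset.sum_const, nsmul_eq_mul, mul_comm]
    rw [h1, Finset.sum_congr rfl fun d _ => hind d, Finset.sum_comm]
    refine Finset.sum_congr rfl fun χ _ => ?_
    rw [Finset.mul_sum]
    refine Finset.sum_congr rfl fun d _ => ?_
    rw [char_mul_w]; ring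
  have hvan : ∑ χ : AddChar (Additive G) ℂ, (∑ t ∈ T, χ (Additive.ofMul t)) * χ (Additive.ofMul x) *
      ∑ d ∈ D, χ (Additive.ofMul d) = (T.card : ℂ) * D.card := by
    rw [Finset.sum_eq_single (0 : AddChar (Additive G) ℂ)]
    · simp only [AddChar.zero_apply, Finset.sum_const, nsmul_eq_mul, mul_one]
    · intro χ _ hχ0
      have := hprod χ hχ0
      calc (∑ t ∈ T, χ (Additive.ofMul t)) * χ (Additive.ofMul x) * ∑ d ∈ D, χ (Additive.ofMul d)
          = χ (Additive.ofMul x) * ((∑ d ∈ D, χ (Additive.ofMul d)) * ∑ t ∈ T, χ (Additive.ofMul t)) := by ring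
        _ = 0 := by rw [this, mul_zero]
    · intro h0; exact absurd (Finset.mem_univ _) h0
  rw [hvan, h32, hT16] at hsum
  have : (32 : ℂ) * ((D.filter fun d => x * d ∈ T).card : ℂ) = 16 * (D.card : ℂ) := by exact_mod_cast hsum
  have h' : ((2 * (D.filter fun d => x * d ∈ T).card : ℕ) : ℂ) = (D.card : ℂ) := by
    push_cast; linear_combination this / 16
  exact_mod_cast h'

end Test

/-! ## §12 No Weil subgroups of index `16` or `32`: a balanced `H ∌ ρ` has `|H| ≥ 4` (append, g46-#15) -/

section IndexBound

omit [DecidableEq G] in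
/-- `4 · #{χ odd : χ(h) = 1} = |G|` for `h ∉ {1, ρ}` (`Σ_χ (1 − χ(ρ))(1 + χ(h)) = |G|`). [folklore] -/
private theorem four_mul_card_odd_apply_eq_one_w (hexp : ∀ g : G, g ^ 2 = 1) {h : G} (h1 : h ≠ 1) (hρ1 : ρ ≠ 1)
    (hhρ : h ≠ ρ) :
    4 * (Finset.univ.filter fun χ : AddChar (Additive G) ℂ =>
      χ (Additive.ofMul ρ) = -1 ∧ χ (Additive.ofMul h) = 1).card = Fintype.card G := by
  have hρh : ρ * h ≠ 1 := by
    intro h0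
    have : h = ρ := by
      calc h = ρ * ρ * h := by rw [mul_self_w hexp, one_mul]
        _ = ρ := by rw [mul_assoc, h0, mul_one]
    exact hhρ this
  have hkey : ∀ χ : AddChar (Additive G) ℂ, (1 - χ (Additive.ofMul ρ)) * (1 + χ (Additive.ofMul h)) =
      if χ (Additive.ofMul ρ) = -1 ∧ χ (Additive.ofMul h) = 1 then (4 : ℂ) else 0 := by
    intro χ
    rcases char_eq_one_or_w hexp χ ρ with hr | hr <;> rcases char_eq_one_or_w hexp χ h with hh | hh <;>
      simp only [hr, hh] <;> norm_num
  have hsum : ∑ χ : AddChar (Additive G) ℂ, (1 - χ (Additive.ofMul ρ)) * (1 + χ (Additive.ofMul h)) =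
      (Fintype.card G : ℂ) := by
    have e : ∀ χ : AddChar (Additive G) ℂ, (1 - χ (Additive.ofMul ρ)) * (1 + χ (Additive.ofMul h)) =
        χ (Additive.ofMul (1 : G)) + χ (Additive.ofMul h) - χ (Additive.ofMul ρ) - χ (Additive.ofMul (ρ * h)) := by
      intro χ; rw [char_one_w, char_mul_w]; ring
    rw [Finset.sum_congr rfl fun χ _ => e χ, Finset.sum_sub_distrib, Finset.sum_sub_distrib, Finset.sum_add_distrib,
      sum_char_apply_eq_ite_w, sum_char_apply_eq_ite_w, sum_char_apply_eq_ite_w, sum_char_apply_eq_ite_w,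
      if_pos rfl, if_neg h1, if_neg hρ1, if_neg hρh]
    ring
  rw [Finset.sum_congr rfl fun χ _ => hkey χ, Finset.sum_ite, Finset.sum_const_zero, add_zero, Finset.sum_const,
    nsmul_eq_mul, mul_comm] at hsum
  exact_mod_cast hsum

/-- **NO WEIL SUBGROUPS OF INDEX `16` OR `32`** (rank `11`, order `32`): if `ρ ∉ H` and all cosets of `H` are
`T`-balanced then `|H| ≥ 4` — the odd characters trivial on `H` must all be Weil characters (`Ŝ_T = 0`, tree
`forall_coset_iff_forall_oddChar`), there are only `6` of those, but `|H| ≤ 2` leaves at least `8` odd characters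
trivial on `H`.  Field side: a CM type of rank `11` of a multiquadratic CM field of degree `32` is of Weil type over
NO CM subfield of degree `16` or `32`. [cite: MoonenZarhin1998WeilClasses, Criterion (Q1)]
[cite: Kubota1965, §4 Lemma 2] [cite: Dodson1984, §3.1.1 Theorem] -/
theorem four_le_natCard_of_balanced (hexp : ∀ g : G, g ^ 2 = 1) (h : IsCMTypeWith ρ (T : Set G))
    (h32 : Fintype.card G = 32) (hr : typeRank G (T : Set G) = 11) {H : Subgroup G} (hρ : ρ ∉ H)
    (hbal : ∀ x : G, 2 * (T.filter fun t => x * t ∈ H).card = Nat.card H) : 4 ≤ Nat.card H := by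
  have hρ1 := rho_ne_one_w h
  by_contra hlt
  push Not at hlt
  -- the odd characters trivial on `H` are Weil characters
  have hW := (Literature.NumberTheory.ComplexMultiplication.BalancedCosets.forall_coset_iff_forall_oddChar hexp h H).1
    hbal
  obtain ⟨-, -, h6, -, -⟩ := card_classes_of_typeRank_eq_eleven hexp h h32 hr
  set W : Finset (AddChar (Additive G) ℂ) := (Finset.univ.filter fun χ : AddChar (Additive G) ℂ =>
    χ (Additive.ofMul ρ) = -1).filter fun χ => (T.filter fun s => χ (Additive.ofMul s) = -1).card = 8 with hWdef
  -- an element `h' ∉ {1, ρ}` with `H ⊆ {1, h'}`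
  obtain ⟨h', h'1, h'ρ, hH⟩ : ∃ h' : G, h' ≠ 1 ∧ h' ≠ ρ ∧ ∀ k ∈ H, k = 1 ∨ k = h' := by
    by_cases hex : ∃ k ∈ H, k ≠ 1
    · obtain ⟨k, hk, hk1⟩ := hex
      refine ⟨k, hk1, fun e => hρ (e ▸ hk), fun k' hk' => ?_⟩
      by_contra hne
      push Not at hne
      have hcard : Nat.card H = (Finset.univ.filter fun g : G => g ∈ H).card := by
        rw [Nat.card_eq_fintype_card, ← Fintype.card_subtype]
      have hsub : ({1, k, k'} : Finset G) ⊆ Finset.univ.filter fun g : G => g ∈ H := by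
        intro g hg
        simp only [Finset.mem_insert, Finset.mem_singleton] at hg
        rw [Finset.mem_filter]
        rcases hg with rfl | rfl | rfl
        · exact ⟨Finset.mem_univ _, H.one_mem⟩
        · exact ⟨Finset.mem_univ _, hk⟩
        · exact ⟨Finset.mem_univ _, hk'⟩
      have h3 : ({1, k, k'} : Finset G).card = 3 := by
        rw [Finset.card_insert_of_notMem, Finset.card_pair hne.2.symm]
        simp only [Finset.mem_insert, Finset.mem_singleton, not_or]
        exact ⟨hk1.symm, hne.1.symm⟩
      have := Finset.card_le_card hsub
      rw [h3, ← hcard] at this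
      have hc3 : Nat.card H = 3 := by omega
      have hdvd := Subgroup.card_subgroup_dvd_card H
      rw [hc3, Nat.card_eq_fintype_card, h32] at hdvd
      norm_num at hdvd
    · push Not at hex
      obtain ⟨g₀, hg1, hgρ, -⟩ := exists_forall_four_iff_apply_eq hexp h h32 hr
      exact ⟨g₀, hg1, hgρ, fun k hk => Or.inl (hex k hk)⟩
  -- the `8` odd characters trivial at `h'` are trivial on `H`, hence Weil
  have hsub : (Finset.univ.filter fun χ : AddChar (Additive G) ℂ =>
      χ (Additive.ofMul ρ) = -1 ∧ χ (Additive.ofMul h') = 1) ⊆ W := by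
    intro χ hχ
    obtain ⟨-, hodd, hh'⟩ := Finset.mem_filter.1 hχ
    rw [hWdef, Finset.mem_filter]
    refine ⟨Finset.mem_filter.2 ⟨Finset.mem_univ _, hodd⟩,
      (sum_char_eq_zero_iff_card_eq_eight hexp h h32 χ).1 (hW χ hodd fun k hk => ?_)⟩
    rcases hH k hk with rfl | rfl
    · exact char_one_w χ
    · exact hh'
  have h8 := four_mul_card_odd_apply_eq_one_w (ρ := ρ) hexp h'1 hρ1 h'ρ
  rw [h32] at h8
  have := Finset.card_le_card hsub
  rw [h6] at this
  omega

/-- **… equivalently the index of a balanced `H ∌ ρ` is at most `8`**: the Weil CM subfields of the field side have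
degree `2`, `4` or `8` only. [cite: MoonenZarhin1998WeilClasses, Criterion (Q1)] [cite: Dodson1984, §3.1.1 Theorem] -/
theorem index_le_eight_of_balanced (hexp : ∀ g : G, g ^ 2 = 1) (h : IsCMTypeWith ρ (T : Set G))
    (h32 : Fintype.card G = 32) (hr : typeRank G (T : Set G) = 11) {H : Subgroup G} (hρ : ρ ∉ H)
    (hbal : ∀ x : G, 2 * (T.filter fun t => x * t ∈ H).card = Nat.card H) : H.index ≤ 8 := by
  have h4 := four_le_natCard_of_balanced hexp h h32 hr hρ hbal
  have := H.card_mul_index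
  rw [Nat.card_eq_fintype_card (α := G), h32] at this
  nlinarith [H.index.zero_le]

end IndexBound

end BalancedCosetsThirtyTwo

end Literature.NumberTheory.ComplexMultiplication
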